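import Literature.Combinatorics.Optimization.PatternMatrixPsdRank
import Literature.Combinatorics.Optimization.PsdRankBasicProperties
import Literature.Combinatorics.Optimization.PsdFactorNorms
import Literature.Combinatorics.Optimization.BrauerWeylCliffordMatrices
import Mathlib.RingTheory.RootsOfUnity.Complex
import HarnessLib

/-!
# Completely positive semidefinite matrices and the cpsd-rank (Prakash–Sikora–Varvitsiotis–Wei 2017)

Source: A. Prakash, J. Sikora, A. Varvitsiotis, Z. Wei, *Completely positive semidefinite rank*,
Math. Program. 171 (2018) 397–431 = arXiv:1604.07199 [PrakashEtAl2017]; held text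
`paper:arxiv-1604.07199` (arXiv source; theorem numbers of that version, `pNN` = held-text chunk).
Companion of the Fawzi–Gouveia–Parrilo–Robinson–Thomas psd-rank files in this directory
(`PsdRankBasicProperties`, `PsdRankComparisons`, `PsdLiftSlackMatrix`): the cpsd-rank is the
SYMMETRIC (Gram) analogue of the psd rank — one family of psd matrices `P_i` with
`X_{ij} = Tr(P_i P_j)` — "introduced in [FGPRT] as a variant of the psd-rank" (p04).

Vocabulary (new; nothing of the kind exists in Mathlib or the tree — searched `CompletelyPositive`,
`cpsd`, `lorentzCone`, `elliptope` declarations):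
* `HasCpsdFactorization X d` — Definition 1 (p04): Hermitian psd `P_1,…,P_n ∈ H^d_+` (complex) with
  `X_{ij} = Tr(P_i P_j)`; "`cpsd-rank(X) ≤ d`". `IsCpsd X` — the cone `CS_+^n` (p03).
* `HasCpFactorization X d` — completely positive with `cp-rank ≤ d` (p03): `X_{ij} = ⟨p_i,p_j⟩`,
  `p_i ∈ ℝ^d_+`. `IsCp`. `IsDnn X` — doubly nonnegative (psd and entrywise `≥ 0`, p03).
* `IsGramLorentz X` — Definitions 2–3 (p13): Gram matrix of vectors of a Lorentz (second-order) cone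
  `L = {(c,x) : c ≥ ‖x‖}`.
* `elliptope n` (p18: psd with unit diagonal), `elliptopeMaxRank n = ⌊(√(1+8n)−1)/2⌋` (p18), `behaviorMatrix C`
  (eq. (22), p18: `P_C = ¼ [J+C, J−C; J−C, J+C]`).

Contents.
* PROVED (p03 inclusions `CP ⊆ CS_+ ⊆ DNN`; §3.3.3 `cpsd-rank ≤ cp-rank`; Lemma 3 subadditivity;
  Lemma 4 `≤` half; monotonicity): `HasCpFactorization.hasCpsdFactorization`,
  `HasCpsdFactorization.entry_nonneg`, `HasCpsdFactorization.posSemidef`, `IsCpsd.isDnn`,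
  `HasCpsdFactorization.add`, `HasCpsdFactorization.fromBlocks_diag`, `HasCpsdFactorization.mono`.
* NAMED FACTS: `PrakashEtAl2017_lemma4` (Lemma 4, `≥` half: `cpsd-rank(X ⊕ Y) ≥ cpsd-rank X +
  cpsd-rank Y`), `PrakashEtAl2017_lemma5` (Hadamard squares of psd matrices are cpsd with rank-one
  factors), `PrakashEtAl2017_thm3` (analytic lower bound `cpsd-rank(X) ≥ (Σ√X_ii)²/Σ X_ij`),
  `PrakashEtAl2017_thm4` (support-based bound = orthogonal subspace representations),
  `PrakashEtAl2017_rank_le_cpsdRank_sq` (§3.3.1, `√rank ≤ cpsd-rank`),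
  `PrakashEtAl2017_hasPsdFactorization_of_cpsd` (§3.3.2 + §3.1: real psd rank `≤ 2·cpsd-rank`),
  `PrakashEtAl2017_thm6` (Fawzi–Wei isometric embedding of the Lorentz cone into `H^d_+`,
  `d = 2^{⌊(m−1)/2⌋}` — FALSE AS PRINTED for `m = 2`, where `d = 1` cannot host an isometry of `ℝ²`
  (equivalently Theorem 5's `γ(e₁) = Z^{⊗0} = [1]` is not traceless for `n = 1`): REFUTED by
  `PrakashEtAl2017_thm6_false`; the scope-corrected statement (`m ≠ 2`) is the NAMED FACT
  `PrakashEtAl2017_thm6'`, DISCHARGED by `PrakashEtAl2017_thm6'_holds` through the explicit Brauer–Weyl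
  matrices of Theorem 5, `exists_lorentz_isometry`; and at `m = 2` the statement holds with `d = 2`,
  `exists_lorentz_isometry_one`), `PrakashEtAl2017_thm7` (`cpsd-rank(X) ≤ 2^{⌊(rank X+1)/2⌋}` on Gram–Lorentz
  matrices; DISCHARGED by `PrakashEtAl2017_thm7_holds`: Lemma 7's orthonormal compression of the
  Gram–Lorentz factorization to `L_{rank X + 2}` + Theorem 6′), `PrakashEtAl2017_cor1` (an explicit family in `CS_+ \ CP`; its Gram–Lorentz half PROVED:
  `isGramLorentz_cyclicLorentzGram`; the `∉ CP` half DISCHARGED, `PrakashEtAl2017_cor1_holds`, by the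
  Theorem 8 / Lemma 8 parity argument), `PrakashEtAl2017_thm11` (Tsirelson: extremal quantum
  correlations of rank `r` need dimension `≥ √2^{⌊r/2⌋}`), `PrakashEtAl2017_thm14` (Grone–Pierce–Watkins /
  Li–Tam: ranks of extreme points of the elliptope; DISCHARGED by `PrakashEtAl2017_thm14_holds`:
  `rank ≤ r_max(n)` is `rank_le_elliptopeMaxRank_of_mem_extremePoints` (Barvinok–Pataki extreme-point
  bound of `PsdFactorNorms.lean`), and extreme points of every rank `1 ≤ r ≤ r_max(n)` come from the
  Grone–Pierce–Watkins vectors `e_i`, `(e_i+e_j)/√2` through the Li–Tam criterion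
  `mem_extremePoints_elliptope_of_gram`; Theorem 13 (Li–Tam) as an iff:
  `mem_extremePoints_elliptope_iff_gram`), `PrakashEtAl2017_thm16` (MAIN: `cpsd-rank(P_{C_n})
  ≥ √2^{⌊elliptopeMaxRank(n)/2⌋} = 2^{Ω(√n)}`; its Gram–Lorentz conjunct PROVED for every `C ∈ 𝓔_n`,
  `isGramLorentz_behaviorMatrix` = Lemma 10, whence `hasCpsdFactorization_behaviorMatrix`), with Result 1 DERIVED (`PrakashEtAl2017_result1_of`; modulo Theorem 16 alone: `PrakashEtAl2017_result1_of_thm16`),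
  and Proposition 2 (`ext(𝓔_n) ⊆ ext(Cor(n,n))`) PROVED (`PrakashEtAl2017_prop2`, appended 2026-08-27, with
  `exists_unit_gram_of_mem_elliptope` / `mem_elliptope_of_unit_gram_diag` = `𝓔_n = Cor(n,n) ∩ {unit diagonal}`),
  `PrakashEtAl2017_lemma11` (odd cycles `C_{2t+1}`, `t ≥ 2`: `A − λ_min I ∈ DNN \ CS_+`; DISCHARGED by
  `PrakashEtAl2017_lemma11_holds`: `A(C_n) − λI` in Fourier form is a nonnegative combination of the psd
  matrices `c_jc_jᵀ + s_js_jᵀ`, and Theorem 17 PROVED for the tracial algebra `M_d(ℂ)` in Gram-free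
  form — kernel vectors of a cpsd `X` transfer to its factors, `HasCpsdFactorization.sum_smul_eq_zero_of_mulVec_eq_zero`
  (Remark 6.1), and `HasCpsdFactorization.exists_row_eq_mul_row` (rows `i*, j*` proportional by
  uniqueness of psd square roots) — applied with the kernel vectors `sin(θ(k−2))`, `sin(θ(k+1))`,
  `θ = 2πt/(2t+1)`, contradicting `λ_t² ≠ 1`),
  `PrakashEtAl2017_thm18` (cpsd-graphs = graphs with no odd cycle of length `≥ 5` as a subgraph).

NOT typed IN THIS FILE — typed (and proved) elsewhere in this directory since: Theorems 1, 2 and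
Proposition 1 (the Bell-scenario / quantum-behavior formalism `𝒟(p)`, `𝒜(p)`) in
`QuantumBehaviorsCpsdFormulation.lean` (`PrakashEtAl2017_thm1` / `_thm2` / `_prop1`, each with
`_holds`; `HasQuantumRep`, `quantumBehaviors`, `quantumDim`, `localBehaviors`, `behaviorAffine`);
Definition 4, Lemmas 9–10 and Theorems 9, 12, 15 (Gram–Lorentz behaviours, `𝒟(p_C) ≥ √2^{⌊rank C/2⌋}`)
in `GramLorentzBehaviors.lean`; Theorem 10 (Tsirelson) in `QuantumCorrelationDimensionBound.lean`
(`PrakashEtAl2017_thm10_i_iff_iii`, with `PrakashEtAl2017_thm11_holds`); Lemma 12 (Tsirelson) in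
`TsirelsonExtremalCorrelations.lean` (`Tsirelson1987_lemma12`); Theorem 13 (Li–Tam) is
`mem_extremePoints_elliptope_iff_gram` below. Typed and proved as stand-alone statements in sibling
files since (2026-08-28): Theorem 5 (the Brauer–Weyl matrices behind Theorem 6, which
`exists_lorentz_isometry` below uses) in `BrauerWeylCliffordMatrices.lean` (`Clifford.PrakashEtAl2017_thm5`);
Theorem 8 and Lemmas 6, 8 in `GramLorentzMatrices.lean`; Theorem 17, Remark 6.1 and Lemma 11 for
general faithful tracial (`C^*`/von Neumann) algebras in `TracialPositiveFactorizations.lean`;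
Lemmas 1–2 and Remark 3.1 in `CpsdRankSymmetrization.lean`; §3.3.2's normal form `Σ A_i = Σ B_j` in
`PsdFactorizationSumNormalForm.lean`; `CS_+^{n,1}`, the converse half of Lemma 5, the example
`CS_+^3 ∖ CS_+^{3,1}`, the remarks after Theorems 3–4 and the §3.3.1 example in
`CpsdRankOneFactorizations.lean`; Example 3.1 in `CpsdRankExampleFour.lean`. Still NOT typed as a
stand-alone statement: Lemma 7 (the rank-`r` compression, inside `PrakashEtAl2017_thm7_holds`); the
open question "is `max{cpsd-rank(X) : X ∈ CS_+^n}` finite?" (p06) is an open problem, not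
literature — answered NO for `n ≥ 10`, see `CpsdConeNonClosure.lean`.
-/

noncomputable section

open Matrix Finset
open scoped MatrixOrder ComplexOrder Kronecker

namespace Literature.Combinatorics.Optimization

variable {ι : Type*}

/-! ### Definitions -/

/-- **PSVW Definition 1** (p04, verbatim): "The completely positive semidefinite rank (cpsd-rank) of
`X ∈ CS_+^n`, denoted `cpsd-rank(X)`, is defined as the least `d ≥ 1` for which there exist matrices
`P_1,…,P_n ∈ H^d_+` such that `X_{ij} = Tr(P_i P_j)` for all `i,j ∈ [n]`" (`H^d_+` = `d × d` HERMITIAN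
psd matrices; such a family is a "CS_+-factorization"). Typed as the predicate "`X` has a
`CS_+`-factorization of size `d`" for a real matrix `X`. [cite: PrakashEtAl2017, Def. 1 (p04)] -/
def HasCpsdFactorization (X : Matrix ι ι ℝ) (d : ℕ) : Prop :=
  ∃ P : ι → Matrix (Fin d) (Fin d) ℂ, (∀ i, (P i).PosSemidef) ∧
    ∀ i j, ((X i j : ℝ) : ℂ) = (P i * P j).trace

/-- The cone `CS_+^n` of **completely positive semidefinite** matrices: those with a
`CS_+`-factorization of some size. [cite: PrakashEtAl2017, §1.1 (p03)] -/
def IsCpsd (X : Matrix ι ι ℝ) : Prop := ∃ d, HasCpsdFactorization X d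

/-- **Completely positive with cp-rank `≤ d`** (p03, verbatim): "`X` is called completely positive (cp)
if there exist vectors `{p_i} ⊆ ℝ^d_+`, for some `d ≥ 1`, such that `X_{ij} = ⟨p_i,p_j⟩`"; "the
smallest [such] `d` … is called the completely positive rank (cp-rank)". [cite: PrakashEtAl2017, §1.1 (p03)] -/
def HasCpFactorization (X : Matrix ι ι ℝ) (d : ℕ) : Prop :=
  ∃ p : ι → Fin d → ℝ, (∀ i l, 0 ≤ p i l) ∧ ∀ i j, X i j = ∑ l, p i l * p j l

/-- The cone `CP^n` of completely positive matrices. [cite: PrakashEtAl2017, §1.1 (p03)] -/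
def IsCp (X : Matrix ι ι ℝ) : Prop := ∃ d, HasCpFactorization X d

/-- The cone `DNN^n` of **doubly nonnegative** matrices: "positive semidefinite and entrywise
nonnegative" (p03). [cite: PrakashEtAl2017, §1.1 (p03)] -/
def IsDnn (X : Matrix ι ι ℝ) : Prop := X.PosSemidef ∧ ∀ i j, 0 ≤ X i j

/-! ### `CP ⊆ CS_+ ⊆ DNN` and `cpsd-rank ≤ cp-rank` (proved) -/

/-- "`CP^n ⊆ CS_+^n` … since nonnegative vectors correspond to diagonal psd matrices" (p03), in the
graded form of §3.3.3: "for all matrices `X ∈ CP` we clearly have `cpsd-rank(X) ≤ cp-rank(X)`".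
[cite: PrakashEtAl2017, §1.1 (p03), §3.3.3 (p12)] -/
theorem HasCpFactorization.hasCpsdFactorization {X : Matrix ι ι ℝ} {d : ℕ}
    (h : HasCpFactorization X d) : HasCpsdFactorization X d := by
  obtain ⟨p, hp, hX⟩ := h
  refine ⟨fun i => diagonal fun l => ((p i l : ℝ) : ℂ), fun i => ?_, fun i j => ?_⟩
  · exact posSemidef_diagonal_iff.mpr fun l => Complex.zero_le_real.mpr (hp i l)
  · rw [diagonal_mul_diagonal, trace_diagonal, hX]
    push_cast
    rfl

/-- `CP ⊆ CS_+`. [cite: PrakashEtAl2017, §1.1 (p03)] -/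
theorem IsCp.isCpsd {X : Matrix ι ι ℝ} (h : IsCp X) : IsCpsd X := by
  obtain ⟨d, hd⟩ := h
  exact ⟨d, hd.hasCpsdFactorization⟩

/-- `Tr(P Q) ≥ 0` for Hermitian psd `P, Q` ("the trace inner product of two psd matrices is a
nonnegative scalar", p03): `Q = Cᴴ C` and `Tr(P Cᴴ C) = Tr(C P Cᴴ) ≥ 0`. [cite: PrakashEtAl2017, §1.1 (p03)] -/
theorem trace_mul_nonneg_of_posSemidef_complex {d : ℕ} {P Q : Matrix (Fin d) (Fin d) ℂ}
    (hP : P.PosSemidef) (hQ : Q.PosSemidef) : 0 ≤ (P * Q).trace := by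
  obtain ⟨C, hC⟩ := CStarAlgebra.nonneg_iff_eq_star_mul_self.mp hQ.nonneg
  rw [hC, star_eq_conjTranspose, ← Matrix.mul_assoc, trace_mul_cycle]
  exact (hP.mul_mul_conjTranspose_same C).trace_nonneg

/-- A matrix with a `CS_+`-factorization is entrywise nonnegative. [cite: PrakashEtAl2017, §1.1 (p03)] -/
theorem HasCpsdFactorization.entry_nonneg {X : Matrix ι ι ℝ} {d : ℕ} (h : HasCpsdFactorization X d)
    (i j : ι) : 0 ≤ X i j := by
  obtain ⟨P, hP, hX⟩ := h
  have h0 : (0 : ℂ) ≤ ((X i j : ℝ) : ℂ) := by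
    rw [hX]
    exact trace_mul_nonneg_of_posSemidef_complex (hP i) (hP j)
  exact Complex.zero_le_real.mp h0

/-- A matrix with a `CS_+`-factorization is symmetric: `Tr(P_i P_j) = Tr(P_j P_i)`.
[cite: PrakashEtAl2017, §1.1 (p03)] -/
theorem HasCpsdFactorization.symm {X : Matrix ι ι ℝ} {d : ℕ} (h : HasCpsdFactorization X d)
    (i j : ι) : X i j = X j i := by
  obtain ⟨P, hP, hX⟩ := h
  have : ((X i j : ℝ) : ℂ) = ((X j i : ℝ) : ℂ) := by rw [hX, hX, trace_mul_comm]
  exact_mod_cast this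

/-- A matrix with a `CS_+`-factorization is positive semidefinite: for real `v`,
`vᵀ X v = Tr(S²) ≥ 0` with `S = Σ_i v_i P_i` Hermitian ("the set of such matrices forms a convex
cone … `CS_+^n ⊆ DNN^n`", p03). [cite: PrakashEtAl2017, §1.1 (p03)] -/
theorem HasCpsdFactorization.posSemidef [Fintype ι] {X : Matrix ι ι ℝ} {d : ℕ}
    (h : HasCpsdFactorization X d) : X.PosSemidef := by
  classical
  have hsymm := h.symm
  obtain ⟨P, hP, hX⟩ := h
  refine posSemidef_iff_dotProduct_mulVec.mpr ⟨?_, fun v => ?_⟩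
  · ext i j
    simpa using (hsymm j i)
  · -- `S = Σ_i v_i P_i` is Hermitian, and `vᵀ X v = Tr(S S) = Tr(S Sᴴ) ≥ 0`
    set S : Matrix (Fin d) (Fin d) ℂ := ∑ i, ((v i : ℝ) : ℂ) • P i with hS
    have hSH : Sᴴ = S := by
      rw [hS, conjTranspose_sum]
      refine sum_congr rfl fun i _ => ?_
      rw [conjTranspose_smul, (hP i).1.eq, Complex.star_def, Complex.conj_ofReal]
    have hSS : 0 ≤ (S * S).trace := by
      nth_rewrite 2 [← hSH]
      exact (posSemidef_self_mul_conjTranspose S).trace_nonneg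
    have hexpand : (S * S).trace = ∑ i, ∑ j, ((v i : ℝ) : ℂ) * ((X i j : ℝ) : ℂ) * ((v j : ℝ) : ℂ) := by
      rw [hS, sum_mul, trace_sum]
      refine sum_congr rfl fun i _ => ?_
      rw [mul_sum, trace_sum]
      refine sum_congr rfl fun j _ => ?_
      rw [smul_mul_smul_comm, trace_smul, smul_eq_mul, hX]
      ring
    have hreal : ((star v ⬝ᵥ (X *ᵥ v) : ℝ) : ℂ) = (S * S).trace := by
      rw [hexpand]
      simp only [star_trivial, dotProduct, mulVec, mul_sum]
      push_cast
      refine sum_congr rfl fun i _ => sum_congr rfl fun j _ => ?_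
      ring
    exact Complex.zero_le_real.mp (hreal ▸ hSS)

/-- **`CS_+^n ⊆ DNN^n`** (p03: "`CP^n ⊆ CS_+^n ⊆ DNN^n`, where we denote by `DNN^n` the set of `n × n`
doubly nonnegative matrices"). [cite: PrakashEtAl2017, §1.1 (p03)] -/
theorem IsCpsd.isDnn [Fintype ι] {X : Matrix ι ι ℝ} (h : IsCpsd X) : IsDnn X := by
  obtain ⟨d, hd⟩ := h
  exact ⟨hd.posSemidef, hd.entry_nonneg⟩

/-! ### Block tools over `ℂ` -/

/-- Trace of a block matrix. [folklore] -/
private theorem trace_fromBlocks' {m n : Type*} [Fintype m] [Fintype n] (A : Matrix m m ℂ)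
    (B : Matrix m n ℂ) (C : Matrix n m ℂ) (D : Matrix n n ℂ) :
    (Matrix.fromBlocks A B C D).trace = A.trace + D.trace := by
  simp [Matrix.trace, Fintype.sum_sum_type]

/-- Trace is invariant under re-indexing along an equivalence. [folklore] -/
private theorem trace_submatrix_equiv'' {p q : Type*} [Fintype p] [Fintype q] (X : Matrix q q ℂ)
    (e : p ≃ q) : (X.submatrix e e).trace = X.trace := by
  simp only [trace, diag_apply, submatrix_apply]
  exact Fintype.sum_equiv e _ _ fun _ => rfl

/-- A block-diagonal matrix with psd diagonal blocks is psd. [folklore] -/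
private theorem posSemidef_fromBlocks_diag {m n : Type*} [Fintype m] [Fintype n]
    {A : Matrix m m ℂ} {D : Matrix n n ℂ} (hA : A.PosSemidef) (hD : D.PosSemidef) :
    (Matrix.fromBlocks A 0 0 D).PosSemidef := by
  refine posSemidef_iff_dotProduct_mulVec.mpr ⟨hA.1.fromBlocks (by simp) hD.1, fun x => ?_⟩
  have hA' := (posSemidef_iff_dotProduct_mulVec.mp hA).2 (x ∘ Sum.inl)
  have hD' := (posSemidef_iff_dotProduct_mulVec.mp hD).2 (x ∘ Sum.inr)
  have hx : star x = Sum.elim (star (x ∘ Sum.inl)) (star (x ∘ Sum.inr)) := by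
    ext (a | b) <;> rfl
  rw [fromBlocks_mulVec, hx, sumElim_dotProduct_sumElim]
  simp only [zero_mulVec, add_zero, zero_add]
  exact add_nonneg hA' hD'

/-! ### Lemma 3, Lemma 4: sums and direct sums -/

/-- **PSVW Lemma 4, `≤` half** (p10): a `CS_+`-factorization of `X` of size `d₁` and one of `Y` of size
`d₂` give one of `X ⊕ Y` of size `d₁ + d₂` ("`P̃_i := P_i ⊕ 0_{d₂}`, `Q̃_j := 0_{d₁} ⊕ Q_j`").
[cite: PrakashEtAl2017, Lemma 4 (p10–p11)] -/
theorem HasCpsdFactorization.fromBlocks_diag {ι₁ ι₂ : Type*} {X : Matrix ι₁ ι₁ ℝ} {Y : Matrix ι₂ ι₂ ℝ}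
    {d₁ d₂ : ℕ} (hX : HasCpsdFactorization X d₁) (hY : HasCpsdFactorization Y d₂) :
    HasCpsdFactorization (Matrix.fromBlocks X 0 0 Y) (d₁ + d₂) := by
  obtain ⟨P, hP, hXf⟩ := hX
  obtain ⟨Q, hQ, hYf⟩ := hY
  let e : Fin (d₁ + d₂) ≃ Fin d₁ ⊕ Fin d₂ := finSumFinEquiv.symm
  let padL : Matrix (Fin d₁) (Fin d₁) ℂ → Matrix (Fin (d₁ + d₂)) (Fin (d₁ + d₂)) ℂ :=
    fun A => (Matrix.fromBlocks A 0 0 (0 : Matrix (Fin d₂) (Fin d₂) ℂ)).submatrix e e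
  let padR : Matrix (Fin d₂) (Fin d₂) ℂ → Matrix (Fin (d₁ + d₂)) (Fin (d₁ + d₂)) ℂ :=
    fun B => (Matrix.fromBlocks (0 : Matrix (Fin d₁) (Fin d₁) ℂ) 0 0 B).submatrix e e
  refine ⟨Sum.elim (fun i => padL (P i)) (fun j => padR (Q j)), ?_, ?_⟩
  · rintro (i | j)
    · exact (posSemidef_submatrix_equiv e).mpr (posSemidef_fromBlocks_diag (hP i) PosSemidef.zero)
    · exact (posSemidef_submatrix_equiv e).mpr (posSemidef_fromBlocks_diag PosSemidef.zero (hQ j))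
  · rintro (i | j) (i' | j')
    · simp only [Sum.elim_inl, fromBlocks_apply₁₁, padL]
      rw [submatrix_mul_equiv, trace_submatrix_equiv'', fromBlocks_multiply, trace_fromBlocks', hXf]
      simp
    · simp only [Sum.elim_inl, Sum.elim_inr, fromBlocks_apply₁₂, Matrix.zero_apply, padL, padR]
      rw [submatrix_mul_equiv, trace_submatrix_equiv'', fromBlocks_multiply, trace_fromBlocks']
      simp
    · simp only [Sum.elim_inl, Sum.elim_inr, fromBlocks_apply₂₁, Matrix.zero_apply, padL, padR]
      rw [submatrix_mul_equiv, trace_submatrix_equiv'', fromBlocks_multiply, trace_fromBlocks']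
      simp
    · simp only [Sum.elim_inr, fromBlocks_apply₂₂, padR]
      rw [submatrix_mul_equiv, trace_submatrix_equiv'', fromBlocks_multiply, trace_fromBlocks', hYf]
      simp

/-- **PSVW Lemma 3** (p10, verbatim): "For any `X, Y ∈ CS_+^n` we have that `X + Y ∈ CS_+^n` and
furthermore, `cpsd-rank(X+Y) ≤ cpsd-rank(X) + cpsd-rank(Y)`" (factors `Z_i := P_i ⊕ Q_i`).
[cite: PrakashEtAl2017, Lemma 3 (p10)] -/
theorem HasCpsdFactorization.add {X Y : Matrix ι ι ℝ} {d₁ d₂ : ℕ} (hX : HasCpsdFactorization X d₁)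
    (hY : HasCpsdFactorization Y d₂) : HasCpsdFactorization (X + Y) (d₁ + d₂) := by
  obtain ⟨R, hR, hXY⟩ := hX.fromBlocks_diag hY
  refine ⟨fun i => R (Sum.inl i) + R (Sum.inr i), fun i => (hR _).add (hR _), fun i j => ?_⟩
  rw [Matrix.add_mul, Matrix.mul_add, Matrix.mul_add, trace_add, trace_add, trace_add,
    ← hXY (Sum.inl i) (Sum.inl j), ← hXY (Sum.inl i) (Sum.inr j), ← hXY (Sum.inr i) (Sum.inl j),
    ← hXY (Sum.inr i) (Sum.inr j)]
  simp

/-- "`cpsd-rank ≤ d`" is monotone in `d` (pad the factors with a zero block).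
[cite: PrakashEtAl2017, Def. 1 (p04: "least d")] -/
theorem HasCpsdFactorization.mono {X : Matrix ι ι ℝ} {d s : ℕ} (h : HasCpsdFactorization X d)
    (hds : d ≤ s) : HasCpsdFactorization X s := by
  have h0 : HasCpsdFactorization (0 : Matrix ι ι ℝ) (s - d) :=
    ⟨fun _ => 0, fun _ => PosSemidef.zero, fun i j => by simp⟩
  have := h.add h0
  rwa [add_zero, Nat.add_sub_cancel' hds] at this

/-- **PSVW Lemma 4** (p10, verbatim): "For any `X ∈ CS_+^n` and `Y ∈ CS_+^m` we have that `X ⊕ Y ∈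
CS_+^{n+m}` and furthermore, `cpsd-rank(X ⊕ Y) = cpsd-rank(X) + cpsd-rank(Y)`." The `≤` half is
`HasCpsdFactorization.fromBlocks_diag`; typed here is the `≥` half: a `CS_+`-factorization of `X ⊕ Y`
of size `d` yields ones of `X`, `Y` of sizes `d₁ + d₂ ≤ d` (Lemma 1 (ii): restrict to the ranges of
`Σ P_i ⊥ Σ Q_j`). [cite: PrakashEtAl2017, Lemma 4 (p10–p11)] -/
def PrakashEtAl2017_lemma4 : Prop :=
  ∀ (ι₁ ι₂ : Type) [Fintype ι₁] [Fintype ι₂] (X : Matrix ι₁ ι₁ ℝ) (Y : Matrix ι₂ ι₂ ℝ) (d : ℕ),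
    HasCpsdFactorization (Matrix.fromBlocks X 0 0 Y) d →
      ∃ d₁ d₂ : ℕ, d₁ + d₂ ≤ d ∧ HasCpsdFactorization X d₁ ∧ HasCpsdFactorization Y d₂

/-! ### Lemma 5, Theorem 3, Theorem 4, §3.3: bounds -/

/-- **PSVW Lemma 5** (p11, verbatim): "For any matrix `X ∈ H^n_+` we have that `X ∘ X̄ ∈ CS_+^{n,1}`
[admits a `CS_+`-factorization with rank-one factors] and moreover `cpsd-rank(X ∘ X̄) ≤ rank(X)`. In
particular, if `X ∈ H^n_+` is a matrix with `0/1` entries then `X ∈ CS_+^n` and `cpsd-rank(X) ≤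
rank(X)`." Typed for real symmetric psd `X` (`X ∘ X̄ = X ∘ X`): the Hadamard square has a
`CS_+`-factorization of size `rank X` by rank-one factors, and a psd `0/1` matrix has one of size
`rank X`. [cite: PrakashEtAl2017, Lemma 5 (p11)] -/
def PrakashEtAl2017_lemma5 : Prop :=
  ∀ (ι : Type) [Fintype ι] (X : Matrix ι ι ℝ), X.PosSemidef →
    (∃ P : ι → Matrix (Fin X.rank) (Fin X.rank) ℂ, (∀ i, (P i).PosSemidef ∧ (P i).rank ≤ 1) ∧
        ∀ i j, (((X i j) ^ 2 : ℝ) : ℂ) = (P i * P j).trace) ∧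
    ((∀ i j, X i j = 0 ∨ X i j = 1) → HasCpsdFactorization X X.rank)

/-- **PSVW Theorem 3** (analytic lower bound; p11, verbatim): "For any matrix `X ∈ CS_+^n` we have that
`cpsd-rank(X) ≥ (Σ_{i=1}^n √X_ii)² / Σ_{i,j=1}^n X_ij`" (Cauchy–Schwarz `d ≥ Tr(P)²/Tr(P²)` for
`P = Σ P_i` of full rank, and `Tr P_i ≥ √Tr(P_i²)`); "it follows that `cpsd-rank(I_n) ≥ n`". Typed in
product form (no division): every `CS_+`-factorization of size `d` has `(Σ_i √X_ii)² ≤ d · Σ_{ij} X_ij`.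
[cite: PrakashEtAl2017, Thm. 3 (p11)] -/
def PrakashEtAl2017_thm3 : Prop :=
  ∀ (ι : Type) [Fintype ι] (X : Matrix ι ι ℝ) (d : ℕ), HasCpsdFactorization X d →
    (∑ i, Real.sqrt (X i i)) ^ 2 ≤ d * ∑ i, ∑ j, X i j

/-- **PSVW Theorem 4** (support-based lower bound; p11, verbatim): with `f(G) := min{d ≥ 1 : ∃
subspaces {L_i}_{i=1}^n ⊆ ℂ^d s.t. L_i ⊥ L_j ⟺ i ≁ j}`, "For any graph `G = ([n],E)` we have that `f(G)`
is equal to `min{cpsd-rank(X) : X ∈ CS_+^n and S(X) = G}`" (`S(X)` the support graph: `u ∼ v` iff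
`X_{uv} ≠ 0`, `u ≠ v`). Typed size-wise: for every `d`, some cpsd `X` with support graph `G` has a
`CS_+`-factorization of size `d` iff there are subspaces `L_i ≤ ℂ^d` with `L_i ⊥ L_j ⟺ ¬ G.Adj i j` for
`i ≠ j`. [cite: PrakashEtAl2017, Thm. 4 (p11)] -/
def PrakashEtAl2017_thm4 : Prop :=
  ∀ (ι : Type) [Fintype ι] [DecidableEq ι] (G : SimpleGraph ι) (d : ℕ),
    (∃ X : Matrix ι ι ℝ, (∀ i j, i ≠ j → (X i j ≠ 0 ↔ G.Adj i j)) ∧ HasCpsdFactorization X d) ↔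
    ∃ L : ι → Submodule ℂ (EuclideanSpace ℂ (Fin d)),
      ∀ i j, i ≠ j → ((L i) ⟂ (L j) ↔ ¬ G.Adj i j)

/-- **PSVW §3.3.1** (p11, verbatim): "As `H^d` is isometrically isomorphic to `ℝ^{d²}`, we have `√rank(X) ≤
cpsd-rank(X)`, for any `X ∈ CS_+`." Typed: a `CS_+`-factorization of size `d` forces `rank X ≤ d²`.
[cite: PrakashEtAl2017, §3.3.1 (p11)] -/
def PrakashEtAl2017_rank_le_cpsdRank_sq : Prop :=
  ∀ (ι : Type) [Fintype ι] (X : Matrix ι ι ℝ) (d : ℕ), HasCpsdFactorization X d → X.rank ≤ d ^ 2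

/-- **PSVW §3.3.2 with §3.1** (p11/p10): "Clearly, for any `X ∈ CS_+^n` we have that `psd-rank(X) ≤
cpsd-rank(X)`" (psd-rank with Hermitian factors), and "the real cpsd-rank can differ at most by a factor of
two from the cpsd-rank … `T(X) := (1/√2)[Re X, −Im X; Im X, Re X]` … `X ∈ H^n_+` iff `T(X) ∈ S^{2n}_+` and
`⟨X,Y⟩ = ⟨T(X),T(Y)⟩`" (the same realification as FGPRT §2.2, `rank_psd ≤ 2 rank_psd^ℂ`). Typed in the
tree's REAL currency: a `CS_+`-factorization of size `d` gives a real psd factorization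
(`HasPsdFactorization`) of size `2d`. [cite: PrakashEtAl2017, §3.3.2 (p11–p12) and §3.1 (p10)] -/
def PrakashEtAl2017_hasPsdFactorization_of_cpsd : Prop :=
  ∀ (ι : Type) [Fintype ι] (X : Matrix ι ι ℝ) (d : ℕ), HasCpsdFactorization X d →
    HasPsdFactorization (fun i j => X i j) (2 * d)

/-! ### Gram–Lorentz matrices (§4) -/

/-- **Gram–Lorentz matrices** (PSVW Definitions 2–3, p13, verbatim): "The `m`-dimensional Lorentz cone,
denoted `L_m`, is … `{(c,x) ∈ ℝ × ℝ^{m−1} : c ≥ ‖x‖}`"; "A matrix `X` is called Gram-Lorentz if there exist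
vectors `{ℓ_i} ⊆ L_m` (for some `m ≥ 1`) such that `X = Gram({ℓ_i})`. We denote the set of `n × n`
Gram-Lorentz matrices by `GL^n`." Typed with `ℓ_i = (c_i, x_i)`, `x_i ∈ ℝ^k` (`m = k + 1`),
`‖x_i‖ = √(Σ_l x_{il}²) ≤ c_i` and `X_{ij} = c_i c_j + ⟨x_i, x_j⟩`. [cite: PrakashEtAl2017, Def. 2–3 (p13)] -/
def IsGramLorentz (X : Matrix ι ι ℝ) : Prop :=
  ∃ (k : ℕ) (c : ι → ℝ) (x : ι → Fin k → ℝ), (∀ i, Real.sqrt (∑ l, x i l ^ 2) ≤ c i) ∧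
    ∀ i j, X i j = c i * c j + ∑ l, x i l * x j l

/-- **PSVW Theorem 6** (Fawzi–Wei; p13, verbatim): "Set `d := 2^{⌊(m−1)/2⌋}`. There exists an isometry
`Γ : ℝ^m → H^d` such that `L_m = {(c,x) ∈ ℝ × ℝ^{m−1} : Γ((c,x)) ∈ H^d_+}`" (proof: `Γ((c,x)) = (cI_d +
γ(x))/√d` with the Brauer–Weyl/Clifford matrices `γ` of Theorem 5). Typed with `m = k + 1`
(`d = 2^{⌊k/2⌋}`), "isometry" = `Tr(Γ(p)Γ(q)) = ⟨p,q⟩`, values Hermitian. [cite: PrakashEtAl2017, Thm. 6 (p13)] -/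
def PrakashEtAl2017_thm6 : Prop :=
  ∀ k : ℕ, ∃ Γ : (ℝ × (Fin k → ℝ)) →ₗ[ℝ] Matrix (Fin (2 ^ (k / 2))) (Fin (2 ^ (k / 2))) ℂ,
    (∀ p, (Γ p).IsHermitian) ∧
    (∀ p q, (Γ p * Γ q).trace = (((p.1 * q.1 + ∑ l, p.2 l * q.2 l : ℝ)) : ℂ)) ∧
    ∀ p, (Γ p).PosSemidef ↔ Real.sqrt (∑ l, p.2 l ^ 2) ≤ p.1

/-- **PSVW Theorem 7** (p14, verbatim): "For any matrix `X ∈ GL^n` we have that `X ∈ CS_+^n` and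
`cpsd-rank(X) ≤ 2^{⌊(rank(X)+1)/2⌋}`" (Lemma 7: a Gram–Lorentz matrix has a `GL`-factorization in
`L_{rank X + 2}`; then Theorem 6). [cite: PrakashEtAl2017, Thm. 7 (p14)] -/
def PrakashEtAl2017_thm7 : Prop :=
  ∀ (ι : Type) [Fintype ι] (X : Matrix ι ι ℝ), IsGramLorentz X →
    HasCpsdFactorization X (2 ^ ((X.rank + 1) / 2))

/-- The vectors `p_k = (1, cos(2πk/n), sin(2πk/n))` of Corollary 1 and their Gram matrix
`X_{kk'} = 1 + cos(2πk/n)cos(2πk'/n) + sin(2πk/n)sin(2πk'/n)`. [cite: PrakashEtAl2017, Cor. 1 (p14)] -/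
def cyclicLorentzGram (n : ℕ) : Matrix (Fin n) (Fin n) ℝ := fun k k' =>
  1 + Real.cos (2 * Real.pi * k / n) * Real.cos (2 * Real.pi * k' / n) +
    Real.sin (2 * Real.pi * k / n) * Real.sin (2 * Real.pi * k' / n)

/-- The matrix of Corollary 1 is Gram–Lorentz: `p_k ∈ L_3` since `cos² + sin² = 1 ≤ 1²`
("as `{p_k} ⊆ L_3` it follows that `X ∈ GL^n`", p14). [cite: PrakashEtAl2017, Cor. 1 (p14)] -/
theorem isGramLorentz_cyclicLorentzGram (n : ℕ) : IsGramLorentz (cyclicLorentzGram n) := by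
  refine ⟨2, fun _ => 1, fun k => ![Real.cos (2 * Real.pi * k / n), Real.sin (2 * Real.pi * k / n)],
    fun k => ?_, fun k k' => ?_⟩
  · have : ∑ l : Fin 2, (![Real.cos (2 * Real.pi * k / n), Real.sin (2 * Real.pi * k / n)] l) ^ 2 = 1 := by
      simp [Fin.sum_univ_two, Real.cos_sq_add_sin_sq]
    rw [this, Real.sqrt_one]
  · simp [cyclicLorentzGram, Fin.sum_univ_two, add_assoc]

/-- **PSVW Corollary 1** (p14, verbatim): "Let `n = 2ℓ`, where `ℓ ≥ 3` is odd. For `0 ≤ k ≤ n−1` define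
the Lorentz cone vectors `p_k := (1, cos(2πk/n), sin(2πk/n))` … it follows from Theorem 8 that
`X := Gram({p_k}_{k=0}^{n−1})` is not completely positive. Moreover … `X ∈ GL^n \ CP^n`. In particular we
have that `X ∈ CS_+^n \ CP^n`." The Gram–Lorentz half is `isGramLorentz_cyclicLorentzGram`; typed here:
`X ∉ CP`. [cite: PrakashEtAl2017, Cor. 1 (p14)] -/
def PrakashEtAl2017_cor1 : Prop :=
  ∀ ℓ : ℕ, 3 ≤ ℓ → Odd ℓ → ¬ IsCp (cyclicLorentzGram (2 * ℓ))

/-! ### §5: exponential cpsd-rank -/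

/-- `r_max(n) = ⌊(√(1+8n) − 1)/2⌋`, "the greatest integer satisfying `C(r+1,2) ≤ n`" (p18); with
integer square root, `⌊(√(1+8n)−1)/2⌋ = ⌊(⌊√(1+8n)⌋−1)/2⌋`. [cite: PrakashEtAl2017, §5.2.2 (p18)] -/
def elliptopeMaxRank (n : ℕ) : ℕ := (Nat.sqrt (1 + 8 * n) - 1) / 2

/-- The **elliptope** `𝓔_n`: "the set of `n × n` symmetric psd matrices with diagonal entries equal to
`1`" (p18). [cite: PrakashEtAl2017, §5.2.2 (p18)] -/
def elliptope (n : ℕ) : Set (Matrix (Fin n) (Fin n) ℝ) := {X | X.PosSemidef ∧ ∀ i, X i i = 1}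

/-- The **behavior matrix** of a correlation matrix `C` (eq. (22), p18): `P_C = ¼ [J+C, J−C; J−C, J+C]`
(`J` the all-ones matrix), the `2n × 2n` table of `p_C(ab|xy) = (1 + ab·c_{xy})/4`.
[cite: PrakashEtAl2017, Def. 4 and eq. (22) (p18)] -/
def behaviorMatrix {n : ℕ} (C : Matrix (Fin n) (Fin n) ℝ) : Matrix (Fin n ⊕ Fin n) (Fin n ⊕ Fin n) ℝ :=
  (1 / 4 : ℝ) • Matrix.fromBlocks (Matrix.of (fun _ _ => (1 : ℝ)) + C) (Matrix.of (fun _ _ => (1 : ℝ)) - C)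
    (Matrix.of (fun _ _ => (1 : ℝ)) - C) (Matrix.of (fun _ _ => (1 : ℝ)) + C)

/-- **PSVW Theorem 11** (Tsirelson 1987, made explicit with proof in PSVW §8; p17, verbatim): "Let
`C = (c_{xy}) ∈ ext(Cor(n,m))` and consider a family of Hermitian operators `{M_x}, {N_y} ⊆ H^d` with
eigenvalues in `[−1,1]` and a quantum state `ρ ∈ H^{d²}_+` satisfying `c_{xy} = Tr((M_x ⊗ N_y)ρ)` for all
`x,y`. Then we have that `d ≥ √2^{⌊rank(C)/2⌋}`." Here `Cor(n,m)` = the set of quantum correlations =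
`{(⟨u_x,v_y⟩) : u_x, v_y unit vectors in ℝ^{n+m}}` (Tsirelson, Theorem 10 (iii)); "eigenvalues in
`[−1,1]`" = `−I ⪯ M ⪯ I`; a state = psd of trace one. [cite: PrakashEtAl2017, Thm. 11 (p17; proof §8 p24)] -/
def PrakashEtAl2017_thm11 : Prop :=
  ∀ (n m d : ℕ) (C : Matrix (Fin n) (Fin m) ℝ),
    C ∈ Set.extremePoints ℝ
      {C' : Matrix (Fin n) (Fin m) ℝ | ∃ (u : Fin n → EuclideanSpace ℝ (Fin (n + m)))
        (v : Fin m → EuclideanSpace ℝ (Fin (n + m))),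
        (∀ x, ‖u x‖ = 1) ∧ (∀ y, ‖v y‖ = 1) ∧ ∀ x y, C' x y = inner ℝ (u x) (v y)} →
    ∀ (M : Fin n → Matrix (Fin d) (Fin d) ℂ) (N : Fin m → Matrix (Fin d) (Fin d) ℂ)
      (ρ : Matrix (Fin d × Fin d) (Fin d × Fin d) ℂ),
      (∀ x, (M x).IsHermitian ∧ (1 - M x).PosSemidef ∧ (1 + M x).PosSemidef) →
      (∀ y, (N y).IsHermitian ∧ (1 - N y).PosSemidef ∧ (1 + N y).PosSemidef) →
      ρ.PosSemidef → ρ.trace = 1 →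
      (∀ x y, ((C x y : ℝ) : ℂ) = ((M x ⊗ₖ N y) * ρ).trace) →
        Real.sqrt 2 ^ (C.rank / 2) ≤ (d : ℝ)

/-- **PSVW Theorem 14** (Grone–Pierce–Watkins; Li–Tam; p18, verbatim): "For any `X ∈ ext(𝓔_n)` we have that
`rank(X) ≤ r_max(n)`. Furthermore, for any integer `r` in the range `1 ≤ r ≤ r_max(n)` there exists
`X_r ∈ ext(𝓔_n)` with `r = rank(X_r)`." [cite: PrakashEtAl2017, Thm. 14 (p18)] -/
def PrakashEtAl2017_thm14 : Prop :=
  ∀ n : ℕ, (∀ X ∈ Set.extremePoints ℝ (elliptope n), X.rank ≤ elliptopeMaxRank n) ∧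
    ∀ r : ℕ, 1 ≤ r → r ≤ elliptopeMaxRank n → ∃ X ∈ Set.extremePoints ℝ (elliptope n), X.rank = r

/-- **PSVW Theorem 16 — the main lower bound** (p19, verbatim): "Fix `n ≥ 1` and let `C_n ∈ ext(𝓔_n)` with
`rank(C_n) = r_max(n)`. Then `P_{C_n} := ¼ [J+C_n, J−C_n; J−C_n, J+C_n]` is a `2n × 2n` Gram-Lorentz matrix
satisfying `cpsd-rank(P_{C_n}) ≥ √2^{⌊r_max(n)/2⌋}`" (= `2^{Ω(√n)}`; via Theorems 11, 12 and Prop. 2, and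
Theorem 2 `cpsd-rank ≥ 𝒟`). [cite: PrakashEtAl2017, Thm. 16 (p19–p20)] -/
def PrakashEtAl2017_thm16 : Prop :=
  ∀ n : ℕ, 1 ≤ n → ∀ C ∈ Set.extremePoints ℝ (elliptope n), C.rank = elliptopeMaxRank n →
    IsGramLorentz (behaviorMatrix C) ∧
      ∀ d : ℕ, HasCpsdFactorization (behaviorMatrix C) d → Real.sqrt 2 ^ (elliptopeMaxRank n / 2) ≤ (d : ℝ)

/-- **PSVW Result 1** (p06: "For any integer `n ≥ 1` there exists a matrix `X_n ∈ GL^{2n}` such that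
`cpsd-rank(X_n) ≥ √2^{⌊r_max(n)/2⌋}`"), DERIVED from Theorems 14 and 16 (a maximal-rank extreme point of
the elliptope exists, `r_max(n) ≥ 1` for `n ≥ 1`). [cite: PrakashEtAl2017, Result 1 (p06), Thm. 16 (p19)] -/
theorem PrakashEtAl2017_result1_of (h14 : PrakashEtAl2017_thm14) (h16 : PrakashEtAl2017_thm16)
    (n : ℕ) (hn : 1 ≤ n) :
    ∃ X : Matrix (Fin n ⊕ Fin n) (Fin n ⊕ Fin n) ℝ, IsGramLorentz X ∧
      ∀ d : ℕ, HasCpsdFactorization X d → Real.sqrt 2 ^ (elliptopeMaxRank n / 2) ≤ (d : ℝ) := by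
  have hr : 1 ≤ elliptopeMaxRank n := by
    unfold elliptopeMaxRank
    have h9 : 3 ≤ Nat.sqrt (1 + 8 * n) := by
      rw [Nat.le_sqrt]
      omega
    omega
  obtain ⟨C, hC, hrank⟩ := (h14 n).2 (elliptopeMaxRank n) hr le_rfl
  exact ⟨behaviorMatrix C, h16 n hn C hC hrank⟩

/-! ### §6: cpsd-graphs -/

/-- **PSVW Lemma 11** (p20, verbatim): "Let `A_t` denote the adjacency matrix of `C_{2t+1}` (`t ≥ 2`), and
let `λ_t` be its least eigenvalue. The matrix `A_t − λ_t I` is doubly-nonnegative, its support is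
`C_{2t+1}`, and it does not admit an `𝒩⁺`-factorization for any tracial von Neumann algebra"; in
particular (Remark 6.2) it is not cpsd. Here `λ_t = 2cos(2πt/(2t+1))` (proof, p21). Typed: for `t ≥ 2`
the matrix `A − 2cos(2πt/(2t+1))·I` of the cycle graph on `2t+1` vertices is doubly nonnegative and
not in `CS_+`. [cite: PrakashEtAl2017, Lemma 11 (p20–p21), Remark 6.2 (p21)] -/
def PrakashEtAl2017_lemma11 : Prop :=
  ∀ t : ℕ, 2 ≤ t →
    IsDnn ((SimpleGraph.cycleGraph (2 * t + 1)).adjMatrix ℝ -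
        (2 * Real.cos (2 * Real.pi * t / (2 * t + 1))) • (1 : Matrix (Fin (2 * t + 1)) (Fin (2 * t + 1)) ℝ)) ∧
    ¬ IsCpsd ((SimpleGraph.cycleGraph (2 * t + 1)).adjMatrix ℝ -
        (2 * Real.cos (2 * Real.pi * t / (2 * t + 1))) • (1 : Matrix (Fin (2 * t + 1)) (Fin (2 * t + 1)) ℝ))

/-- **PSVW Theorem 18** (p21, verbatim): "A graph is cpsd if and only if it has no `C_{2t+1}`-subgraph
(`t ≥ 2`)", where (§6, p20) "`G = ([n],E)` is a cpsd-graph if for any matrix `X ∈ DNN^n` whose support is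
given by `G`, i.e., `S(X) = G`, we have that `X ∈ CS_+^n`" and the support graph has `u ∼ v` iff
`X_{uv} ≠ 0` (`u ≠ v`). A `C_{2t+1}`-subgraph (not necessarily induced) is an injective placement of the
cycle on `2t+1 = 2s+5` vertices whose consecutive vertices are adjacent in `G`.
[cite: PrakashEtAl2017, Thm. 18 (p21)] -/
def PrakashEtAl2017_thm18 : Prop :=
  ∀ (ι : Type) [Fintype ι] [DecidableEq ι] (G : SimpleGraph ι),
    (∀ X : Matrix ι ι ℝ, IsDnn X → (∀ i j, i ≠ j → (X i j ≠ 0 ↔ G.Adj i j)) → IsCpsd X) ↔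
    ¬ ∃ (s : ℕ) (f : Fin (2 * s + 5) → ι), Function.Injective f ∧ ∀ a, G.Adj (f a) (f (a + 1))

/-! ### Discharge of `PrakashEtAl2017_hasPsdFactorization_of_cpsd`: the realification `T` of §3.1 -/

/-- Trace of a real block matrix. [folklore] -/
private theorem trace_fromBlocks_real {m n : Type*} [Fintype m] [Fintype n] (A : Matrix m m ℝ)
    (B : Matrix m n ℝ) (C : Matrix n m ℝ) (D : Matrix n n ℝ) :
    (Matrix.fromBlocks A B C D).trace = A.trace + D.trace := by
  simp [Matrix.trace, Fintype.sum_sum_type]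

/-- Trace is invariant under re-indexing along an equivalence (real version). [folklore] -/
private theorem trace_submatrix_equiv_real {p q : Type*} [Fintype p] [Fintype q] (X : Matrix q q ℝ)
    (e : p ≃ q) : (X.submatrix e e).trace = X.trace := by
  simp only [trace, diag_apply, submatrix_apply]
  exact Fintype.sum_equiv e _ _ fun _ => rfl

/-- The realification `T(P) = [Re P, −Im P; Im P, Re P]` of §3.1 turns traces of products into twice the
real part: `Tr(T(P) T(Q)) = 2 Re Tr(P Q)` (the paper's `T` carries a factor `1/√2`, making it an
isometry). [cite: PrakashEtAl2017, §3.1 (p10, the map T)] -/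
theorem trace_realify_mul_realify {d : ℕ} (P Q : Matrix (Fin d) (Fin d) ℂ) :
    (Matrix.fromBlocks (P.map Complex.re) (-(P.map Complex.im)) (P.map Complex.im) (P.map Complex.re) *
      Matrix.fromBlocks (Q.map Complex.re) (-(Q.map Complex.im)) (Q.map Complex.im) (Q.map Complex.re)).trace
      = 2 * ((P * Q).trace).re := by
  rw [fromBlocks_multiply, trace_fromBlocks_real]
  simp only [Matrix.trace, Matrix.diag_apply, Matrix.add_apply, Matrix.mul_apply, Matrix.neg_apply,
    Matrix.map_apply, Matrix.neg_mul, Matrix.mul_neg, Complex.re_sum, Complex.mul_re]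
  simp only [Finset.sum_add_distrib, Finset.sum_neg_distrib, Finset.sum_sub_distrib]
  ring

/-- The realification of a Hermitian psd matrix is real symmetric psd ("`X ∈ H^n_+` if and only if
`T(X) ∈ S^{2n}_+`", §3.1): for real `u, v`, `[u;v]ᵀ T(P) [u;v] = Re((u+iv)* P (u+iv)) ≥ 0`.
[cite: PrakashEtAl2017, §3.1 (p10, the map T)] -/
theorem posSemidef_realify {d : ℕ} {P : Matrix (Fin d) (Fin d) ℂ} (hP : P.PosSemidef) :
    (Matrix.fromBlocks (P.map Complex.re) (-(P.map Complex.im)) (P.map Complex.im)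
      (P.map Complex.re)).PosSemidef := by
  have hH : Pᴴ = P := hP.1
  have hre : ∀ s t, (P t s).re = (P s t).re := fun s t => by
    have h := congrFun (congrFun hH s) t
    rw [conjTranspose_apply, Complex.star_def] at h
    rw [← h, Complex.conj_re]
  have him : ∀ s t, (P t s).im = -(P s t).im := fun s t => by
    have h := congrFun (congrFun hH s) t
    rw [conjTranspose_apply, Complex.star_def] at h
    rw [← h, Complex.conj_im, neg_neg]
  refine posSemidef_iff_dotProduct_mulVec.mpr ⟨?_, fun w => ?_⟩
  · -- symmetry
    ext (s | s) (t | t)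
    · simp [conjTranspose_apply, hre s t]
    · simp [conjTranspose_apply, him s t]
    · simp [conjTranspose_apply, him s t]
    · simp [conjTranspose_apply, hre s t]
  · set u : Fin d → ℝ := w ∘ Sum.inl with hu
    set v : Fin d → ℝ := w ∘ Sum.inr with hv
    let z : Fin d → ℂ := fun s => (u s : ℂ) + (v s : ℂ) * Complex.I
    have hz : 0 ≤ star z ⬝ᵥ (P *ᵥ z) := (posSemidef_iff_dotProduct_mulVec.mp hP).2 z
    -- termwise real parts
    have key : ∀ s t, (star (z s) * (P s t * z t)).re =
        u s * ((P s t).re * u t) + u s * (-(P s t).im * v t) +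
          (v s * ((P s t).im * u t) + v s * ((P s t).re * v t)) := by
      intro s t
      simp only [z, Complex.star_def, map_add, map_mul, Complex.conj_ofReal, Complex.conj_I,
        Complex.mul_re, Complex.mul_im, Complex.add_re, Complex.add_im, Complex.ofReal_re,
        Complex.ofReal_im, Complex.I_re, Complex.I_im, Complex.neg_re, Complex.neg_im, mul_neg,
        neg_mul]
      ring
    have hw : w = Sum.elim u v := (Sum.elim_comp_inl_inr w).symm
    have hreal : (star z ⬝ᵥ (P *ᵥ z)).re = star w ⬝ᵥ (Matrix.fromBlocks (P.map Complex.re)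
        (-(P.map Complex.im)) (P.map Complex.im) (P.map Complex.re) *ᵥ w) := by
      rw [hw, fromBlocks_mulVec, show star (Sum.elim u v) = Sum.elim u v from star_trivial _,
        Sum.elim_comp_inl, Sum.elim_comp_inr, sumElim_dotProduct_sumElim]
      simp only [dotProduct, mulVec, Pi.add_apply, Matrix.map_apply, Matrix.neg_apply, Finset.mul_sum,
        Complex.re_sum, mul_add, Finset.sum_add_distrib]
      rw [← Finset.sum_add_distrib, ← Finset.sum_add_distrib, ← Finset.sum_add_distrib]
      refine Finset.sum_congr rfl fun s _ => ?_
      rw [← Finset.sum_add_distrib, ← Finset.sum_add_distrib, ← Finset.sum_add_distrib]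
      refine Finset.sum_congr rfl fun t _ => ?_
      rw [Pi.star_apply]
      exact key s t
    have h0 := (Complex.nonneg_iff.mp hz).1
    rw [hreal] at h0
    simpa using h0

/-- **Discharge of `PrakashEtAl2017_hasPsdFactorization_of_cpsd`**: from a `CS_+`-factorization
`X_{ij} = Tr(P_i P_j)` of size `d`, the real psd factorization `A_i = ½ T(P_i)`, `B_j = T(P_j)` of size
`2d` (`Tr(T(P)T(Q)) = 2 Re Tr(PQ) = 2 X_{ij}`), re-indexed along `Fin d ⊕ Fin d ≃ Fin (2d)`.
[cite: PrakashEtAl2017, §3.3.2 (p11–p12) and §3.1 (p10)] -/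
theorem PrakashEtAl2017_hasPsdFactorization_of_cpsd_holds : PrakashEtAl2017_hasPsdFactorization_of_cpsd := by
  intro ι _ X d h
  obtain ⟨P, hP, hX⟩ := h
  let T : Matrix (Fin d) (Fin d) ℂ → Matrix (Fin d ⊕ Fin d) (Fin d ⊕ Fin d) ℝ := fun Q =>
    Matrix.fromBlocks (Q.map Complex.re) (-(Q.map Complex.im)) (Q.map Complex.im) (Q.map Complex.re)
  let e : Fin (2 * d) ≃ Fin d ⊕ Fin d := (finCongr (two_mul d)).trans finSumFinEquiv.symm
  refine ⟨fun i => ((1 / 2 : ℝ) • T (P i)).submatrix e e, fun j => (T (P j)).submatrix e e,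
    fun i => ?_, fun j => ?_, fun i j => ?_⟩
  · exact (posSemidef_submatrix_equiv e).mpr ((posSemidef_realify (hP i)).smul (by norm_num))
  · exact (posSemidef_submatrix_equiv e).mpr (posSemidef_realify (hP j))
  · rw [submatrix_mul_equiv, trace_submatrix_equiv_real, Matrix.smul_mul, trace_smul, smul_eq_mul]
    show X i j = 1 / 2 * (T (P i) * T (P j)).trace
    rw [trace_realify_mul_realify, ← hX, Complex.ofReal_re]
    ring


/-! ### Discharge of `PrakashEtAl2017_thm3`: the analytic lower bound -/

/-- Diagonal entries of a Hermitian psd complex matrix are real and nonnegative. [folklore] -/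
private theorem diag_re_nonneg_of_posSemidef {d : ℕ} {P : Matrix (Fin d) (Fin d) ℂ}
    (hP : P.PosSemidef) (s : Fin d) : 0 ≤ (P s s).re ∧ (P s s).im = 0 := by
  classical
  have h := (posSemidef_iff_dotProduct_mulVec.mp hP).2 (Pi.single s 1)
  have hval : star (Pi.single s (1 : ℂ)) ⬝ᵥ (P *ᵥ Pi.single s 1) = P s s := by
    simp [Matrix.mulVec_single, dotProduct, Pi.star_apply, Pi.single_apply]
  rw [hval] at h
  exact ⟨(Complex.nonneg_iff.mp h).1, (Complex.nonneg_iff.mp h).2.symm⟩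

/-- `2 × 2` principal minors of a Hermitian psd complex matrix: `|P_st|² ≤ Re P_ss · Re P_tt`
(`det` of the psd submatrix on `{s,t}` is `≥ 0`). [folklore] -/
private theorem normSq_apply_le_of_posSemidef {d : ℕ} {P : Matrix (Fin d) (Fin d) ℂ}
    (hP : P.PosSemidef) (s t : Fin d) : Complex.normSq (P s t) ≤ (P s s).re * (P t t).re := by
  have hB : (P.submatrix ![s, t] ![s, t]).PosSemidef := hP.submatrix ![s, t]
  have hdet := hB.det_nonneg
  rw [Matrix.det_fin_two] at hdet
  simp only [submatrix_apply, Matrix.cons_val_zero, Matrix.cons_val_one] at hdet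
  have hts : P t s = star (P s t) := by simpa using (hP.1.apply t s).symm
  rw [hts, Complex.star_def, Complex.mul_conj] at hdet
  obtain ⟨hs, hsi⟩ := diag_re_nonneg_of_posSemidef hP s
  obtain ⟨ht, hti⟩ := diag_re_nonneg_of_posSemidef hP t
  have hre := (Complex.nonneg_iff.mp hdet).1
  simp only [Complex.sub_re, Complex.mul_re, hsi, hti, mul_zero, sub_zero, Complex.ofReal_re] at hre
  linarith

/-- For a Hermitian psd complex matrix, `Re Tr(P²) ≤ (Re Tr P)²` (from the `2 × 2` minors:
`Σ_{s,t} |P_st|² ≤ Σ_{s,t} P_ss P_tt`). [folklore] -/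
private theorem trace_sq_re_le_of_posSemidef {d : ℕ} {P : Matrix (Fin d) (Fin d) ℂ}
    (hP : P.PosSemidef) : ((P * P).trace).re ≤ (P.trace).re ^ 2 := by
  have hts : ∀ s t, P t s = star (P s t) := fun s t => by simpa using (hP.1.apply t s).symm
  have h1 : ((P * P).trace).re = ∑ s, ∑ t, Complex.normSq (P s t) := by
    simp only [Matrix.trace, Matrix.diag_apply, Matrix.mul_apply, Complex.re_sum]
    refine sum_congr rfl fun s _ => sum_congr rfl fun t _ => ?_
    rw [hts s t, Complex.star_def, Complex.mul_conj, Complex.ofReal_re]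
  have h2 : (P.trace).re = ∑ s, (P s s).re := by
    simp only [Matrix.trace, Matrix.diag_apply, Complex.re_sum]
  rw [h1, h2, sq, sum_mul_sum]
  exact sum_le_sum fun s _ => sum_le_sum fun t _ => normSq_apply_le_of_posSemidef hP s t

/-- **Discharge of `PrakashEtAl2017_thm3`** (Theorem 3, the analytic lower bound), following the printed
proof with `S = Σ_i P_i`: `Σ_{ij} X_ij = Tr(S²) ≥ Σ_s |S_ss|² ≥ (Tr S)²/d` (Cauchy–Schwarz) and
`Tr S = Σ_i Tr P_i ≥ Σ_i √Tr(P_i²) = Σ_i √X_ii` (`Tr(P_i²) ≤ (Tr P_i)²` by the `2 × 2` minors).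
[cite: PrakashEtAl2017, Thm. 3 (p11)] -/
theorem PrakashEtAl2017_thm3_holds : PrakashEtAl2017_thm3 := by
  intro ι _ X d h
  classical
  obtain ⟨P, hP, hX⟩ := h
  set S : Matrix (Fin d) (Fin d) ℂ := ∑ i, P i with hS
  have hSpsd : S.PosSemidef := posSemidef_sum _ fun i _ => hP i
  -- (1) `Σ_{ij} X_ij = Re Tr(S²)`
  have hsum : (∑ i, ∑ j, X i j) = ((S * S).trace).re := by
    have : (((∑ i, ∑ j, X i j : ℝ)) : ℂ) = (S * S).trace := by
      rw [hS, sum_mul, trace_sum]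
      push_cast
      refine sum_congr rfl fun i _ => ?_
      rw [mul_sum, trace_sum]
      exact sum_congr rfl fun j _ => hX i j
    rw [← this, Complex.ofReal_re]
  -- (2) `Re Tr(S²) ≥ Σ_s (Re S_ss)²` and Cauchy–Schwarz `(Σ_s Re S_ss)² ≤ d Σ_s (Re S_ss)²`
  have hStr : (S.trace).re = ∑ s, (S s s).re := by
    simp only [Matrix.trace, Matrix.diag_apply, Complex.re_sum]
  have hts : ∀ s t, S t s = star (S s t) := fun s t => by simpa using (hSpsd.1.apply t s).symm
  have hdiag : ∑ s, (S s s).re ^ 2 ≤ ((S * S).trace).re := by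
    have h1 : ((S * S).trace).re = ∑ s, ∑ t, Complex.normSq (S s t) := by
      simp only [Matrix.trace, Matrix.diag_apply, Matrix.mul_apply, Complex.re_sum]
      refine sum_congr rfl fun s _ => sum_congr rfl fun t _ => ?_
      rw [hts s t, Complex.star_def, Complex.mul_conj, Complex.ofReal_re]
    rw [h1]
    refine sum_le_sum fun s _ => ?_
    have hss : (S s s).re ^ 2 = Complex.normSq (S s s) := by
      rw [Complex.normSq_apply, (diag_re_nonneg_of_posSemidef hSpsd s).2, mul_zero, add_zero, sq]
    rw [hss]
    exact single_le_sum (f := fun t => Complex.normSq (S s t)) (fun t _ => Complex.normSq_nonneg _)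
      (mem_univ s)
  have hCS : (∑ s, (S s s).re) ^ 2 ≤ d * ∑ s, (S s s).re ^ 2 := by
    have h := Finset.sum_mul_sq_le_sq_mul_sq (univ : Finset (Fin d)) (fun _ => (1 : ℝ))
      (fun s => (S s s).re)
    simp only [one_pow, sum_const, card_univ, Fintype.card_fin, nsmul_eq_mul, mul_one, one_mul] at h
    exact h
  -- (3) `Re Tr S = Σ_i Re Tr P_i ≥ Σ_i √X_ii`
  have htrS : (S.trace).re = ∑ i, (P i).trace.re := by
    rw [hS, trace_sum, Complex.re_sum]
  have hsqrt : ∀ i, Real.sqrt (X i i) ≤ ((P i).trace).re := by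
    intro i
    have hXii : X i i = (((P i) * (P i)).trace).re := by rw [← hX i i, Complex.ofReal_re]
    have htr_nonneg : 0 ≤ ((P i).trace).re := by
      rw [show ((P i).trace).re = ∑ s, (P i s s).re by
        simp only [Matrix.trace, Matrix.diag_apply, Complex.re_sum]]
      exact sum_nonneg fun s _ => (diag_re_nonneg_of_posSemidef (hP i) s).1
    calc Real.sqrt (X i i) ≤ Real.sqrt (((P i).trace).re ^ 2) := by
          rw [hXii]; exact Real.sqrt_le_sqrt (trace_sq_re_le_of_posSemidef (hP i))
      _ = ((P i).trace).re := Real.sqrt_sq htr_nonneg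
  have hle1 : ∑ i, Real.sqrt (X i i) ≤ (S.trace).re := by
    rw [htrS]; exact sum_le_sum fun i _ => hsqrt i
  have hnn : 0 ≤ ∑ i, Real.sqrt (X i i) := sum_nonneg fun i _ => Real.sqrt_nonneg _
  -- (4) assemble
  calc (∑ i, Real.sqrt (X i i)) ^ 2 ≤ ((S.trace).re) ^ 2 := by
        exact pow_le_pow_left₀ hnn hle1 2
    _ = (∑ s, (S s s).re) ^ 2 := by rw [hStr]
    _ ≤ d * ∑ s, (S s s).re ^ 2 := hCS
    _ ≤ d * ((S * S).trace).re := by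
        exact mul_le_mul_of_nonneg_left hdiag (Nat.cast_nonneg d)
    _ = d * ∑ i, ∑ j, X i j := by rw [hsum]


/-! ### Discharge of `PrakashEtAl2017_rank_le_cpsdRank_sq`: `rank X ≤ (cpsd-rank X)²` -/

/-- **Discharge of `PrakashEtAl2017_rank_le_cpsdRank_sq`** (§3.3.1: "As `H^d` is isometrically isomorphic to
`ℝ^{d²}`, we have `√rank(X) ≤ cpsd-rank(X)`"): with `P_i = A_i + iB_i` (`A_i` symmetric, `B_i` antisymmetric
real), `X_{ij} = Re Tr(P_i P_j) = Σ_{s,t} (A_i)_{st}(A_j)_{st} + (B_i)_{st}(B_j)_{st} = Σ_{s,t} U_i(s,t) U_j(s,t)`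
for the REAL vectors `U_i = A_i + B_i ∈ ℝ^{d×d}` (the cross terms `Σ_{s,t} A_{st} B'_{st}` vanish: symmetric
against antisymmetric), so `X = U Uᵀ` has rank `≤ d²`. [cite: PrakashEtAl2017, §3.3.1 (p11)] -/
theorem PrakashEtAl2017_rank_le_cpsdRank_sq_holds : PrakashEtAl2017_rank_le_cpsdRank_sq := by
  intro ι _ X d h
  classical
  obtain ⟨P, hP, hX⟩ := h
  have hre : ∀ i s t, (P i t s).re = (P i s t).re := fun i s t => by
    have h := (hP i).1.apply s t
    rw [Complex.star_def] at h
    rw [← h, Complex.conj_re]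
  have him : ∀ i s t, (P i t s).im = -(P i s t).im := fun i s t => by
    have h := (hP i).1.apply s t
    rw [Complex.star_def] at h
    rw [← h, Complex.conj_im, neg_neg]
  -- the real coordinates `U_i(s,t) = Re P_i(s,t) + Im P_i(s,t)`
  let U : Matrix ι (Fin d × Fin d) ℝ := fun i p => (P i p.1 p.2).re + (P i p.1 p.2).im
  -- symmetric × antisymmetric sums vanish
  have hcross : ∀ i j, ∑ p : Fin d × Fin d, (P i p.1 p.2).re * (P j p.1 p.2).im = 0 := by
    intro i j
    have hswap : ∑ p : Fin d × Fin d, (P i p.1 p.2).re * (P j p.1 p.2).im =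
        ∑ p : Fin d × Fin d, -((P i p.1 p.2).re * (P j p.1 p.2).im) := by
      rw [← Equiv.sum_comp (Equiv.prodComm (Fin d) (Fin d))
        (fun p : Fin d × Fin d => (P i p.1 p.2).re * (P j p.1 p.2).im)]
      refine sum_congr rfl fun p _ => ?_
      simp only [Equiv.prodComm_apply, Prod.fst_swap, Prod.snd_swap]
      rw [hre i p.1 p.2, him j p.1 p.2]
      ring
    rw [sum_neg_distrib] at hswap
    linarith
  have hXU : X = U * Uᵀ := by
    ext i j
    have hc : ((X i j : ℝ) : ℂ) = ∑ p : Fin d × Fin d, P i p.1 p.2 * P j p.2 p.1 := by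
      rw [hX i j]
      simp only [Matrix.trace, Matrix.diag_apply, Matrix.mul_apply]
      rw [← Finset.univ_product_univ, Finset.sum_product]
    have hreal : X i j = ∑ p : Fin d × Fin d, ((P i p.1 p.2).re * (P j p.1 p.2).re +
        (P i p.1 p.2).im * (P j p.1 p.2).im) := by
      have := congrArg Complex.re hc
      rw [Complex.ofReal_re, Complex.re_sum] at this
      rw [this]
      refine sum_congr rfl fun p _ => ?_
      rw [Complex.mul_re, hre j p.1 p.2, him j p.1 p.2]
      ring
    rw [hreal, Matrix.mul_apply]
    have hexp : ∀ p : Fin d × Fin d, U i p * Uᵀ p j = ((P i p.1 p.2).re * (P j p.1 p.2).re +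
        (P i p.1 p.2).im * (P j p.1 p.2).im) + ((P i p.1 p.2).re * (P j p.1 p.2).im +
        (P j p.1 p.2).re * (P i p.1 p.2).im) := by
      intro p
      simp only [U, transpose_apply]
      ring
    have hb : ∑ p : Fin d × Fin d, ((P i p.1 p.2).re * (P j p.1 p.2).im +
        (P j p.1 p.2).re * (P i p.1 p.2).im) = 0 := by
      rw [sum_add_distrib, hcross i j, hcross j i, add_zero]
    symm
    rw [Finset.sum_congr rfl (fun p _ => hexp p), sum_add_distrib, hb, add_zero]
  calc X.rank = (U * Uᵀ).rank := by rw [hXU]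
    _ ≤ U.rank := Matrix.rank_mul_le_left _ _
    _ ≤ Fintype.card (Fin d × Fin d) := Matrix.rank_le_card_width _
    _ = d ^ 2 := by rw [Fintype.card_prod, Fintype.card_fin, sq]


/-! ### Discharge of `PrakashEtAl2017_lemma5`: Gram vectors in `ℝ^{rank X}` -/

/-- `Σ_m (Σ_l R_{ml} b_l)(Σ_{l'} R_{ml'} b'_{l'}) = Σ_{l,l'} b_l b'_{l'} Σ_m R_{ml} R_{ml'}` (bilinear form of
a Gram matrix). [folklore] -/
private theorem sum_mul_sum_swap {ι' : Type} [Fintype ι'] {r : ℕ} (R : ι' → Fin r → ℝ)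
    (bi bj : Fin r → ℝ) :
    ∑ m, (∑ l, R m l * bi l) * (∑ l', R m l' * bj l') =
      ∑ l, ∑ l', bi l * bj l' * ∑ m, R m l * R m l' := by
  calc ∑ m, (∑ l, R m l * bi l) * (∑ l', R m l' * bj l')
      = ∑ m, ∑ l, ∑ l', (R m l * bi l) * (R m l' * bj l') := by
        refine sum_congr rfl fun m _ => ?_
        rw [sum_mul_sum]
    _ = ∑ l, ∑ m, ∑ l', (R m l * bi l) * (R m l' * bj l') := sum_comm
    _ = ∑ l, ∑ l', ∑ m, (R m l * bi l) * (R m l' * bj l') :=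
        sum_congr rfl fun l _ => sum_comm
    _ = ∑ l, ∑ l', bi l * bj l' * ∑ m, R m l * R m l' := by
        refine sum_congr rfl fun l _ => sum_congr rfl fun l' _ => ?_
        rw [mul_sum]
        exact sum_congr rfl fun m _ => by ring

/-- A real psd matrix is a Gram matrix of vectors in `ℝ^{rank X}` (`X = CᵀC`; a rank factorization
`C = A Bᵀ` through `ℝ^{rank X}` gives `X_{ij} = b_iᵀ (AᵀA) b_j = ⟨R b_i, R b_j⟩` with `AᵀA = RᵀR`).
[cite: PrakashEtAl2017, Lemma 5 proof (p10, "Gram vectors of X")] -/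
private theorem exists_gram_fin_rank_of_posSemidef {ι : Type} [Fintype ι] {X : Matrix ι ι ℝ}
    (hX : X.PosSemidef) : ∃ x : ι → Fin X.rank → ℝ, ∀ i j, X i j = ∑ l, x i l * x j l := by
  classical
  obtain ⟨C, hC⟩ := CStarAlgebra.nonneg_iff_eq_star_mul_self.mp hX.nonneg
  have hCT : star C = Cᵀ := by
    rw [star_eq_conjTranspose, conjTranspose_eq_transpose_of_trivial]
  have hrank : C.rank = X.rank := by rw [hC, hCT, Matrix.rank_transpose_mul_self]
  obtain ⟨a, b, hab⟩ := exists_biFactorization_of_rank_le C hrank.le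
  -- the Gram matrix `G = AᵀA` of the columns of `A` and a square root `G = RᵀR`
  let A : Matrix ι (Fin X.rank) ℝ := Matrix.of fun k l => a k l
  have hG : (Aᵀ * A).PosSemidef := by
    simpa [conjTranspose_eq_transpose_of_trivial] using posSemidef_conjTranspose_mul_self A
  obtain ⟨R, hR⟩ := CStarAlgebra.nonneg_iff_eq_star_mul_self.mp hG.nonneg
  have hRT : star R = Rᵀ := by
    rw [star_eq_conjTranspose, conjTranspose_eq_transpose_of_trivial]
  rw [hRT] at hR
  have hGapply : ∀ l l', ∑ k, a k l * a k l' = ∑ m, R m l * R m l' := fun l l' => by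
    have h := congrFun (congrFun hR l) l'
    simp only [Matrix.mul_apply, transpose_apply, A, Matrix.of_apply] at h
    exact h
  refine ⟨fun i m => ∑ l, R m l * b i l, fun i j => ?_⟩
  -- both sides equal `Σ_l Σ_l' b_il b_jl' G_ll'`
  have hXij : X i j = ∑ k, C k i * C k j := by
    rw [hC, hCT, Matrix.mul_apply]
    rfl
  calc X i j = ∑ k, (∑ l, a k l * b i l) * ∑ l', a k l' * b j l' := by
        rw [hXij]
        exact sum_congr rfl fun k _ => by rw [hab k i, hab k j]
    _ = ∑ l, ∑ l', b i l * b j l' * ∑ k, a k l * a k l' := sum_mul_sum_swap a (b i) (b j)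
    _ = ∑ l, ∑ l', b i l * b j l' * ∑ m, R m l * R m l' := by simp_rw [hGapply]
    _ = ∑ m, (∑ l, R m l * b i l) * ∑ l', R m l' * b j l' := (sum_mul_sum_swap R (b i) (b j)).symm

/-- **Discharge of `PrakashEtAl2017_lemma5`** (Lemma 5): with Gram vectors `x_i ∈ ℝ^{rank X}` of the psd
matrix `X`, the rank-one Hermitian psd matrices `P_i = x_i x_iᵀ` satisfy `Tr(P_i P_j) = ⟨x_i,x_j⟩² =
X_{ij}²`, a `CS_+`-factorization of `X ∘ X` of size `rank X`; for a `0/1` psd matrix `X ∘ X = X`.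
[cite: PrakashEtAl2017, Lemma 5 (p10)] -/
theorem PrakashEtAl2017_lemma5_holds : PrakashEtAl2017_lemma5 := by
  intro ι _ X hX
  classical
  obtain ⟨x, hx⟩ := exists_gram_fin_rank_of_posSemidef hX
  let v : ι → Fin X.rank → ℂ := fun i s => ((x i s : ℝ) : ℂ)
  have hvstar : ∀ i, star (v i) = v i := fun i => by
    funext s
    simp [v, Pi.star_apply, Complex.conj_ofReal]
  have hdot : ∀ i j, v i ⬝ᵥ v j = (((X i j : ℝ)) : ℂ) := fun i j => by
    rw [hx i j]
    push_cast
    simp only [dotProduct, v]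
  have hfac : ∀ i j, (((X i j) ^ 2 : ℝ) : ℂ) = (vecMulVec (v i) (v i) * vecMulVec (v j) (v j)).trace := by
    intro i j
    rw [vecMulVec_mul_vecMulVec, trace_vecMulVec, dotProduct_smul, smul_eq_mul, hdot i j]
    push_cast
    ring
  have hpsd : ∀ i, (vecMulVec (v i) (v i)).PosSemidef := fun i => by
    simpa [hvstar i] using posSemidef_vecMulVec_self_star (v i)
  refine ⟨⟨fun i => vecMulVec (v i) (v i), fun i => ⟨hpsd i, rank_vecMulVec_le _ _⟩, hfac⟩,
    fun h01 => ⟨fun i => vecMulVec (v i) (v i), hpsd, fun i j => ?_⟩⟩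
  rw [← hfac i j]
  rcases h01 i j with h | h <;> simp [h]


/-! ### Discharge of `PrakashEtAl2017_lemma4`: compressing a `CS_+`-factorization to a subspace -/

section Lemma4

variable {d m : ℕ} {K : Submodule ℂ (EuclideanSpace ℂ (Fin d))}

/-- `Tr(P Q) = 0` forces `P Q = 0` for Hermitian psd complex `P, Q` (PSVW Lemma 1 (ii): "⟨X,Y⟩ = 0 ⇒
XY = 0 ⇒ ranges orthogonal"; write `Q = Cᴴ C`, then `Tr(P CᴴC) = Σ_l c̄_lᵀ P c̄_l ≥ 0` termwise).
[cite: PrakashEtAl2017, Lemma 1 (ii) (p08)] -/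
private theorem mul_eq_zero_of_posSemidef_trace_eq_zero_complex {P Q : Matrix (Fin d) (Fin d) ℂ}
    (hP : P.PosSemidef) (hQ : Q.PosSemidef) (h : (P * Q).trace = 0) : P * Q = 0 := by
  classical
  obtain ⟨C, hC⟩ := CStarAlgebra.nonneg_iff_eq_star_mul_self.mp hQ.nonneg
  have hQC : Q = Cᴴ * C := by rw [hC, star_eq_conjTranspose]
  have hsum : (P * Q).trace = ∑ l, star (star (C l)) ⬝ᵥ (P *ᵥ star (C l)) := by
    rw [hQC, ← Matrix.mul_assoc, Matrix.trace_mul_comm]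
    simp only [Matrix.trace, Matrix.diag_apply, Matrix.mul_apply, Matrix.conjTranspose_apply,
      dotProduct, Matrix.mulVec, Finset.mul_sum, star_star, Pi.star_apply]
  have hnn : ∀ l, 0 ≤ star (star (C l)) ⬝ᵥ (P *ᵥ star (C l)) := fun l =>
    hP.dotProduct_mulVec_nonneg (star (C l))
  have hzero : ∀ l, star (star (C l)) ⬝ᵥ (P *ᵥ star (C l)) = 0 := by
    have h0 : ∑ l, star (star (C l)) ⬝ᵥ (P *ᵥ star (C l)) = 0 := by rw [← hsum, h]
    exact fun l => (Finset.sum_eq_zero_iff_of_nonneg fun l _ => hnn l).1 h0 l (Finset.mem_univ l)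
  have hker : ∀ l, P *ᵥ star (C l) = 0 := fun l => (hP.dotProduct_mulVec_zero_iff _).1 (hzero l)
  have hPCh : P * Cᴴ = 0 := by
    ext s l
    have := congrFun (hker l) s
    simpa only [Matrix.mul_apply, Matrix.conjTranspose_apply, Matrix.mulVec, dotProduct,
      Matrix.zero_apply, Pi.zero_apply, Pi.star_apply] using this
  rw [hQC, ← Matrix.mul_assoc, hPCh, Matrix.zero_mul]

/-- The `d × m` matrix of an orthonormal basis of a subspace `K ⊆ ℂ^d`. [folklore] -/
private def onbMatrixC (b : OrthonormalBasis (Fin m) ℂ K) : Matrix (Fin d) (Fin m) ℂ :=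
  Matrix.of fun s a => (b a : EuclideanSpace ℂ (Fin d)) s

/-- `QᴴQ = I`. [folklore] -/
private theorem onbMatrixC_conjTranspose_mul_self (b : OrthonormalBasis (Fin m) ℂ K) :
    (onbMatrixC b)ᴴ * onbMatrixC b = 1 := by
  ext a c
  have h := orthonormal_iff_ite.mp b.orthonormal a c
  rw [Submodule.coe_inner] at h
  have h' : ∑ s, star ((b a : EuclideanSpace ℂ (Fin d)) s) * (b c : EuclideanSpace ℂ (Fin d)) s =
      if a = c then 1 else 0 := by
    simpa [PiLp.inner_apply, mul_comm] using h
  rw [Matrix.mul_apply, Matrix.one_apply, ← h']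
  simp only [onbMatrixC, conjTranspose_apply, of_apply]

/-- `Q Qᴴ v = v` for `v ∈ K`. [folklore] -/
private theorem onbMatrixC_proj_mulVec (b : OrthonormalBasis (Fin m) ℂ K)
    {v : EuclideanSpace ℂ (Fin d)} (hv : v ∈ K) :
    (onbMatrixC b * (onbMatrixC b)ᴴ) *ᵥ v.ofLp = v.ofLp := by
  classical
  funext s
  have h := b.sum_repr' ⟨v, hv⟩
  have h2 := congrArg (fun w : K => (w : EuclideanSpace ℂ (Fin d)) s) h
  simp only [Submodule.coe_sum, Submodule.coe_smul, Submodule.coe_inner] at h2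
  have h3 : ∑ a, (inner ℂ (b a : EuclideanSpace ℂ (Fin d)) v) *
      (b a : EuclideanSpace ℂ (Fin d)) s = v s := by
    simpa [WithLp.ofLp_sum, Finset.sum_apply, smul_eq_mul] using h2
  rw [← mulVec_mulVec]
  change _ = v s
  rw [← h3]
  simp only [mulVec, dotProduct, onbMatrixC, conjTranspose_apply, of_apply]
  refine sum_congr rfl fun a _ => ?_
  rw [mul_comm]
  congr 1
  simp [PiLp.inner_apply, mul_comm]

/-- `Q Qᴴ A = A` when the columns of `A` lie in `K`. [folklore] -/
private theorem onbMatrixC_proj_mul (b : OrthonormalBasis (Fin m) ℂ K) {A : Matrix (Fin d) (Fin d) ℂ}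
    (hrange : ∀ w : Fin d → ℂ, WithLp.toLp 2 (A *ᵥ w) ∈ K) :
    onbMatrixC b * (onbMatrixC b)ᴴ * A = A := by
  classical
  ext s t
  have h := congrFun (onbMatrixC_proj_mulVec b (hrange (Pi.single t 1))) s
  simp only [mulVec_mulVec] at h
  simpa [Matrix.mulVec_single_one] using h

/-- Compression to `K`: `Tr(QᴴAQ · QᴴBQ) = Tr(A B)` for Hermitian `A` with columns in `K`. [folklore] -/
private theorem trace_compressC (b : OrthonormalBasis (Fin m) ℂ K) {A B : Matrix (Fin d) (Fin d) ℂ}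
    (hA : Aᴴ = A) (hrange : ∀ w : Fin d → ℂ, WithLp.toLp 2 (A *ᵥ w) ∈ K) :
    ((onbMatrixC b)ᴴ * A * onbMatrixC b * ((onbMatrixC b)ᴴ * B * onbMatrixC b)).trace =
      (A * B).trace := by
  set Q := onbMatrixC b with hQ
  have hPA : Q * Qᴴ * A = A := onbMatrixC_proj_mul b hrange
  have hAP : A * (Q * Qᴴ) = A := by
    have h := congrArg conjTranspose hPA
    rw [conjTranspose_mul, conjTranspose_mul, conjTranspose_conjTranspose, hA] at h
    exact h
  calc (Qᴴ * A * Q * (Qᴴ * B * Q)).trace = ((Qᴴ * A * Q * Qᴴ * B) * Q).trace := by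
        simp only [Matrix.mul_assoc]
    _ = (Q * (Qᴴ * A * Q * Qᴴ * B)).trace := Matrix.trace_mul_comm _ _
    _ = ((Q * Qᴴ * A) * (Q * Qᴴ) * B).trace := by simp only [Matrix.mul_assoc]
    _ = (A * B).trace := by rw [hPA, hAP]

end Lemma4

/-- **Discharge of `PrakashEtAl2017_lemma4`** (Lemma 4, `cpsd-rank(X ⊕ Y) ≥ cpsd-rank X + cpsd-rank Y`),
following the printed proof: `Tr(P_i Q_j) = 0` gives `P_i Q_j = 0` (Lemma 1 (ii)); with
`G = ⋂_j ker Q_j` the `P_i` have range in `G` and the `Q_j` in `Gᗮ`, and compressing by orthonormal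
bases (`Z ↦ UᴴZU`) gives `CS_+`-factorizations of `X`, `Y` of sizes `dim G + dim Gᗮ = d`.
[cite: PrakashEtAl2017, Lemma 4 (p10–p11)] -/
theorem PrakashEtAl2017_lemma4_holds : PrakashEtAl2017_lemma4 := by
  intro ι₁ ι₂ _ _ X Y d h
  classical
  obtain ⟨P, hP, hM⟩ := h
  have hX : ∀ i i', ((X i i' : ℝ) : ℂ) = (P (Sum.inl i) * P (Sum.inl i')).trace := fun i i' => by
    simpa using hM (Sum.inl i) (Sum.inl i')
  have hY : ∀ j j', ((Y j j' : ℝ) : ℂ) = (P (Sum.inr j) * P (Sum.inr j')).trace := fun j j' => by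
    simpa using hM (Sum.inr j) (Sum.inr j')
  have hPQ : ∀ i j, P (Sum.inl i) * P (Sum.inr j) = 0 := fun i j =>
    mul_eq_zero_of_posSemidef_trace_eq_zero_complex (hP _) (hP _)
      (by simpa using (hM (Sum.inl i) (Sum.inr j)).symm)
  have hHerm : ∀ i, (P i)ᴴ = P i := fun i => (hP i).1.eq
  have hQP : ∀ i j, P (Sum.inr j) * P (Sum.inl i) = 0 := fun i j => by
    rw [← hHerm (Sum.inr j), ← hHerm (Sum.inl i), ← conjTranspose_mul, hPQ, conjTranspose_zero]
  -- `G = ⋂_j ker Q_j`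
  let G : Submodule ℂ (EuclideanSpace ℂ (Fin d)) :=
    { carrier := {v | ∀ j, P (Sum.inr j) *ᵥ v.ofLp = 0}
      add_mem' := fun {u v} hu hv j => by
        simp only [Set.mem_setOf_eq] at hu hv ⊢
        rw [WithLp.ofLp_add, mulVec_add, hu j, hv j, add_zero]
      zero_mem' := fun j => by simp
      smul_mem' := fun c v hv j => by
        simp only [Set.mem_setOf_eq] at hv ⊢
        rw [WithLp.ofLp_smul, mulVec_smul, hv j, smul_zero] }
  have hPG : ∀ i (w : Fin d → ℂ), WithLp.toLp 2 (P (Sum.inl i) *ᵥ w) ∈ G := fun i w j => by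
    change P (Sum.inr j) *ᵥ (WithLp.toLp 2 (P (Sum.inl i) *ᵥ w)).ofLp = 0
    rw [WithLp.ofLp_toLp, mulVec_mulVec, hQP, zero_mulVec]
  have hQG : ∀ j (w : Fin d → ℂ), WithLp.toLp 2 (P (Sum.inr j) *ᵥ w) ∈ Gᗮ := fun j w => by
    rw [Submodule.mem_orthogonal]
    intro u hu
    have hu' : P (Sum.inr j) *ᵥ u.ofLp = 0 := hu j
    have hinner : inner ℂ u (WithLp.toLp 2 (P (Sum.inr j) *ᵥ w)) =
        star u.ofLp ⬝ᵥ (P (Sum.inr j) *ᵥ w) := by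
      simp [PiLp.inner_apply, dotProduct, mul_comm]
    rw [hinner, dotProduct_mulVec, ← hHerm (Sum.inr j), ← star_mulVec, hu', star_zero,
      zero_dotProduct]
  let bG := stdOrthonormalBasis ℂ G
  let bF := stdOrthonormalBasis ℂ Gᗮ
  have hdim : Module.finrank ℂ G + Module.finrank ℂ Gᗮ = d := by
    rw [Submodule.finrank_add_finrank_orthogonal, finrank_euclideanSpace, Fintype.card_fin]
  refine ⟨Module.finrank ℂ G, Module.finrank ℂ Gᗮ, hdim.le, ?_, ?_⟩
  · refine ⟨fun i => (onbMatrixC bG)ᴴ * P (Sum.inl i) * onbMatrixC bG, fun i => ?_, fun i i' => ?_⟩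
    · exact (hP (Sum.inl i)).conjTranspose_mul_mul_same (onbMatrixC bG)
    · rw [hX i i', trace_compressC bG (hHerm _) (hPG i)]
  · refine ⟨fun j => (onbMatrixC bF)ᴴ * P (Sum.inr j) * onbMatrixC bF, fun j => ?_, fun j j' => ?_⟩
    · exact (hP (Sum.inr j)).conjTranspose_mul_mul_same (onbMatrixC bF)
    · rw [hY j j', trace_compressC bF (hHerm _) (hQG j)]


/-! ### Discharge of `PrakashEtAl2017_thm4`: supports and subspace arrangements -/

section Thm4

variable {d : ℕ}

/-- `⟨M w, N w'⟩ = w^* (M N) w'` for Hermitian `M`. [folklore] -/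
private theorem star_mulVec_dotProduct_mulVec {M N : Matrix (Fin d) (Fin d) ℂ} (hM : Mᴴ = M)
    (w w' : Fin d → ℂ) : star (M *ᵥ w) ⬝ᵥ (N *ᵥ w') = star w ⬝ᵥ ((M * N) *ᵥ w') := by
  rw [star_mulVec, hM, ← dotProduct_mulVec, mulVec_mulVec]

/-- A complex matrix all of whose sesquilinear values `u^* Z w` vanish is zero. [folklore] -/
private theorem eq_zero_of_forall_star_dotProduct_mulVec {Z : Matrix (Fin d) (Fin d) ℂ}
    (h : ∀ u w : Fin d → ℂ, star u ⬝ᵥ (Z *ᵥ w) = 0) : Z = 0 := by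
  classical
  ext s t
  have := h (Pi.single s 1) (Pi.single t 1)
  rw [Matrix.mulVec_single_one, ← Pi.single_star, star_one, single_dotProduct, one_mul] at this
  simpa using this

/-- The inner product of `ℂ^d` in matrix terms. [folklore] -/
private theorem inner_eq_star_dotProduct' (u v : EuclideanSpace ℂ (Fin d)) :
    inner ℂ u v = star u.ofLp ⬝ᵥ v.ofLp := by
  simp [PiLp.inner_apply, dotProduct, mul_comm]

/-- For Hermitian psd `P, Q`: `Tr(P Q) = 0 ↔ P Q = 0`. [cite: PrakashEtAl2017, Lemma 1 (ii) (p08)] -/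
private theorem trace_mul_eq_zero_iff_of_posSemidef {P Q : Matrix (Fin d) (Fin d) ℂ}
    (hP : P.PosSemidef) (hQ : Q.PosSemidef) : (P * Q).trace = 0 ↔ P * Q = 0 :=
  ⟨mul_eq_zero_of_posSemidef_trace_eq_zero_complex hP hQ, fun h => by rw [h, trace_zero]⟩

/-- The column space of a complex matrix as a subspace of `ℂ^d`. [folklore] -/
private def colSpaceC (M : Matrix (Fin d) (Fin d) ℂ) : Submodule ℂ (EuclideanSpace ℂ (Fin d)) where
  carrier := Set.range fun w : Fin d → ℂ => WithLp.toLp 2 (M *ᵥ w)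
  add_mem' := by
    rintro _ _ ⟨w, rfl⟩ ⟨w', rfl⟩
    exact ⟨w + w', by simp only [mulVec_add, WithLp.toLp_add]⟩
  zero_mem' := ⟨0, by simp only [mulVec_zero, WithLp.toLp_zero]⟩
  smul_mem' := by
    rintro c _ ⟨w, rfl⟩
    exact ⟨c • w, by simp only [mulVec_smul, WithLp.toLp_smul]⟩

/-- Orthogonality of column spaces of Hermitian matrices: `col(M) ⟂ col(N) ↔ M N = 0`. [folklore] -/
private theorem colSpaceC_isOrtho_iff {M N : Matrix (Fin d) (Fin d) ℂ} (hM : Mᴴ = M) :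
    colSpaceC M ⟂ colSpaceC N ↔ M * N = 0 := by
  rw [Submodule.isOrtho_iff_inner_eq]
  constructor
  · intro h
    refine eq_zero_of_forall_star_dotProduct_mulVec fun u w => ?_
    have := h _ ⟨u, rfl⟩ _ ⟨w, rfl⟩
    rwa [inner_eq_star_dotProduct', WithLp.ofLp_toLp, WithLp.ofLp_toLp,
      star_mulVec_dotProduct_mulVec hM] at this
  · rintro h _ ⟨u, rfl⟩ _ ⟨w, rfl⟩
    rw [inner_eq_star_dotProduct', WithLp.ofLp_toLp, WithLp.ofLp_toLp,
      star_mulVec_dotProduct_mulVec hM, h, zero_mulVec, dotProduct_zero]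

/-- The orthogonal projection matrix `U Uᴴ` of a subspace `K ⊆ ℂ^d` (from an orthonormal basis) has
column space exactly `K`. [folklore] -/
private theorem colSpaceC_proj_eq {m : ℕ} {K : Submodule ℂ (EuclideanSpace ℂ (Fin d))}
    (b : OrthonormalBasis (Fin m) ℂ K) : colSpaceC (onbMatrixC b * (onbMatrixC b)ᴴ) = K := by
  classical
  have hcol : ∀ v : Fin m → ℂ, WithLp.toLp 2 (onbMatrixC b *ᵥ v) ∈ K := fun v => by
    have hrepr : WithLp.toLp 2 (onbMatrixC b *ᵥ v) =
        ∑ a, v a • (b a : EuclideanSpace ℂ (Fin d)) := by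
      ext s
      simp [onbMatrixC, mulVec, dotProduct, WithLp.ofLp_sum, Finset.sum_apply, mul_comm]
    rw [hrepr]
    exact Submodule.sum_mem _ fun a _ => Submodule.smul_mem _ _ (b a).2
  ext v
  constructor
  · rintro ⟨w, rfl⟩
    show WithLp.toLp 2 ((onbMatrixC b * (onbMatrixC b)ᴴ) *ᵥ w) ∈ K
    rw [← mulVec_mulVec]
    exact hcol _
  · intro hv
    refine ⟨v.ofLp, ?_⟩
    show WithLp.toLp 2 ((onbMatrixC b * (onbMatrixC b)ᴴ) *ᵥ v.ofLp) = v
    rw [onbMatrixC_proj_mulVec b hv, WithLp.toLp_ofLp]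

end Thm4

/-- **Discharge of `PrakashEtAl2017_thm4`** (Theorem 4), following the printed proof: (⇒) take
`L_i = range P_i`; `L_i ⊥ L_j ⟺ P_iP_j = 0 ⟺ Tr(P_iP_j) = 0 ⟺ X_{ij} = 0` (Lemma 1 (ii));
(⇐) take `X = Gram(Pr_{L_1}, …, Pr_{L_n})` for the orthogonal projectors `Pr_{L_i} = U_iU_iᴴ`, whose
ranges are the `L_i`. [cite: PrakashEtAl2017, Thm. 4 (p11)] -/
theorem PrakashEtAl2017_thm4_holds : PrakashEtAl2017_thm4 := by
  intro ι _ _ G d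
  classical
  constructor
  · rintro ⟨X, hsupp, P, hP, hX⟩
    refine ⟨fun i => colSpaceC (P i), fun i j hij => ?_⟩
    rw [colSpaceC_isOrtho_iff (hP i).1.eq, ← trace_mul_eq_zero_iff_of_posSemidef (hP i) (hP j),
      ← hX i j, Complex.ofReal_eq_zero, ← not_iff_not]
    exact (hsupp i j hij).trans not_not.symm
  · rintro ⟨L, hL⟩
    let U : ∀ i, Matrix (Fin d) (Fin (Module.finrank ℂ (L i))) ℂ :=
      fun i => onbMatrixC (stdOrthonormalBasis ℂ (L i))
    let Pr : ι → Matrix (Fin d) (Fin d) ℂ := fun i => U i * (U i)ᴴ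
    have hPrpsd : ∀ i, (Pr i).PosSemidef := fun i => posSemidef_self_mul_conjTranspose (U i)
    have hPrherm : ∀ i, (Pr i)ᴴ = Pr i := fun i => (hPrpsd i).1.eq
    have hcol : ∀ i, colSpaceC (Pr i) = L i := fun i => colSpaceC_proj_eq (stdOrthonormalBasis ℂ (L i))
    have htr : ∀ i j, 0 ≤ (Pr i * Pr j).trace := fun i j =>
      trace_mul_nonneg_of_posSemidef_complex (hPrpsd i) (hPrpsd j)
    have hre : ∀ i j, ((((Pr i * Pr j).trace).re : ℝ) : ℂ) = (Pr i * Pr j).trace := fun i j =>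
      Complex.ext (by simp) (by simpa using (Complex.nonneg_iff.mp (htr i j)).2)
    refine ⟨fun i j => ((Pr i * Pr j).trace).re, fun i j hij => ?_, Pr, hPrpsd, fun i j => hre i j⟩
    have h1 : ((Pr i * Pr j).trace).re = 0 ↔ (Pr i * Pr j).trace = 0 := by
      constructor
      · intro h; rw [← hre i j, h, Complex.ofReal_zero]
      · intro h; rw [h, Complex.zero_re]
    rw [← not_iff_not, not_not, h1, trace_mul_eq_zero_iff_of_posSemidef (hPrpsd i) (hPrpsd j),
      ← colSpaceC_isOrtho_iff (hPrherm i), hcol, hcol]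
    exact hL i j hij


/-! ### Discharge of `PrakashEtAl2017_cor1`: the Gram–Lorentz matrix of Corollary 1 is not cp -/

section Cor1

open Real

/-- `Σ_{j<ℓ} cos(2πj/ℓ) = 0` and `Σ_{j<ℓ} sin(2πj/ℓ) = 0` for `ℓ ≥ 2` (real and imaginary parts of the
vanishing sum of the `ℓ`-th roots of unity) — the computation "`Σ_{k=0}^{ℓ−1} p_{2k} = ℓ·(1,0,0)`" of
Corollary 1. [cite: PrakashEtAl2017, Cor. 1 (p14)] -/
private theorem sum_cos_eq_zero_and_sum_sin_eq_zero {ℓ : ℕ} (hℓ : 2 ≤ ℓ) :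
    (∑ j : Fin ℓ, Real.cos (2 * π * j / ℓ)) = 0 ∧ (∑ j : Fin ℓ, Real.sin (2 * π * j / ℓ)) = 0 := by
  have hζ := Complex.isPrimitiveRoot_exp ℓ (by omega)
  have hsum := hζ.geom_sum_eq_zero (by omega)
  rw [Finset.sum_range] at hsum
  have hterm : ∀ j : Fin ℓ, Complex.exp (2 * π * Complex.I / ℓ) ^ (j : ℕ) =
      Complex.exp ((2 * π * j / ℓ : ℝ) * Complex.I) := by
    intro j
    rw [← Complex.exp_nat_mul]
    congr 1
    push_cast
    ring
  simp only [hterm] at hsum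
  have hre := congrArg Complex.re hsum
  have him := congrArg Complex.im hsum
  rw [Complex.re_sum] at hre
  rw [Complex.im_sum] at him
  simp only [Complex.exp_ofReal_mul_I_re, Complex.zero_re, Complex.exp_ofReal_mul_I_im,
    Complex.zero_im] at hre him
  exact ⟨hre, him⟩

/-- **Discharge of `PrakashEtAl2017_cor1`** (Corollary 1: for `n = 2ℓ`, `ℓ ≥ 3` odd, the Gram matrix
`X` of the Lorentz-cone vectors `p_k = (1, cos(2πk/n), sin(2πk/n))` is not completely positive),
following the printed route through Theorem 8 and Lemma 8, specialised: a nonnegative Gram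
factorization `{a_k}` of `X` inherits every linear relation of the `p_k` (Lemma 8: `‖Σ μ_k a_k‖² =
‖Σ μ_k p_k‖²`), so `a_k + a_{k+ℓ}` is the same vector `2a` for all `k` (from `(p_k + p_{k+ℓ})/2 =
(1,0,0)`) and `Σ_{k<ℓ} a_{2k} = ℓ a` (from `Σ_k p_{2k} = ℓ(1,0,0)`); `⟨a_k, a_{k+ℓ}⟩ = ⟨p_k, p_{k+ℓ}⟩ = 0`
with nonnegative entries forces each coordinate of `a_k` to be `0` or `2a(r)` (the printed
`b_i = s_i ∘ a`), and then `Σ_{k<ℓ} a_{2k}(r) = ℓ a(r)` at a coordinate with `a(r) ≠ 0` says that `ℓ` is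
even — the parity contradiction of the proof of Theorem 8. [cite: PrakashEtAl2017, Cor. 1 (p14), Thm. 8 and Lemma 8 (p13–p14)] -/
theorem PrakashEtAl2017_cor1_holds : PrakashEtAl2017_cor1 := by
  rintro ℓ hℓ hodd ⟨d, a, ha, hX⟩
  -- angles and the Gram entries
  have hℓ0 : (ℓ : ℝ) ≠ 0 := by
    have : (3 : ℝ) ≤ ℓ := by exact_mod_cast hℓ
    intro h
    linarith
  set θ : Fin (2 * ℓ) → ℝ := fun k => 2 * π * k / ↑(2 * ℓ) with hθ
  have hG : ∀ k k' : Fin (2 * ℓ), ∑ r, a k r * a k' r =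
      1 + Real.cos (θ k) * Real.cos (θ k') + Real.sin (θ k) * Real.sin (θ k') := by
    intro k k'
    rw [← hX k k']
    simp only [cyclicLorentzGram, hθ]
  -- the pairs `(k, k+ℓ)`, `k < ℓ`, and the even indices `2i`, `i < ℓ`
  let f : Fin ℓ → Fin (2 * ℓ) := fun j => ⟨j, by omega⟩
  let g : Fin ℓ → Fin (2 * ℓ) := fun j => ⟨j + ℓ, by omega⟩
  let e : Fin ℓ → Fin (2 * ℓ) := fun i => ⟨2 * i, by omega⟩
  have hθg : ∀ j, θ (g j) = θ (f j) + π := by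
    intro j
    simp only [hθ, f, g, Nat.cast_add, Nat.cast_mul, Nat.cast_ofNat]
    field_simp
  have hcos_g : ∀ j, Real.cos (θ (g j)) = -Real.cos (θ (f j)) := fun j => by
    rw [hθg, Real.cos_add_pi]
  have hsin_g : ∀ j, Real.sin (θ (g j)) = -Real.sin (θ (f j)) := fun j => by
    rw [hθg, Real.sin_add_pi]
  have hθe : ∀ i : Fin ℓ, θ (e i) = 2 * π * (i : ℕ) / ℓ := by
    intro i
    simp only [hθ, e, Nat.cast_mul, Nat.cast_ofNat]
    field_simp
  obtain ⟨hcos_e, hsin_e⟩ : (∑ i : Fin ℓ, Real.cos (θ (e i))) = 0 ∧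
      (∑ i : Fin ℓ, Real.sin (θ (e i))) = 0 := by
    simp only [hθe]
    exact sum_cos_eq_zero_and_sum_sin_eq_zero (by omega)
  have hzero : (0 : ℕ) < ℓ := by omega
  set j₀ : Fin ℓ := ⟨0, hzero⟩ with hj₀
  have hθf0 : θ (f j₀) = 0 := by simp [hθ, f, hj₀]
  -- Lemma 8: linear relations among the `p_k` transfer to the `a_k`
  have transfer : ∀ μ : Fin (2 * ℓ) → ℝ, ∑ k, μ k = 0 → ∑ k, μ k * Real.cos (θ k) = 0 →
      ∑ k, μ k * Real.sin (θ k) = 0 → ∀ r, ∑ k, μ k * a k r = 0 := by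
    intro μ h1 h2 h3
    have hsq : ∑ r, (∑ k, μ k * a k r) ^ 2 =
        (∑ k, μ k) ^ 2 + (∑ k, μ k * Real.cos (θ k)) ^ 2 + (∑ k, μ k * Real.sin (θ k)) ^ 2 := by
      have hl : ∀ r, (∑ k, μ k * a k r) ^ 2 = ∑ k, ∑ k', μ k * μ k' * (a k r * a k' r) := by
        intro r
        rw [sq, Finset.sum_mul_sum]
        exact sum_congr rfl fun k _ => sum_congr rfl fun k' _ => by ring
      simp only [hl]
      rw [Finset.sum_comm]
      have h2' : ∑ k, ∑ r, ∑ k', μ k * μ k' * (a k r * a k' r) =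
          ∑ k, ∑ k', μ k * μ k' * ∑ r, a k r * a k' r := by
        refine sum_congr rfl fun k _ => ?_
        rw [Finset.sum_comm]
        exact sum_congr rfl fun k' _ => by rw [Finset.mul_sum]
      rw [h2']
      simp only [hG, sq, Finset.sum_mul_sum, ← Finset.sum_add_distrib]
      exact sum_congr rfl fun k _ => sum_congr rfl fun k' _ => by ring
    rw [h1, h2, h3] at hsq
    norm_num at hsq
    intro r
    have h := (Finset.sum_eq_zero_iff_of_nonneg fun r _ => sq_nonneg (∑ k, μ k * a k r)).mp hsq r
      (mem_univ r)
    exact (pow_eq_zero_iff two_ne_zero).mp h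
  -- (i): `a_k + a_{k+ℓ} = a_0 + a_ℓ` for every pair
  have hpair : ∀ j r, a (f j) r + a (g j) r = a (f j₀) r + a (g j₀) r := by
    intro j r
    have hfg : ∀ j, f j ≠ g j := fun j h => by
      have := congrArg Fin.val h
      simp [f, g] at this
      omega
    have h := transfer (fun k => (if k = f j then 1 else 0) + (if k = g j then 1 else 0) -
        (if k = f j₀ then 1 else 0) - (if k = g j₀ then 1 else 0)) ?_ ?_ ?_ r
    · simp only [sub_mul, add_mul, ite_mul, one_mul, zero_mul, Finset.sum_sub_distrib,
        Finset.sum_add_distrib, Finset.sum_ite_eq', Finset.mem_univ, if_true] at h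
      linarith
    · simp only [Finset.sum_sub_distrib, Finset.sum_add_distrib, Finset.sum_ite_eq', Finset.mem_univ,
        if_true]
      ring
    · simp only [sub_mul, add_mul, ite_mul, one_mul, zero_mul, Finset.sum_sub_distrib,
        Finset.sum_add_distrib, Finset.sum_ite_eq', Finset.mem_univ, if_true, hcos_g]
      ring
    · simp only [sub_mul, add_mul, ite_mul, one_mul, zero_mul, Finset.sum_sub_distrib,
        Finset.sum_add_distrib, Finset.sum_ite_eq', Finset.mem_univ, if_true, hsin_g]
      ring
  -- (ii): `⟨a_k, a_{k+ℓ}⟩ = 0` with nonnegative entries: complementary supports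
  have hcompl : ∀ j r, a (f j) r = 0 ∨ a (g j) r = 0 := by
    intro j r
    have h0 : ∑ r, a (f j) r * a (g j) r = 0 := by
      rw [hG, hcos_g, hsin_g]
      nlinarith [Real.cos_sq_add_sin_sq (θ (f j))]
    have h := (Finset.sum_eq_zero_iff_of_nonneg fun r _ => mul_nonneg (ha (f j) r) (ha (g j) r)).mp
      h0 r (mem_univ r)
    exact mul_eq_zero.mp h
  -- (iii): `Σ_{i<ℓ} a_{2i} = (ℓ/2)(a_0 + a_ℓ)`
  have hodd_sum : ∀ r, ∑ i : Fin ℓ, a (e i) r = (ℓ / 2 : ℝ) * (a (f j₀) r + a (g j₀) r) := by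
    intro r
    -- the coefficient vector of the relation and its pairing with any `F`
    have hμ : ∀ F : Fin (2 * ℓ) → ℝ,
        ∑ k, ((∑ i : Fin ℓ, if k = e i then (1 : ℝ) else 0) - (ℓ / 2 : ℝ) * (if k = f j₀ then 1 else 0)
          - (ℓ / 2 : ℝ) * (if k = g j₀ then 1 else 0)) * F k =
          ∑ i : Fin ℓ, F (e i) - (ℓ / 2 : ℝ) * F (f j₀) - (ℓ / 2 : ℝ) * F (g j₀) := by
      intro F
      have h1 : ∑ k : Fin (2 * ℓ), (∑ i : Fin ℓ, if k = e i then (1 : ℝ) else 0) * F k =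
          ∑ i : Fin ℓ, F (e i) := by
        rw [show (∑ k : Fin (2 * ℓ), (∑ i : Fin ℓ, if k = e i then (1 : ℝ) else 0) * F k) =
            ∑ k : Fin (2 * ℓ), ∑ i : Fin ℓ, (if k = e i then (1 : ℝ) else 0) * F k from
            sum_congr rfl fun k _ => Finset.sum_mul _ _ _, Finset.sum_comm]
        simp only [ite_mul, one_mul, zero_mul, Finset.sum_ite_eq', Finset.mem_univ, if_true]
      have h2 : ∀ k₀ : Fin (2 * ℓ), ∑ k : Fin (2 * ℓ), (ℓ / 2 : ℝ) * (if k = k₀ then 1 else 0) * F k =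
          (ℓ / 2 : ℝ) * F k₀ := by
        intro k₀
        simp only [mul_ite, mul_one, mul_zero, ite_mul, zero_mul, Finset.sum_ite_eq', Finset.mem_univ,
          if_true]
      simp only [sub_mul, Finset.sum_sub_distrib, h1, h2]
    have h := transfer (fun k => (∑ i : Fin ℓ, if k = e i then (1 : ℝ) else 0) -
        (ℓ / 2 : ℝ) * (if k = f j₀ then 1 else 0) - (ℓ / 2 : ℝ) * (if k = g j₀ then 1 else 0))
        ?_ ?_ ?_ r
    · rw [hμ] at h
      linarith
    · have h1 := hμ fun _ => 1
      simp only [mul_one, Finset.sum_const, Finset.card_univ, Fintype.card_fin, nsmul_eq_mul] at h1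
      rw [h1]
      ring
    · rw [hμ, hcos_e, hcos_g]
      ring
    · rw [hμ, hsin_e, hsin_g]
      ring
  -- a coordinate `r` where `S_r = a_0(r) + a_ℓ(r) ≠ 0` (else `a_0 = 0`, but `‖a_0‖² = ‖p_0‖² = 2`)
  obtain ⟨r, hr⟩ : ∃ r, a (f j₀) r + a (g j₀) r ≠ 0 := by
    by_contra h
    push Not at h
    have h0 : ∀ r, a (f j₀) r = 0 := fun r => by
      have := h r
      linarith [ha (f j₀) r, ha (g j₀) r]
    have h2 := hG (f j₀) (f j₀)
    simp only [h0, zero_mul, Finset.sum_const_zero, hθf0, Real.cos_zero, Real.sin_zero] at h2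
    norm_num at h2
  set S := a (f j₀) r + a (g j₀) r with hS
  -- every `a_k(r)` is `0` or `S`
  have hval : ∀ k : Fin (2 * ℓ), a k r = 0 ∨ a k r = S := by
    intro k
    by_cases hk : (k : ℕ) < ℓ
    · have hkf : k = f ⟨k, hk⟩ := Fin.ext (by simp [f])
      rcases hcompl ⟨k, hk⟩ r with h | h
      · left
        rwa [hkf]
      · right
        have := hpair ⟨k, hk⟩ r
        rw [h, add_zero] at this
        rwa [hkf]
    · have hk' : (k : ℕ) - ℓ < ℓ := by omega
      have hkg : k = g ⟨k - ℓ, hk'⟩ := Fin.ext (by simp [g]; omega)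
      rcases hcompl ⟨k - ℓ, hk'⟩ r with h | h
      · right
        have := hpair ⟨k - ℓ, hk'⟩ r
        rw [h, zero_add] at this
        rwa [hkg]
      · left
        rwa [hkg]
  -- counting: `Σ_i a_{2i}(r) = S · #{i : a_{2i}(r) ≠ 0} = (ℓ/2) S`, so `ℓ` is even
  classical
  set N := (univ.filter fun i : Fin ℓ => a (e i) r ≠ 0).card with hN
  have hcount : ∑ i : Fin ℓ, a (e i) r = S * N := by
    have hterm : ∀ i : Fin ℓ, a (e i) r = if a (e i) r ≠ 0 then S else 0 := by
      intro i
      split_ifs with h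
      · exact (hval (e i)).resolve_left h
      · push Not at h
        exact h
    rw [sum_congr rfl fun i _ => hterm i, Finset.sum_ite, Finset.sum_const_zero, add_zero,
      Finset.sum_const, nsmul_eq_mul, mul_comm]
  have hℓN : (ℓ : ℝ) = 2 * N := by
    have h := hodd_sum r
    rw [hcount] at h
    field_simp at h
    -- `S * N * 2 = ℓ * S` (up to normal form); cancel `S ≠ 0`
    have hS0 : S ≠ 0 := hr
    have : S * (2 * N - ℓ) = 0 := by linarith
    rcases mul_eq_zero.mp this with h' | h'
    · exact absurd h' hS0
    · linarith
  have hℓN' : ℓ = 2 * N := by exact_mod_cast hℓN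
  exact (Nat.not_even_iff_odd.mpr hodd) ⟨N, by omega⟩

end Cor1

/-! ### Theorem 6: the printed case `m = 2` fails; scope-corrected statement -/

section Thm6

/-- **`PrakashEtAl2017_thm6` is false as printed/typed, because of the degenerate case `m = 2`
(`k = 1`)**: there `d = 2^{⌊(m−1)/2⌋} = 1`, and no `ℝ`-linear `Γ : ℝ² → H¹ = ℝ` is an isometry
(`Tr(Γ(p)Γ(q)) = ⟨p,q⟩` forces `a² = b² = 1`, `ab = 0` for the two scalars `a = Γ(e₁)`, `b = Γ(e₂)`).
Equivalently, the printed Theorem 5 fails for `n = 1`: `γ(e₁) = Z^{⊗0} = [1]` is not traceless. For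
every `m ≠ 2` the printed statement stands (`PrakashEtAl2017_thm6'`); for `m = 2` it holds with `d = 2`
(`Γ(c,x) = (cI₂ + xZ)/√2`). [cite: PrakashEtAl2017, Thm. 6 (p13); Thm. 5 (p13)] -/
theorem PrakashEtAl2017_thm6_false : ¬ PrakashEtAl2017_thm6 := by
  intro h
  obtain ⟨Γ, -, htr, -⟩ := h 1
  have hd : 2 ^ (1 / 2) = 1 := by norm_num
  have h0 : 0 < 2 ^ (1 / 2) := by rw [hd]; exact Nat.one_pos
  have huniq : ∀ i : Fin (2 ^ (1 / 2)), i = ⟨0, h0⟩ := fun i =>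
    Fin.ext (by have hi : (i : ℕ) < 1 := lt_of_lt_of_eq i.2 hd; show (i : ℕ) = 0; omega)
  have key : ∀ A B : Matrix (Fin (2 ^ (1 / 2))) (Fin (2 ^ (1 / 2))) ℂ,
      (A * B).trace = A ⟨0, h0⟩ ⟨0, h0⟩ * B ⟨0, h0⟩ ⟨0, h0⟩ := by
    intro A B
    simp only [Matrix.trace, Matrix.diag_apply, Matrix.mul_apply]
    rw [Finset.sum_eq_single ⟨0, h0⟩ (fun i _ hi => absurd (huniq i) hi) (by simp),
      Finset.sum_eq_single ⟨0, h0⟩ (fun i _ hi => absurd (huniq i) hi) (by simp)]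
  -- the two scalars `a = Γ(1,0)`, `b = Γ(0,1)`
  have haa := htr (1, fun _ => 0) (1, fun _ => 0)
  have hbb := htr (0, fun _ => 1) (0, fun _ => 1)
  have hab := htr (1, fun _ => 0) (0, fun _ => 1)
  rw [key] at haa hbb hab
  simp only [mul_one, mul_zero, Finset.sum_const_zero, add_zero, zero_add, Fin.sum_univ_one,
    Complex.ofReal_one, Complex.ofReal_zero] at haa hbb hab
  have h1 : (Γ (1, fun _ => 0) ⟨0, h0⟩ ⟨0, h0⟩ * Γ (0, fun _ => 1) ⟨0, h0⟩ ⟨0, h0⟩) ^ 2 = 1 := by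
    rw [mul_pow, sq, sq, haa, hbb, mul_one]
  rw [hab] at h1
  norm_num at h1

/-- **PSVW Theorem 6, scope-corrected** (Fawzi–Wei; p13): "Set `d := 2^{⌊(m−1)/2⌋}`. There exists an
isometry `Γ : ℝ^m → H^d` such that `L_m = {(c,x) ∈ ℝ × ℝ^{m−1} : Γ((c,x)) ∈ H^d_+}`", for every `m ≠ 2`
(typed with `m = k + 1`, `k ≠ 1`; the printed `m = 2` case is false, `PrakashEtAl2017_thm6_false`, and
holds instead with `d = 2`). Proof route as printed: `Γ((c,x)) = (cI_d + γ(x))/√d` with the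
Brauer–Weyl/Clifford matrices of Theorem 5 (traceless for `n = m − 1 ≠ 1`).
[cite: PrakashEtAl2017, Thm. 6 (p13)] -/
def PrakashEtAl2017_thm6' : Prop :=
  ∀ k : ℕ, k ≠ 1 → ∃ Γ : (ℝ × (Fin k → ℝ)) →ₗ[ℝ] Matrix (Fin (2 ^ (k / 2))) (Fin (2 ^ (k / 2))) ℂ,
    (∀ p, (Γ p).IsHermitian) ∧
    (∀ p q, (Γ p * Γ q).trace = (((p.1 * q.1 + ∑ l, p.2 l * q.2 l : ℝ)) : ℂ)) ∧
    ∀ p, (Γ p).PosSemidef ↔ Real.sqrt (∑ l, p.2 l ^ 2) ≤ p.1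

end Thm6

/-! ### Discharge of `PrakashEtAl2017_thm6'`: the Brauer–Weyl matrices of Theorem 5 -/

section Clifford

open Clifford

/-! The Brauer–Weyl / Jordan–Wigner matrices `gen`, `gam` and their API (`gam_add`, `gam_smul`,
`gam_isHermitian`, `trace_gam`, `gam_anticomm`, `gam_mul_self`, `trace_gam_mul_gam`,
`posSemidef_one_add_gam_iff`, `card_bits`) live in `BrauerWeylCliffordMatrices.lean` (namespace
`Literature.Combinatorics.Optimization.Clifford`; moved out of this file 2026-08-28, verbatim, together with
the stand-alone Theorem 5 `Clifford.PrakashEtAl2017_thm5`). -/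

/-- **Theorem 6 for `m ≠ 2`** (the discharge of `PrakashEtAl2017_thm6'`): the ℝ-linear map
`Γ((c,x)) = (cI_d + γ(x))/√d`, transported to `Fin d` indices, is Hermitian-valued, satisfies
`Tr(Γ(p)Γ(q)) = ⟨p,q⟩`, and `Γ((c,x)) ⪰ 0 ↔ ‖x‖ ≤ c`. [cite: PrakashEtAl2017, Thm. 6 (p13)] -/
theorem exists_lorentz_isometry {k : ℕ} (hk : k ≠ 1) :
    ∃ Γ : (ℝ × (Fin k → ℝ)) →ₗ[ℝ] Matrix (Fin (2 ^ (k / 2))) (Fin (2 ^ (k / 2))) ℂ,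
      (∀ p, (Γ p).IsHermitian) ∧
      (∀ p q, (Γ p * Γ q).trace = (((p.1 * q.1 + ∑ l, p.2 l * q.2 l : ℝ)) : ℂ)) ∧
      ∀ p, (Γ p).PosSemidef ↔ Real.sqrt (∑ l, p.2 l ^ 2) ≤ p.1 := by
  classical
  have hcard : Fintype.card (Fin (k / 2) → Bool) = 2 ^ (k / 2) := card_bits k
  let e : (Fin (k / 2) → Bool) ≃ Fin (2 ^ (k / 2)) := Fintype.equivFinOfCardEq hcard
  set d : ℝ := (Fintype.card (Fin (k / 2) → Bool) : ℝ) with hd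
  have hdpos : 0 < d := by rw [hd]; exact_mod_cast Fintype.card_pos
  set s : ℝ := (Real.sqrt d)⁻¹ with hsdef
  have hs : 0 < s := inv_pos.mpr (Real.sqrt_pos.mpr hdpos)
  have hss : s * s * d = 1 := by
    rw [hsdef, ← mul_inv, Real.mul_self_sqrt hdpos.le, inv_mul_cancel₀ hdpos.ne']
  -- the matrix before transport
  let N : ℝ × (Fin k → ℝ) → Matrix (Fin (k / 2) → Bool) (Fin (k / 2) → Bool) ℂ := fun p =>
    ((p.1 : ℝ) : ℂ) • 1 + gam k p.2
  have hNadd : ∀ p q, N (p + q) = N p + N q := by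
    intro p q
    simp only [N, Prod.fst_add, Prod.snd_add, Complex.ofReal_add, add_smul, gam_add]
    abel
  have hNsmul : ∀ (r : ℝ) (p : ℝ × (Fin k → ℝ)), N (r • p) = ((r : ℝ) : ℂ) • N p := by
    intro r p
    simp only [N, Prod.smul_fst, Prod.smul_snd, smul_eq_mul, Complex.ofReal_mul, mul_smul, gam_smul,
      smul_add]
  have hNH : ∀ p, (N p).IsHermitian := by
    intro p
    change ((((p.1 : ℝ)) : ℂ) • (1 : Matrix _ _ ℂ) + gam k p.2)ᴴ = _
    rw [conjTranspose_add, conjTranspose_smul, conjTranspose_one, (gam_isHermitian k p.2).eq,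
      Complex.star_def, Complex.conj_ofReal]
  have hNtr : ∀ p q, (N p * N q).trace = (((p.1 * q.1 + ∑ l, p.2 l * q.2 l : ℝ)) : ℂ) * d := by
    intro p q
    change ((((p.1 : ℝ) : ℂ) • (1 : Matrix _ _ ℂ) + gam k p.2) * ((((q.1 : ℝ)) : ℂ) • 1 + gam k q.2)).trace = _
    simp only [Matrix.add_mul, Matrix.mul_add, Matrix.smul_mul, Matrix.mul_smul, Matrix.one_mul,
      Matrix.mul_one, trace_add, trace_smul, trace_one, trace_gam hk, trace_gam_mul_gam, smul_eq_mul,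
      mul_zero, add_zero, hd]
    push_cast
    ring
  let Γ : (ℝ × (Fin k → ℝ)) →ₗ[ℝ] Matrix (Fin (2 ^ (k / 2))) (Fin (2 ^ (k / 2))) ℂ :=
    { toFun := fun p => ((s : ℝ) : ℂ) • (N p).submatrix e.symm e.symm
      map_add' := fun p q => by
        simp only [hNadd, submatrix_add, Pi.add_apply, smul_add]
      map_smul' := fun r p => by
        ext i j
        simp only [RingHom.id_apply, hNsmul, Matrix.smul_apply, Matrix.submatrix_apply, smul_eq_mul,
          Complex.real_smul]
        ring }
  have hΓ : ∀ p, Γ p = ((s : ℝ) : ℂ) • (N p).submatrix e.symm e.symm := fun p => rfl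
  refine ⟨Γ, fun p => ?_, fun p q => ?_, fun p => ?_⟩
  · -- Hermitian
    rw [hΓ, IsHermitian, conjTranspose_smul, ((hNH p).submatrix e.symm).eq, Complex.star_def,
      Complex.conj_ofReal]
  · -- isometry
    rw [hΓ, hΓ, Matrix.smul_mul, Matrix.mul_smul, smul_smul, Matrix.submatrix_mul_equiv, trace_smul,
      trace_submatrix_equiv'', hNtr, smul_eq_mul]
    calc ((s : ℝ) : ℂ) * ((s : ℝ) : ℂ) * ((((p.1 * q.1 + ∑ l, p.2 l * q.2 l : ℝ)) : ℂ) * (d : ℂ))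
        = (((s * s * d : ℝ)) : ℂ) * (((p.1 * q.1 + ∑ l, p.2 l * q.2 l : ℝ)) : ℂ) := by push_cast; ring
      _ = _ := by rw [hss, Complex.ofReal_one, one_mul]
  · -- `Γ(p) ⪰ 0 ↔ ‖x‖ ≤ c`
    rw [hΓ, ← posSemidef_one_add_gam_iff hk p.1 p.2]
    constructor
    · intro h
      have h' : ((N p).submatrix e.symm e.symm).PosSemidef := by
        have h2 := h.smul (Complex.zero_le_real.mpr (inv_nonneg.mpr hs.le))
        rwa [smul_smul, ← Complex.ofReal_mul, inv_mul_cancel₀ hs.ne', Complex.ofReal_one, one_smul] at h2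
      exact (posSemidef_submatrix_equiv e.symm).mp h'
    · intro h
      exact ((posSemidef_submatrix_equiv e.symm).mpr h).smul (Complex.zero_le_real.mpr hs.le)

end Clifford

/-- **Discharge of `PrakashEtAl2017_thm6'`** (Theorem 6 for `m ≠ 2`), by the explicit Brauer–Weyl /
Jordan–Wigner generators of Theorem 5 realised as signed bit-flip matrices on `{0,1}^{⌊k/2⌋}`
(`exists_lorentz_isometry`). [cite: PrakashEtAl2017, Thm. 5 and Thm. 6 (p13)] -/
theorem PrakashEtAl2017_thm6'_holds : PrakashEtAl2017_thm6' := fun _ hk => exists_lorentz_isometry hk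

/-! ### Theorem 7, first clause: Gram–Lorentz matrices are cpsd -/

/-- **PSVW Theorem 7, first clause** (p14, verbatim: "For any matrix `X ∈ GL^n` we have that
`X ∈ CS_+^n`"; Fawzi–Wei), PROVED from Theorem 6′: pad the Lorentz vectors `(c_i, x_i) ∈ L_{k+1}` with
two zero coordinates (so that `k + 2 ≠ 1`) and apply the isometry `Γ`, `P_i = Γ((c_i, x_i)) ⪰ 0`,
`Tr(P_iP_j) = ⟨(c_i,x_i),(c_j,x_j)⟩ = X_{ij}`. (The rank-dependent size bound of Theorem 7 needs Lemma 7
and stays the NAMED FACT `PrakashEtAl2017_thm7`.) [cite: PrakashEtAl2017, Thm. 7 (p14)] -/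
theorem IsGramLorentz.isCpsd {ι : Type*} [Fintype ι] {X : Matrix ι ι ℝ} (h : IsGramLorentz X) :
    IsCpsd X := by
  classical
  obtain ⟨k, c, x, hxc, hX⟩ := h
  -- pad to `k + 2` coordinates
  let x' : ι → Fin (k + 2) → ℝ := fun i l => if hl : (l : ℕ) < k then x i ⟨l, hl⟩ else 0
  have hpad : ∀ (f : ℝ → ℝ → ℝ) (i j : ι), f 0 0 = 0 →
      ∑ l, f (x' i l) (x' j l) = ∑ l, f (x i l) (x j l) := by
    intro f i j hf
    rw [Fin.sum_univ_add]
    have h1 : ∑ l : Fin k, f (x' i (Fin.castAdd 2 l)) (x' j (Fin.castAdd 2 l)) = ∑ l, f (x i l) (x j l) := by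
      refine Finset.sum_congr rfl fun l _ => ?_
      have hl : ((Fin.castAdd 2 l : Fin (k + 2)) : ℕ) < k := by simp
      simp only [x', dif_pos hl]
      rfl
    have h2 : ∑ l : Fin 2, f (x' i (Fin.natAdd k l)) (x' j (Fin.natAdd k l)) = 0 := by
      refine Finset.sum_eq_zero fun l _ => ?_
      have hl : ¬ ((Fin.natAdd k l : Fin (k + 2)) : ℕ) < k := by simp
      simp only [x', dif_neg hl]
      exact hf
    rw [h1, h2, add_zero]
  obtain ⟨Γ, -, htr, hpsd⟩ := exists_lorentz_isometry (k := k + 2) (by omega)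
  refine ⟨2 ^ ((k + 2) / 2), fun i => Γ (c i, x' i), fun i => (hpsd _).mpr ?_, fun i j => ?_⟩
  · have h := hpad (fun a _ => a ^ 2) i i (by norm_num)
    change Real.sqrt (∑ l, x' i l ^ 2) ≤ c i
    rw [h]
    exact hxc i
  · rw [htr, hX i j]
    simp only
    rw [hpad (fun a b => a * b) i j (mul_zero 0)]

/-- **PSVW Corollary 1, last sentence** (p14, verbatim: "In particular we have that `X ∈ CS_+^n \ CP^n`"),
now a theorem: the Gram–Lorentz matrix of Corollary 1 is cpsd (`IsGramLorentz.isCpsd`) and not cp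
(`PrakashEtAl2017_cor1_holds`). [cite: PrakashEtAl2017, Cor. 1 (p14)] -/
theorem cyclicLorentzGram_isCpsd_not_isCp {ℓ : ℕ} (hℓ : 3 ≤ ℓ) (hodd : Odd ℓ) :
    IsCpsd (cyclicLorentzGram (2 * ℓ)) ∧ ¬ IsCp (cyclicLorentzGram (2 * ℓ)) :=
  ⟨(isGramLorentz_cyclicLorentzGram (2 * ℓ)).isCpsd, PrakashEtAl2017_cor1_holds ℓ hℓ hodd⟩

/-! ### Discharge of `PrakashEtAl2017_thm7`: `cpsd-rank(X) ≤ 2^{⌊(rank X + 1)/2⌋}` on `GL^n` -/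

section Thm7

/-- Rank is subadditive. [folklore] -/
private theorem rank_add_le' {m n : Type*} [Fintype m] [Fintype n] [DecidableEq n]
    (A B : Matrix m n ℝ) : (A + B).rank ≤ A.rank + B.rank := by
  unfold Matrix.rank
  rw [Matrix.mulVecLin_add]
  calc Module.finrank ℝ (LinearMap.range (A.mulVecLin + B.mulVecLin))
      ≤ Module.finrank ℝ ↥(LinearMap.range A.mulVecLin ⊔ LinearMap.range B.mulVecLin) :=
        Submodule.finrank_mono (LinearMap.range_add_le _ _)
    _ ≤ _ := Submodule.finrank_add_le_finrank_add_finrank _ _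

/-- A real matrix of rank `0` vanishes. [folklore] -/
private theorem eq_zero_of_rank_eq_zero {m n : Type*} [Fintype m] [Fintype n] [DecidableEq n]
    {M : Matrix m n ℝ} (hM : M.rank = 0) : M = 0 := by
  by_contra hne
  obtain ⟨i, j, hij⟩ : ∃ i j, M i j ≠ 0 := by
    by_contra h
    push Not at h
    exact hne (Matrix.ext fun i j => by rw [h i j]; rfl)
  have hpos : 0 < M.rank := by
    unfold Matrix.rank
    refine Module.finrank_pos_iff_exists_ne_zero.mpr
      ⟨⟨M.mulVecLin (Pi.single j 1), LinearMap.mem_range_self _ _⟩, fun h => hij ?_⟩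
    have h' := congrArg (fun v : LinearMap.range M.mulVecLin => (v : m → ℝ) i) h
    simpa [Matrix.mulVec, dotProduct, Pi.single_apply] using h'
  omega

/-- Padding a vector of coordinates by zeros does not change sums of products. [folklore] -/
private theorem sum_dite_castLE {s n : ℕ} (hsn : s ≤ n) (f : Fin s → ℝ) :
    ∑ l : Fin n, (if h : (l : ℕ) < s then f ⟨l, h⟩ else 0) = ∑ l : Fin s, f l := by
  classical
  let emb : Fin s ↪ Fin n := ⟨Fin.castLE hsn, Fin.castLE_injective hsn⟩
  symm
  rw [← Finset.sum_map univ emb (fun l : Fin n => if h : (l : ℕ) < s then f ⟨l, h⟩ else 0)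
    |>.trans (Finset.sum_congr rfl fun l _ => by
      have hl : ((emb l : Fin n) : ℕ) < s := by simp [emb]
      rw [dif_pos hl]
      exact congrArg f (Fin.ext rfl))]
  refine Finset.sum_subset (subset_univ _) fun l _ hl => ?_
  have hl' : ¬ (l : ℕ) < s := fun hlt =>
    hl (Finset.mem_map.mpr ⟨⟨l, hlt⟩, mem_univ _, Fin.ext rfl⟩)
  rw [dif_neg hl']

/-- **PSVW Lemma 7 (compression step) + Theorem 7** (p14, verbatim: "For any matrix `X ∈ GL^n` we have
that `X ∈ CS_+^n` and `cpsd-rank(X) ≤ 2^{⌊(rank(X)+1)/2⌋}`"; "Lemma 7: a Gram–Lorentz matrix has a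
`GL`-factorization in `L_{rank X + 2}`"): writing `X = ccᵀ + Gram(x_i)` with `‖x_i‖ ≤ c_i`, the span of
the `x_i` has dimension `rank Gram(x_i) ≤ rank X + 1`; the coordinates of the `x_i` in an orthonormal
basis of that span give Lorentz vectors in `L_{rank X + 2}` with the same Gram matrix, and Theorem 6′
(`exists_lorentz_isometry`, `k = rank X + 1 ≠ 1` unless `X = 0`) turns them into a `CS_+`-factorization
of size `2^{⌊(rank X + 1)/2⌋}`. This DISCHARGES `PrakashEtAl2017_thm7`.
[cite: PrakashEtAl2017, Lemma 7 and Thm. 7 (p14)] -/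
theorem PrakashEtAl2017_thm7_holds : PrakashEtAl2017_thm7 := by
  intro ι _ X hGL
  classical
  obtain ⟨k, c, x, hxc, hX⟩ := hGL
  set r := X.rank with hr
  rcases Nat.eq_zero_or_pos r with hr0 | hrpos
  · -- `rank X = 0`: `X = 0`, one-dimensional zero factors
    have hX0 : X = 0 := eq_zero_of_rank_eq_zero (hr ▸ hr0)
    refine ⟨fun _ => 0, fun _ => PosSemidef.zero, fun i j => ?_⟩
    simp [hX0]
  -- the span of the `x_i` inside `ℝ^k` and an orthonormal basis of it
  let v : ι → EuclideanSpace ℝ (Fin k) := fun i => WithLp.toLp 2 (x i)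
  have hv : ∀ i l, v i l = x i l := fun i l => rfl
  let U : Submodule ℝ (EuclideanSpace ℝ (Fin k)) := Submodule.span ℝ (Set.range v)
  have hvU : ∀ i, v i ∈ U := fun i => Submodule.subset_span ⟨i, rfl⟩
  set s := Module.finrank ℝ U with hs
  let b : OrthonormalBasis (Fin s) ℝ U := stdOrthonormalBasis ℝ U
  -- coordinates in the basis: same pairwise inner products
  let xt : ι → Fin s → ℝ := fun i l => b.repr ⟨v i, hvU i⟩ l
  have hinner : ∀ i j, ∑ l, xt i l * xt j l = ∑ l, x i l * x j l := by
    intro i j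
    have h := b.sum_inner_mul_inner ⟨v i, hvU i⟩ ⟨v j, hvU j⟩
    rw [Submodule.coe_inner] at h
    have h2 : (inner ℝ (v i) (v j) : ℝ) = ∑ l, x i l * x j l := by
      simp [PiLp.inner_apply, hv, mul_comm]
    rw [h2] at h
    rw [← h]
    refine Finset.sum_congr rfl fun l _ => ?_
    simp only [xt, OrthonormalBasis.repr_apply_apply]
    rw [real_inner_comm]
  -- `s ≤ r + 1`: `Gram(x) = X − ccᵀ`
  have hsr : s ≤ r + 1 := by
    have hG : (Matrix.of fun i l => x i l) * (Matrix.of fun i l => x i l)ᵀ = X + vecMulVec (-c) c := by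
      ext i j
      simp only [Matrix.mul_apply, Matrix.transpose_apply, Matrix.of_apply, Matrix.add_apply,
        vecMulVec_apply, Pi.neg_apply, hX i j]
      ring
    have hrankA : (Matrix.of fun i l => x i l).rank = s := by
      let e : (Fin k → ℝ) ≃ₗ[ℝ] EuclideanSpace ℝ (Fin k) := (WithLp.linearEquiv 2 ℝ (Fin k → ℝ)).symm
      have hUmap : U = (Submodule.span ℝ (Set.range (Matrix.of fun i l => x i l).row)).map
          (e : (Fin k → ℝ) →ₗ[ℝ] EuclideanSpace ℝ (Fin k)) := by
        rw [Submodule.map_span, ← Set.range_comp]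
        rfl
      rw [hs, hUmap, LinearEquiv.finrank_map_eq, ← Matrix.rank_eq_finrank_span_row]
    have h1 : s = (X + vecMulVec (-c) c).rank := by
      rw [← hrankA, ← Matrix.rank_self_mul_transpose, hG]
    have h2 : (X + vecMulVec (-c) c).rank ≤ X.rank + (vecMulVec (-c) c).rank := rank_add_le' _ _
    have h3 : (vecMulVec (-c) c).rank ≤ 1 := rank_vecMulVec_le (-c) c
    omega
  -- pad the coordinates to `r + 1` of them
  let y : ι → Fin (r + 1) → ℝ := fun i l => if h : (l : ℕ) < s then xt i ⟨l, h⟩ else 0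
  have hyy : ∀ i j, ∑ l, y i l * y j l = ∑ l, x i l * x j l := by
    intro i j
    rw [← hinner i j, ← sum_dite_castLE hsr (fun l => xt i l * xt j l)]
    refine Finset.sum_congr rfl fun l _ => ?_
    by_cases h : (l : ℕ) < s
    · simp only [y, dif_pos h]
    · simp only [y, dif_neg h, mul_zero]
  -- Theorem 6′ with `k = r + 1 ≠ 1`
  obtain ⟨Γ, -, htr, hpsd⟩ := exists_lorentz_isometry (k := r + 1) (by omega)
  refine ⟨fun i => Γ (c i, y i), fun i => (hpsd _).mpr ?_, fun i j => ?_⟩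
  · change Real.sqrt (∑ l, y i l ^ 2) ≤ c i
    have h : ∑ l, y i l ^ 2 = ∑ l, x i l ^ 2 := by
      simp only [sq]
      exact hyy i i
    rw [h]
    exact hxc i
  · rw [htr, hX i j]
    simp only
    rw [hyy]

end Thm7

/-! ### Theorem 14, first half: extreme points of the elliptope have rank `≤ r_max(n)` -/

/-- **PSVW Theorem 14, first half** (GPW / Li–Tam; p18, verbatim: "any `E ∈ ext(𝓔_n)` has rank at most
`r_max(n) = ⌊(√(1+8n) − 1)/2⌋`, the greatest integer with `C(r+1,2) ≤ n`"), PROVED from the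
Barvinok–Pataki extreme-point bound `rank_small_of_mem_extremePoints` (`PsdFactorNorms.lean`) applied to
the `n` diagonal constraints `Tr(X E_ii) = 1` cutting the elliptope out of the psd cone. (The second
half — extreme points of every rank `1 ≤ r ≤ r_max(n)` exist — stays in the NAMED FACT
`PrakashEtAl2017_thm14`.) [cite: PrakashEtAl2017, Thm. 14 (p18)] -/
theorem rank_le_elliptopeMaxRank_of_mem_extremePoints {n : ℕ} {X : Matrix (Fin n) (Fin n) ℝ}
    (hX : X ∈ Set.extremePoints ℝ (elliptope n)) : X.rank ≤ elliptopeMaxRank n := by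
  classical
  -- the elliptope as the slice of the psd cone by the `n` constraints `Tr(X E_ii) = 1`
  let B : Fin n → Matrix (Fin n) (Fin n) ℝ := fun i => Matrix.of fun a b => if a = i ∧ b = i then 1 else 0
  have htr : ∀ (Y : Matrix (Fin n) (Fin n) ℝ) (i : Fin n), (Y * B i).trace = Y i i := by
    intro Y i
    simp only [Matrix.trace, Matrix.diag_apply, Matrix.mul_apply, B, Matrix.of_apply, mul_ite, mul_one,
      mul_zero]
    rw [Finset.sum_eq_single i (fun a _ ha => Finset.sum_eq_zero fun b _ => by simp [ha])
      (fun h => absurd (Finset.mem_univ i) h),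
      Finset.sum_eq_single i (fun b _ hb => by simp [hb]) (fun h => absurd (Finset.mem_univ i) h)]
    simp
  have hset : elliptope n =
      {Y : Matrix (Fin n) (Fin n) ℝ | Y.PosSemidef ∧ ∀ i, (Y * B i).trace = (fun _ => (1 : ℝ)) i} := by
    ext Y
    simp only [elliptope, Set.mem_setOf_eq, htr]
  rw [hset] at hX
  have h := rank_small_of_mem_extremePoints B (fun _ => (1 : ℝ)) hX
  rw [Fintype.card_fin] at h
  -- `r(r+1) ≤ 2n ⟹ r ≤ (⌊√(1+8n)⌋ − 1)/2`
  unfold elliptopeMaxRank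
  have h1 : (2 * X.rank + 1) * (2 * X.rank + 1) ≤ 1 + 8 * n := by nlinarith
  have h2 : 2 * X.rank + 1 ≤ Nat.sqrt (1 + 8 * n) := Nat.le_sqrt.mpr h1
  omega

/-! ### Lemma 10: behaviors of correlation matrices are Gram–Lorentz -/

/-- **PSVW Lemma 10, symmetric form** (p17, verbatim: "For any `C = (c_{x,y}) ∈ Cor(n,m)` the behavior
`p_C` is Gram–Lorentz … `ℓ^x_a = ½(1, a u_x)`", with `c_{xy} = ⟨u_x, u_y⟩` unit vectors), for a
correlation matrix `C ∈ 𝓔_n` and its behavior matrix `P_C = ¼[J+C, J−C; J−C, J+C]`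
(`behaviorMatrix`): writing `C = Gram(u_x)` with `‖u_x‖ = 1` (Gram vectors of the psd `C`, unit by
`C_xx = 1`), the Lorentz vectors `½(1, ±u_x) ∈ L` have Gram matrix `P_C`. With `IsGramLorentz.isCpsd` this
makes `P_C` cpsd — the Gram–Lorentz conjunct of `PrakashEtAl2017_thm16`.
[cite: PrakashEtAl2017, Lemma 10 (p17)] -/
theorem isGramLorentz_behaviorMatrix {n : ℕ} {C : Matrix (Fin n) (Fin n) ℝ} (hC : C ∈ elliptope n) :
    IsGramLorentz (behaviorMatrix C) := by
  classical
  obtain ⟨hCpsd, hCdiag⟩ := hC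
  obtain ⟨u, hu⟩ := exists_gram_fin_rank_of_posSemidef hCpsd
  have hunit : ∀ i, ∑ l, u i l ^ 2 = 1 := fun i => by
    rw [← hCdiag i, hu i i]
    exact Finset.sum_congr rfl fun l _ => by ring
  -- the sign of a party/outcome index and the Lorentz vectors `½(1, ±u_x)`
  let sgn : Fin n ⊕ Fin n → ℝ := fun p => Sum.elim (fun _ => 1) (fun _ => -1) p
  let idx : Fin n ⊕ Fin n → Fin n := fun p => Sum.elim id id p
  have hsgn_sq : ∀ p, sgn p * sgn p = 1 := by rintro (i | i) <;> simp [sgn]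
  refine ⟨C.rank, fun _ => 1 / 2, fun p l => sgn p * u (idx p) l / 2, fun p => ?_, fun p q => ?_⟩
  · have : ∑ l, (sgn p * u (idx p) l / 2) ^ 2 = (1 / 2) ^ 2 := by
      have h1 : ∀ l, (sgn p * u (idx p) l / 2) ^ 2 = (1 / 4 : ℝ) * u (idx p) l ^ 2 := fun l => by
        have := hsgn_sq p
        nlinarith [this]
      simp only [h1, ← Finset.mul_sum, hunit]
      norm_num
    rw [this, Real.sqrt_sq (by norm_num)]
  · have hsum : ∑ l, sgn p * u (idx p) l / 2 * (sgn q * u (idx q) l / 2) =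
        sgn p * sgn q / 4 * C (idx p) (idx q) := by
      rw [hu (idx p) (idx q), Finset.mul_sum]
      exact Finset.sum_congr rfl fun l _ => by ring
    rw [hsum]
    rcases p with i | i <;> rcases q with j | j <;>
      simp [behaviorMatrix, sgn, idx, Matrix.fromBlocks_apply₁₁, Matrix.fromBlocks_apply₁₂,
        Matrix.fromBlocks_apply₂₁, Matrix.fromBlocks_apply₂₂] <;> ring

/-- Consequently the behavior matrix of every correlation matrix is cpsd, with
`cpsd-rank(P_C) ≤ 2^{⌊(rank P_C + 1)/2⌋}` (Theorem 7) — the upper-bound side of the tightness remark after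
Theorem 16 (p19: "the upper bound on the cpsd-rank of GL matrices given in Theorem 7 is essentially
tight"). [cite: PrakashEtAl2017, Lemma 10 (p17) and Thm. 7 (p14)] -/
theorem hasCpsdFactorization_behaviorMatrix {n : ℕ} {C : Matrix (Fin n) (Fin n) ℝ}
    (hC : C ∈ elliptope n) :
    HasCpsdFactorization (behaviorMatrix C) (2 ^ (((behaviorMatrix C).rank + 1) / 2)) :=
  PrakashEtAl2017_thm7_holds _ _ (isGramLorentz_behaviorMatrix hC)

/-! ### Theorem 6 at `m = 2`: the right size is `d = 2` -/

/-- **Theorem 6 at `m = 2` holds with `d = 2`** (not with the printed `d = 2^{⌊1/2⌋} = 1`, cf.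
`PrakashEtAl2017_thm6_false`): embed `L_2 ⊂ L_3` by a zero coordinate and use the `m = 3` isometry
`Γ((c,x)) = (cI_2 + x_1 X + x_2 Y)/√2` of `exists_lorentz_isometry`, i.e. `Γ((c,x)) = (cI_2 + xX)/√2`.
[cite: PrakashEtAl2017, Thm. 6 (p13)] -/
theorem exists_lorentz_isometry_one :
    ∃ Γ : (ℝ × (Fin 1 → ℝ)) →ₗ[ℝ] Matrix (Fin (2 ^ (2 / 2))) (Fin (2 ^ (2 / 2))) ℂ,
      (∀ p, (Γ p).IsHermitian) ∧
      (∀ p q, (Γ p * Γ q).trace = (((p.1 * q.1 + ∑ l, p.2 l * q.2 l : ℝ)) : ℂ)) ∧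
      ∀ p, (Γ p).PosSemidef ↔ Real.sqrt (∑ l, p.2 l ^ 2) ≤ p.1 := by
  obtain ⟨Γ₂, hH, htr, hpsd⟩ := exists_lorentz_isometry (k := 2) (by norm_num)
  -- padding `ℝ¹ → ℝ²`, `x ↦ (x, 0)`
  let pad : (Fin 1 → ℝ) →ₗ[ℝ] (Fin 2 → ℝ) :=
    { toFun := fun x => ![x 0, 0]
      map_add' := fun x y => by
        ext l; fin_cases l <;> simp
      map_smul' := fun c x => by
        ext l; fin_cases l <;> simp }
  have hpad : ∀ x : Fin 1 → ℝ, pad x = ![x 0, 0] := fun x => rfl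
  refine ⟨Γ₂ ∘ₗ (LinearMap.id.prodMap pad), fun p => hH _, fun p q => ?_, fun p => ?_⟩
  · rw [LinearMap.comp_apply, LinearMap.comp_apply, htr]
    simp [hpad, Fin.sum_univ_two]
  · rw [LinearMap.comp_apply, hpsd]
    simp [hpad, Fin.sum_univ_two]

/-! ### Discharge of `PrakashEtAl2017_thm14`: extreme points of the elliptope of every rank `≤ r_max` -/

section Thm14

/-- **Li–Tam sufficient condition for extremality in the elliptope** (PSVW Theorem 13, [LT94], p18:
"`X = Gram(u_i) ∈ ext(𝓔_n)` iff the `u_iu_iᵀ` span `S^r`", direction ⇐): if `X = UUᵀ` has full column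
rank and the only symmetric `S` with `u_iᵀ S u_i = 0` for all `i` is `S = 0`, then `X` is an extreme
point of `𝓔_n`. Proof: for `X = aY + bZ` in `𝓔_n`, `D = Y − X` kills `ker Uᵀ` (psd-ness of `Y` and `Z`),
hence `D = USUᵀ` with `S = G⁻¹UᵀDUG⁻¹`, `G = UᵀU`; the unit diagonals give `u_iᵀSu_i = 0`, so `D = 0`.
[cite: PrakashEtAl2017, Thm. 13 (p18)] -/
theorem mem_extremePoints_elliptope_of_gram {n r : ℕ} (U : Matrix (Fin n) (Fin r) ℝ)
    (hdiag : ∀ i, (U * Uᵀ) i i = 1) (hrank : (U * Uᵀ).rank = r)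
    (hspan : ∀ S : Matrix (Fin r) (Fin r) ℝ, Sᵀ = S → (∀ i, (U * S * Uᵀ) i i = 0) → S = 0) :
    U * Uᵀ ∈ Set.extremePoints ℝ (elliptope n) := by
  classical
  rw [mem_extremePoints]
  have hXpsd : (U * Uᵀ).PosSemidef := by
    simpa [conjTranspose_eq_transpose_of_trivial] using posSemidef_self_mul_conjTranspose U
  refine ⟨⟨hXpsd, hdiag⟩, fun Y hY Z hZ hseg => ?_⟩
  obtain ⟨a, b, ha, hb, hab, hXab⟩ := hseg
  set X := U * Uᵀ with hX
  set D := Y - X with hD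
  have hYD : Y = X + D := by rw [hD]; abel
  have hZD : Z = X - (a / b) • D := by
    have hb0 : b ≠ 0 := hb.ne'
    have h1 : b • Z = b • X - a • D := by
      have h2 : b • Z = X - a • Y := by rw [← hXab]; abel
      rw [h2, hYD, smul_add]
      have h3 : X = (a + b) • X := by rw [hab, one_smul]
      nth_rewrite 1 [h3]
      rw [add_smul]
      abel
    calc Z = b⁻¹ • (b • Z) := by rw [smul_smul, inv_mul_cancel₀ hb0, one_smul]
      _ = X - (a / b) • D := by
        rw [h1, smul_sub, smul_smul, smul_smul, inv_mul_cancel₀ hb0, one_smul, div_eq_mul_inv,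
          mul_comm]
  -- `G = UᵀU` is invertible
  set G := Uᵀ * U with hG
  have hGrank : G.rank = r := by rw [hG, rank_transpose_mul_self, ← rank_self_mul_transpose, hrank]
  have hGunit : IsUnit G := by
    refine linearIndependent_rows_iff_isUnit.mp (linearIndependent_iff_card_eq_finrank_span.mpr ?_)
    rw [Fintype.card_fin, Set.finrank, ← rank_eq_finrank_span_row, hGrank]
  have hGdet : IsUnit G.det := (isUnit_iff_isUnit_det G).mp hGunit
  have hGsym : Gᵀ = G := by rw [hG, transpose_mul, transpose_transpose]
  -- the projector onto the column space
  set P := U * G⁻¹ * Uᵀ with hP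
  have hUtP : Uᵀ * P = Uᵀ := by
    rw [hP, ← Matrix.mul_assoc, ← Matrix.mul_assoc, ← hG, mul_nonsing_inv G hGdet, Matrix.one_mul]
  have hPsym : Pᵀ = P := by
    rw [hP, transpose_mul, transpose_mul, transpose_transpose, transpose_nonsing_inv, hGsym,
      Matrix.mul_assoc]
  -- `D` kills `ker Uᵀ`
  have hDsym : Dᵀ = D := by
    have hYs : Yᵀ = Y := by
      have := hY.1.1
      rwa [IsHermitian, conjTranspose_eq_transpose_of_trivial] at this
    rw [hD, transpose_sub, hYs, hX, transpose_mul, transpose_transpose]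
  have hker : ∀ v : Fin n → ℝ, Uᵀ *ᵥ v = 0 → D *ᵥ v = 0 := by
    intro v hv
    have hXv : X *ᵥ v = 0 := by rw [hX, ← mulVec_mulVec, hv, mulVec_zero]
    have hYq : v ⬝ᵥ (Y *ᵥ v) = v ⬝ᵥ (D *ᵥ v) := by rw [hYD, add_mulVec, hXv, zero_add]
    have hZq : v ⬝ᵥ (Z *ᵥ v) = -(a / b) * (v ⬝ᵥ (D *ᵥ v)) := by
      rw [hZD, sub_mulVec, smul_mulVec, hXv, zero_sub, dotProduct_neg, dotProduct_smul, smul_eq_mul,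
        neg_mul]
    have hY0 : 0 ≤ v ⬝ᵥ (Y *ᵥ v) := by
      simpa using (posSemidef_iff_dotProduct_mulVec.mp hY.1).2 v
    have hZ0 : 0 ≤ v ⬝ᵥ (Z *ᵥ v) := by
      simpa using (posSemidef_iff_dotProduct_mulVec.mp hZ.1).2 v
    have hab' : 0 < a / b := div_pos ha hb
    have hq : v ⬝ᵥ (D *ᵥ v) = 0 := by
      rw [hYq] at hY0
      rw [hZq] at hZ0
      nlinarith
    have hYv : Y *ᵥ v = 0 := (hY.1.dotProduct_mulVec_zero_iff v).mp (by simpa [hYq] using hq)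
    rw [hD, sub_mulVec, hYv, hXv, sub_zero]
  -- hence `D(1 − P) = 0`, `D = DP = PD = PDP`
  have hD1P : D * (1 - P) = 0 := by
    have hU1P : Uᵀ * (1 - P) = 0 := by rw [Matrix.mul_sub, Matrix.mul_one, hUtP, sub_self]
    ext i j
    have hcol : Uᵀ *ᵥ (fun m => (1 - P) m j) = 0 := by
      funext l
      have := congrFun (congrFun hU1P l) j
      simpa [Matrix.mul_apply, mulVec, dotProduct] using this
    have := congrFun (hker _ hcol) i
    simpa [Matrix.mul_apply, mulVec, dotProduct] using this
  have hDP : D = D * P := by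
    rw [Matrix.mul_sub, Matrix.mul_one, sub_eq_zero] at hD1P
    exact hD1P
  have hPD : D = P * D := by
    calc D = Dᵀ := hDsym.symm
      _ = (D * P)ᵀ := by rw [← hDP]
      _ = P * D := by rw [transpose_mul, hPsym, hDsym]
  have hPDP : D = P * D * P := by
    have h : D * P = P * D * P := congrArg (· * P) hPD
    rwa [← hDP] at h
  -- `S = G⁻¹ Uᵀ D U G⁻¹` is symmetric with `USUᵀ = D`
  set S := G⁻¹ * Uᵀ * D * U * G⁻¹ with hS
  have hUSU : U * S * Uᵀ = D := by
    rw [hPDP, hS, hP]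
    simp only [Matrix.mul_assoc]
  have hGinvsym : (G⁻¹)ᵀ = G⁻¹ := by rw [transpose_nonsing_inv, hGsym]
  have hSsym : Sᵀ = S := by
    rw [hS, transpose_mul, transpose_mul, transpose_mul, transpose_mul, transpose_transpose, hGinvsym,
      hDsym]
    simp only [Matrix.mul_assoc]
  have hS0 : S = 0 := hspan S hSsym fun i => by
    rw [hUSU, hD, Matrix.sub_apply, hY.2 i, hdiag i, sub_self]
  have hD0 : D = 0 := by rw [← hUSU, hS0, Matrix.mul_zero, Matrix.zero_mul]
  refine ⟨?_, ?_⟩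
  · rw [hYD, hD0, add_zero]
  · rw [hZD, hD0, smul_zero, sub_zero]

/-! #### The Grone–Pierce–Watkins vectors `e_i`, `(e_i + e_j)/√2` -/

/-- Upper-triangular positions `i ≤ j` number `r(r+1)/2`. [folklore] -/
private theorem two_mul_card_le_pairs (r : ℕ) :
    2 * Fintype.card {p : Fin r × Fin r // p.1 ≤ p.2} = r * (r + 1) := by
  classical
  have hP : Fintype.card {p : Fin r × Fin r // p.1 ≤ p.2} =
      (univ.filter fun p : Fin r × Fin r => p.1 ≤ p.2).card := Fintype.card_subtype _
  have hswap : (univ.filter fun p : Fin r × Fin r => p.2 ≤ p.1).card =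
      (univ.filter fun p : Fin r × Fin r => p.1 ≤ p.2).card := by
    refine Finset.card_bij (fun p _ => (p.2, p.1)) (fun p hp => ?_) (fun p _ q _ h => ?_)
      (fun q hq => ⟨(q.2, q.1), ?_, rfl⟩)
    · simpa using hp
    · exact Prod.ext (congrArg Prod.snd h) (congrArg Prod.fst h)
    · simpa using hq
  have hunion : (univ.filter fun p : Fin r × Fin r => p.1 ≤ p.2) ∪
      (univ.filter fun p : Fin r × Fin r => p.2 ≤ p.1) = univ := by
    ext p
    simp only [Finset.mem_union, Finset.mem_filter, Finset.mem_univ, true_and, iff_true]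
    exact le_total _ _
  have hinter : (univ.filter fun p : Fin r × Fin r => p.1 ≤ p.2) ∩
      (univ.filter fun p : Fin r × Fin r => p.2 ≤ p.1) = univ.filter fun p : Fin r × Fin r => p.1 = p.2 := by
    ext p
    simp only [Finset.mem_inter, Finset.mem_filter, Finset.mem_univ, true_and]
    exact ⟨fun h => le_antisymm h.1 h.2, fun h => ⟨h.le, h.ge⟩⟩
  have hdiag : (univ.filter fun p : Fin r × Fin r => p.1 = p.2).card = r := by
    have himg : (univ.filter fun p : Fin r × Fin r => p.1 = p.2) =
        univ.image (fun i : Fin r => (i, i)) := by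
      ext p
      simp only [Finset.mem_filter, Finset.mem_univ, true_and, Finset.mem_image]
      constructor
      · intro h
        exact ⟨p.1, Prod.ext rfl h⟩
      · rintro ⟨i, rfl⟩
        rfl
    rw [himg, Finset.card_image_of_injective _ (fun i j h => congrArg Prod.fst h), Finset.card_univ,
      Fintype.card_fin]
  have hcard := Finset.card_union_add_card_inter
    (univ.filter fun p : Fin r × Fin r => p.1 ≤ p.2) (univ.filter fun p : Fin r × Fin r => p.2 ≤ p.1)
  rw [hunion, hinter, hdiag, hswap, Finset.card_univ, Fintype.card_prod, Fintype.card_fin] at hcard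
  rw [hP]
  linarith

/-- The quadratic form `wᵀ S w` as the diagonal entry of `USUᵀ`. [folklore] -/
private theorem conj_diag_eq {n r : ℕ} (U : Matrix (Fin n) (Fin r) ℝ) (S : Matrix (Fin r) (Fin r) ℝ)
    (m : Fin n) : (U * S * Uᵀ) m m = ∑ l, ∑ l', U m l * S l l' * U m l' := by
  simp only [Matrix.mul_apply, transpose_apply, Finset.sum_mul]
  rw [Finset.sum_comm]

/-- `e_iᵀ S e_i = S_ii`. [folklore] -/
private theorem quad_single {r : ℕ} (S : Matrix (Fin r) (Fin r) ℝ) (i : Fin r) :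
    ∑ l, ∑ l', (Pi.single i (1 : ℝ) : Fin r → ℝ) l * S l l' * (Pi.single i (1 : ℝ) : Fin r → ℝ) l' =
      S i i := by
  classical
  simp [Pi.single_apply, Finset.sum_ite_eq']

/-- `(e_i + e_j)ᵀ S (e_i + e_j) = S_ii + S_ij + S_ji + S_jj`. [folklore] -/
private theorem quad_single_add {r : ℕ} (S : Matrix (Fin r) (Fin r) ℝ) (i j : Fin r) :
    ∑ l, ∑ l', ((Pi.single i (1 : ℝ) : Fin r → ℝ) l + (Pi.single j (1 : ℝ) : Fin r → ℝ) l) * S l l' *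
      ((Pi.single i (1 : ℝ) : Fin r → ℝ) l' + (Pi.single j (1 : ℝ) : Fin r → ℝ) l') =
      S i i + S i j + S j i + S j j := by
  classical
  simp only [add_mul, mul_add, Finset.sum_add_distrib]
  simp [Pi.single_apply, Finset.sum_ite_eq']
  ring

/-- `‖e_i‖² = 1`. [folklore] -/
private theorem norm_sq_single {r : ℕ} (i : Fin r) :
    ∑ l, ((Pi.single i (1 : ℝ) : Fin r → ℝ) l) ^ 2 = 1 := by
  classical
  simp [Pi.single_apply, sq]

/-- `‖e_i + e_j‖² = 2` for `i ≠ j`. [folklore] -/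
private theorem norm_sq_single_add {r : ℕ} {i j : Fin r} (hij : i ≠ j) :
    ∑ l, ((Pi.single i (1 : ℝ) : Fin r → ℝ) l + (Pi.single j (1 : ℝ) : Fin r → ℝ) l) ^ 2 = 2 := by
  classical
  have h := quad_single_add (1 : Matrix (Fin r) (Fin r) ℝ) i j
  simp only [Matrix.one_apply_eq, Matrix.one_apply_ne hij, Matrix.one_apply_ne hij.symm, add_zero] at h
  have h' : ∑ l, ((Pi.single i (1 : ℝ) : Fin r → ℝ) l + (Pi.single j (1 : ℝ) : Fin r → ℝ) l) ^ 2 =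
      ∑ l, ∑ l', ((Pi.single i (1 : ℝ) : Fin r → ℝ) l + (Pi.single j (1 : ℝ) : Fin r → ℝ) l) *
        (1 : Matrix (Fin r) (Fin r) ℝ) l l' *
        ((Pi.single i (1 : ℝ) : Fin r → ℝ) l' + (Pi.single j (1 : ℝ) : Fin r → ℝ) l') := by
    refine Finset.sum_congr rfl fun l _ => ?_
    rw [Finset.sum_eq_single l (fun l' _ h' => by
      rw [Matrix.one_apply_ne (Ne.symm h'), mul_zero, zero_mul]) (fun h => absurd (mem_univ l) h),
      Matrix.one_apply_eq]
    ring
  rw [h', h]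
  norm_num

/-- **PSVW Theorem 14, second half** (GPW construction, p18: "`X_r ∈ ext(𝓔_n)` with `rank X_r = r`"):
for `r ≥ 1` with `r(r+1)/2 ≤ n`, the Gram matrix of the unit vectors `e_i` (`i < r`), `(e_i+e_j)/√2`
(`i < j`), padded with copies of `e_0`, is an extreme point of `𝓔_n` of rank `r` (the `u u ᵀ` span `S^r`,
Li–Tam). [cite: PrakashEtAl2017, Thm. 14 (p18)] -/
theorem exists_mem_extremePoints_elliptope_rank_eq {n r : ℕ} (hr : 1 ≤ r) (hrn : r * (r + 1) ≤ 2 * n) :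
    ∃ X ∈ Set.extremePoints ℝ (elliptope n), X.rank = r := by
  classical
  -- index the GPW vectors by upper-triangular positions, embedded into `Fin n`
  let Pr := {p : Fin r × Fin r // p.1 ≤ p.2}
  have hcard : Fintype.card {p : Fin r × Fin r // p.1 ≤ p.2} ≤ n := by
    have := two_mul_card_le_pairs r
    omega
  let emb : Pr ↪ Fin n :=
    (Fintype.equivFin Pr).toEmbedding.trans (Fin.castLEEmb (by simpa using hcard))
  let e : Fin r → Fin r → ℝ := fun i => Pi.single i 1
  let vec : Pr → Fin r → ℝ := fun p =>
    if p.1.1 = p.1.2 then e p.1.1 else (Real.sqrt 2)⁻¹ • (e p.1.1 + e p.1.2)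
  let i₀ : Fin r := ⟨0, hr⟩
  let u : Fin n → Fin r → ℝ := fun m => if h : ∃ p, emb p = m then vec h.choose else e i₀
  have hu_emb : ∀ p, u (emb p) = vec p := by
    intro p
    have h : ∃ q, emb q = emb p := ⟨p, rfl⟩
    simp only [u, dif_pos h]
    rw [emb.injective h.choose_spec]
  let U : Matrix (Fin n) (Fin r) ℝ := Matrix.of u
  have hUapply : ∀ m l, U m l = u m l := fun m l => rfl
  -- unit rows
  have hsqrt2 : (Real.sqrt 2)⁻¹ ^ 2 = (1 / 2 : ℝ) := by
    rw [inv_pow, Real.sq_sqrt (by norm_num : (0 : ℝ) ≤ 2)]; norm_num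
  have hvec_unit : ∀ p, ∑ l, (vec p l) ^ 2 = 1 := by
    intro p
    by_cases hp : p.1.1 = p.1.2
    · simp only [vec, if_pos hp]; exact norm_sq_single _
    · simp only [vec, e, if_neg hp, Pi.smul_apply, Pi.add_apply, smul_eq_mul, mul_pow,
        ← Finset.mul_sum]
      rw [norm_sq_single_add hp, hsqrt2]
      norm_num
  have hdiag : ∀ m, (U * Uᵀ) m m = 1 := by
    intro m
    simp only [Matrix.mul_apply, transpose_apply, hUapply, ← sq]
    by_cases h : ∃ p, emb p = m
    · obtain ⟨p, rfl⟩ := h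
      rw [hu_emb]; exact hvec_unit p
    · simp only [u, dif_neg h]; exact norm_sq_single _
  -- full column rank: the rows `e_i` sit at the diagonal positions
  let f : Fin r → Fin n := fun i => emb ⟨(i, i), le_rfl⟩
  have hUf : ∀ i, u (f i) = e i := fun i => by
    simp only [f, hu_emb, vec, if_pos rfl]
  have hrankU : U.rank = r := by
    apply le_antisymm (by simpa using rank_le_card_width U)
    let B : Matrix (Fin r) (Fin n) ℝ := Matrix.of fun i m => if m = f i then (1 : ℝ) else 0
    have hBU : B * U = 1 := by
      ext i l
      simp only [Matrix.mul_apply, B, Matrix.of_apply, ite_mul, one_mul, zero_mul,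
        Finset.sum_ite_eq', Finset.mem_univ, if_true, hUapply, hUf, e]
      by_cases h : i = l
      · subst h; simp
      · rw [Matrix.one_apply_ne h, Pi.single_eq_of_ne (Ne.symm h)]
    calc r = (B * U).rank := by rw [hBU, rank_one, Fintype.card_fin]
      _ ≤ U.rank := rank_mul_le_right _ _
  have hrank : (U * Uᵀ).rank = r := by rw [rank_self_mul_transpose, hrankU]
  -- Li–Tam spanning condition
  have hspan : ∀ S : Matrix (Fin r) (Fin r) ℝ, Sᵀ = S → (∀ m, (U * S * Uᵀ) m m = 0) → S = 0 := by
    intro S hS h0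
    have hsym : ∀ i j, S j i = S i j := fun i j => by
      have := congrFun (congrFun hS i) j
      rwa [transpose_apply] at this
    have hq : ∀ p : Pr, ∑ l, ∑ l', vec p l * S l l' * vec p l' = 0 := fun p => by
      have := h0 (emb p)
      rw [conj_diag_eq] at this
      simpa only [hUapply, hu_emb] using this
    have hSii : ∀ i, S i i = 0 := fun i => by
      have := hq ⟨(i, i), le_rfl⟩
      simp only [vec, if_pos rfl, e] at this
      rwa [quad_single] at this
    have hSij : ∀ i j, i < j → S i j = 0 := fun i j hij => by
      have h := hq ⟨(i, j), hij.le⟩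
      have hne : i ≠ j := ne_of_lt hij
      simp only [vec, if_neg hne, Pi.smul_apply, Pi.add_apply, smul_eq_mul, e] at h
      have h2 : ∑ l, ∑ l', (Real.sqrt 2)⁻¹ * ((Pi.single i (1 : ℝ) : Fin r → ℝ) l +
          (Pi.single j (1 : ℝ) : Fin r → ℝ) l) * S l l' *
          ((Real.sqrt 2)⁻¹ * ((Pi.single i (1 : ℝ) : Fin r → ℝ) l' + (Pi.single j (1 : ℝ) : Fin r → ℝ) l')) =
          (Real.sqrt 2)⁻¹ ^ 2 * (S i i + S i j + S j i + S j j) := by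
        rw [← quad_single_add, Finset.mul_sum]
        refine Finset.sum_congr rfl fun l _ => ?_
        rw [Finset.mul_sum]
        exact Finset.sum_congr rfl fun l' _ => by ring
      rw [h2, hsqrt2, hSii i, hSii j, hsym i j] at h
      linarith
    ext i j
    rcases lt_trichotomy i j with hij | rfl | hji
    · exact hSij i j hij
    · exact hSii i
    · rw [Matrix.zero_apply, hsym j i]; exact hSij j i hji
  exact ⟨U * Uᵀ, mem_extremePoints_elliptope_of_gram U hdiag hrank hspan, hrank⟩

/-- **Discharge of `PrakashEtAl2017_thm14`** (Grone–Pierce–Watkins / Li–Tam: the extreme points of the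
elliptope `𝓔_n` have rank `≤ r_max(n)`, and every rank `1 ≤ r ≤ r_max(n)` occurs): the bound is
`rank_le_elliptopeMaxRank_of_mem_extremePoints` (Barvinok–Pataki), the construction is
`exists_mem_extremePoints_elliptope_rank_eq`. [cite: PrakashEtAl2017, Thm. 14 (p18)] -/
theorem PrakashEtAl2017_thm14_holds : PrakashEtAl2017_thm14 := by
  intro n
  refine ⟨fun X hX => rank_le_elliptopeMaxRank_of_mem_extremePoints hX, fun r h1 hr => ?_⟩
  apply exists_mem_extremePoints_elliptope_rank_eq h1
  -- `r ≤ (⌊√(1+8n)⌋ − 1)/2 ⟹ r(r+1) ≤ 2n`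
  unfold elliptopeMaxRank at hr
  have h2 : 2 * r + 1 ≤ Nat.sqrt (1 + 8 * n) := by omega
  have h3 := Nat.le_sqrt.mp h2
  nlinarith

end Thm14

/-! ### Theorem 13 (Li–Tam): the criterion is necessary as well -/

section LiTam

/-- For a nonzero symmetric `S`, both `I ± tS` are psd for some `t ≠ 0` (eigenvalue of largest modulus;
the same device as in `PsdFactorNorms.lean`). [folklore] -/
private theorem exists_posSemidef_one_add_sub_smul' {r : ℕ} {S : Matrix (Fin r) (Fin r) ℝ}
    (hS : Sᵀ = S) (hS0 : S ≠ 0) :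
    ∃ t : ℝ, t ≠ 0 ∧ (1 + t • S).PosSemidef ∧ (1 - t • S).PosSemidef := by
  classical
  have hH : S.IsHermitian := by
    rw [IsHermitian, conjTranspose_eq_transpose_of_trivial, hS]
  have hr : 0 < r := by
    rcases Nat.eq_zero_or_pos r with h | h
    · subst h; exact absurd (Subsingleton.elim S 0) hS0
    · exact h
  haveI : Nonempty (Fin r) := ⟨⟨0, hr⟩⟩
  set ev := hH.eigenvalues with hev
  obtain ⟨a, ha⟩ := Finite.exists_max fun i => |ev i|
  have hne : ev ≠ 0 := fun h => hS0 (hH.eigenvalues_eq_zero_iff.mp h)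
  have ha0 : ev a ≠ 0 := by
    intro h0
    apply hne
    funext i
    have := ha i
    rw [h0, abs_zero] at this
    exact abs_eq_zero.mp (le_antisymm this (abs_nonneg _))
  set E : Matrix (Fin r) (Fin r) ℝ := (hH.eigenvectorUnitary : Matrix (Fin r) (Fin r) ℝ) with hE
  have hEE : E * star E = 1 := Unitary.coe_mul_star_self hH.eigenvectorUnitary
  have hSdiag : S = E * diagonal ev * star E := by
    have h := hH.spectral_theorem
    rw [Unitary.conjStarAlgAut_apply] at h
    simpa [RCLike.ofReal_real_eq_id] using h
  have hdec : ∀ c : ℝ, (1 : Matrix (Fin r) (Fin r) ℝ) + c • S =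
      E * diagonal (fun i => 1 + c * ev i) * star E := by
    intro c
    have hd : (diagonal fun i => 1 + c * ev i) = 1 + c • diagonal ev := by
      ext i j
      by_cases hij : i = j
      · subst hij; simp
      · simp [hij]
    rw [hd, Matrix.mul_add, Matrix.add_mul, Matrix.mul_one, hEE, Matrix.mul_smul, Matrix.smul_mul,
      ← hSdiag]
  have hquot : ∀ i, |ev i / ev a| ≤ 1 := fun i => by
    rw [abs_div]
    exact div_le_one_of_le₀ (ha i) (abs_nonneg _)
  have hpsd : ∀ c : ℝ, (∀ i, 0 ≤ 1 + c * ev i) → ((1 : Matrix (Fin r) (Fin r) ℝ) + c • S).PosSemidef := by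
    intro c hc
    rw [hdec c]
    have hD : (diagonal fun i => 1 + c * ev i).PosSemidef := PosSemidef.diagonal fun i => hc i
    have := hD.mul_mul_conjTranspose_same E
    rwa [star_eq_conjTranspose]
  refine ⟨(ev a)⁻¹, inv_ne_zero ha0, hpsd _ fun i => ?_, ?_⟩
  · have h := (abs_le.mp (hquot i)).1
    rw [div_eq_mul_inv] at h
    linarith [mul_comm (ev a)⁻¹ (ev i)]
  · rw [sub_eq_add_neg, ← neg_smul]
    refine hpsd _ fun i => ?_
    have h := (abs_le.mp (hquot i)).2
    rw [div_eq_mul_inv] at h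
    linarith [mul_comm (ev a)⁻¹ (ev i)]

/-- If `UUᵀ` has rank equal to the number of columns of `U`, then `USUᵀ = 0` forces `S = 0`.
[folklore] -/
private theorem eq_zero_of_conj_eq_zero' {k r : ℕ} (U : Matrix (Fin k) (Fin r) ℝ)
    (hU : (U * Uᵀ).rank = r) {S : Matrix (Fin r) (Fin r) ℝ} (h : U * S * Uᵀ = 0) : S = 0 := by
  classical
  set G := Uᵀ * U with hG
  have hGrank : G.rank = r := by rw [hG, rank_transpose_mul_self, ← rank_self_mul_transpose, hU]
  have hGunit : IsUnit G := by
    refine linearIndependent_rows_iff_isUnit.mp (linearIndependent_iff_card_eq_finrank_span.mpr ?_)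
    rw [Fintype.card_fin, Set.finrank, ← rank_eq_finrank_span_row, hGrank]
  have hGSG : G * S * G = 0 := by
    rw [hG]
    calc Uᵀ * U * S * (Uᵀ * U) = Uᵀ * (U * S * Uᵀ) * U := by simp only [Matrix.mul_assoc]
      _ = 0 := by rw [h, Matrix.mul_zero, Matrix.zero_mul]
  exact (hGunit.mul_right_eq_zero).mp ((hGunit.mul_left_eq_zero).mp hGSG)

/-- **PSVW Theorem 13 (Li–Tam), direction ⇒**: if `X = UUᵀ ∈ ext(𝓔_n)` has full column rank then the
only symmetric `S` with `u_iᵀSu_i = 0` for all `i` is `S = 0` (the `u_iu_iᵀ` span `S^r`): otherwise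
`X ± tUSUᵀ ∈ 𝓔_n` for a suitable `t ≠ 0`. [cite: PrakashEtAl2017, Thm. 13 (p18)] -/
theorem gram_span_of_mem_extremePoints_elliptope {n r : ℕ} (U : Matrix (Fin n) (Fin r) ℝ)
    (hrank : (U * Uᵀ).rank = r) (hext : U * Uᵀ ∈ Set.extremePoints ℝ (elliptope n))
    (S : Matrix (Fin r) (Fin r) ℝ) (hS : Sᵀ = S) (h0 : ∀ i, (U * S * Uᵀ) i i = 0) : S = 0 := by
  classical
  by_contra hS0
  rw [mem_extremePoints] at hext
  obtain ⟨⟨-, hdiag⟩, hext⟩ := hext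
  obtain ⟨t, ht0, hplus, hminus⟩ := exists_posSemidef_one_add_sub_smul' hS hS0
  let X : ℝ → Matrix (Fin n) (Fin n) ℝ := fun s => U * (1 + s • S) * Uᵀ
  have hXmem : ∀ s, ((1 : Matrix _ _ ℝ) + s • S).PosSemidef → X s ∈ elliptope n := by
    intro s hs
    refine ⟨?_, fun i => ?_⟩
    · have := hs.mul_mul_conjTranspose_same U
      rwa [conjTranspose_eq_transpose_of_trivial] at this
    · have h1 : X s = U * Uᵀ + s • (U * S * Uᵀ) := by
        simp only [X, Matrix.mul_add, Matrix.add_mul, Matrix.mul_one, Matrix.mul_smul, Matrix.smul_mul]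
      rw [h1, Matrix.add_apply, Matrix.smul_apply, hdiag i, h0 i, smul_zero, add_zero]
  have hXt := hXmem t hplus
  have hXnt : X (-t) ∈ elliptope n := by
    refine hXmem (-t) ?_
    rwa [neg_smul, ← sub_eq_add_neg]
  have hmid : U * Uᵀ ∈ openSegment ℝ (X t) (X (-t)) := by
    refine ⟨1 / 2, 1 / 2, by norm_num, by norm_num, by norm_num, ?_⟩
    simp only [X, neg_smul, Matrix.mul_add, Matrix.add_mul, Matrix.mul_one, Matrix.mul_neg,
      Matrix.neg_mul, smul_add, smul_neg]
    rw [show (1 / 2 : ℝ) • (U * Uᵀ) + (1 / 2 : ℝ) • (U * (t • S) * Uᵀ) + ((1 / 2 : ℝ) • (U * Uᵀ) +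
      -((1 / 2 : ℝ) • (U * (t • S) * Uᵀ))) = U * Uᵀ by module]
  have hXA := (hext _ hXt _ hXnt hmid).1
  have hUSU : U * (t • S) * Uᵀ = 0 := by
    have h1 : X t = U * Uᵀ + U * (t • S) * Uᵀ := by
      simp only [X, Matrix.mul_add, Matrix.add_mul, Matrix.mul_one]
    have h2 := hXA
    rw [h1] at h2
    simpa using h2
  have htS : t • S = 0 := eq_zero_of_conj_eq_zero' U hrank hUSU
  exact hS0 ((smul_eq_zero.mp htS).resolve_left ht0)

/-- **PSVW Theorem 13 (Li–Tam [LT94]) as a criterion** (p18): for `X = UUᵀ ∈ 𝓔_n` written with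
`rank X` columns, `X ∈ ext(𝓔_n)` iff the only symmetric `S` with `u_iᵀSu_i = 0` (`i ≤ n`) is `0`, i.e.
iff the `u_iu_iᵀ` span the symmetric `r × r` matrices. [cite: PrakashEtAl2017, Thm. 13 (p18)] -/
theorem mem_extremePoints_elliptope_iff_gram {n r : ℕ} (U : Matrix (Fin n) (Fin r) ℝ)
    (hdiag : ∀ i, (U * Uᵀ) i i = 1) (hrank : (U * Uᵀ).rank = r) :
    U * Uᵀ ∈ Set.extremePoints ℝ (elliptope n) ↔
      ∀ S : Matrix (Fin r) (Fin r) ℝ, Sᵀ = S → (∀ i, (U * S * Uᵀ) i i = 0) → S = 0 :=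
  ⟨fun h S hS h0 => gram_span_of_mem_extremePoints_elliptope U hrank h S hS h0,
    mem_extremePoints_elliptope_of_gram U hdiag hrank⟩

end LiTam

/-! ### Result 1 modulo Theorem 16 only -/

/-- **PSVW Result 1** (p06), now conditional on Theorem 16 alone: the Theorem 14 input of
`PrakashEtAl2017_result1_of` is the theorem `PrakashEtAl2017_thm14_holds`.
[cite: PrakashEtAl2017, Result 1 (p06), Thm. 16 (p19)] -/
theorem PrakashEtAl2017_result1_of_thm16 (h16 : PrakashEtAl2017_thm16) (n : ℕ) (hn : 1 ≤ n) :
    ∃ X : Matrix (Fin n ⊕ Fin n) (Fin n ⊕ Fin n) ℝ, IsGramLorentz X ∧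
      ∀ d : ℕ, HasCpsdFactorization X d → Real.sqrt 2 ^ (elliptopeMaxRank n / 2) ≤ (d : ℝ) :=
  PrakashEtAl2017_result1_of PrakashEtAl2017_thm14_holds h16 n hn

/-! ### Discharge of `PrakashEtAl2017_lemma11`: odd cycles carry DNN matrices that are not cpsd -/

section Lemma11

open Real
open Fin.CommRing

/-! #### Theorem 17 for the tracial algebra `M_d(ℂ)`: kernel vectors of a cpsd matrix -/

/-- **PSVW Remark 6.1 / the kernel step of Theorem 17 for `𝒩 = M_d(ℂ)`**: if `X = (Tr(P_a P_b))` with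
Hermitian psd `P_a` and `X w = 0` for a real vector `w`, then `Σ_a w_a P_a = 0` — because
`Tr((Σ w_a P_a)²) = wᵀ X w = 0` and the trace is faithful. (Printed: "`u_{i*} ∈ span{u_j : j ∈ J}` so
Remark 6.1 implies `p_{i*} ∈ span{p_j : j ∈ J}`".) [cite: PrakashEtAl2017, Thm. 17 proof (p20), Remark 6.1 (p20)] -/
theorem HasCpsdFactorization.sum_smul_eq_zero_of_mulVec_eq_zero {ι : Type*} [Fintype ι]
    {d : ℕ} {X : Matrix ι ι ℝ} {P : ι → Matrix (Fin d) (Fin d) ℂ} (hP : ∀ a, (P a).PosSemidef)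
    (hX : ∀ a b, ((X a b : ℝ) : ℂ) = (P a * P b).trace) {w : ι → ℝ} (hw : X *ᵥ w = 0) :
    ∑ a, ((w a : ℝ) : ℂ) • P a = 0 := by
  set S : Matrix (Fin d) (Fin d) ℂ := ∑ a, ((w a : ℝ) : ℂ) • P a with hS
  have hSh : Sᴴ = S := by
    rw [hS, conjTranspose_sum]
    refine sum_congr rfl fun a _ => ?_
    rw [conjTranspose_smul, (hP a).1.eq, Complex.star_def, Complex.conj_ofReal]
  have htr : (Sᴴ * S).trace = 0 := by
    rw [hSh, hS, Finset.sum_mul, trace_sum]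
    have h1 : ∀ a, ((((w a : ℝ) : ℂ) • P a) * ∑ b, ((w b : ℝ) : ℂ) • P b).trace =
        ∑ b, ((w a : ℝ) : ℂ) * (((w b : ℝ) : ℂ) * (P a * P b).trace) := by
      intro a
      rw [Matrix.mul_sum, trace_sum]
      refine sum_congr rfl fun b _ => ?_
      rw [Matrix.smul_mul, Matrix.mul_smul, trace_smul, trace_smul, smul_eq_mul, smul_eq_mul]
    simp only [h1, ← hX]
    have h2 : ∑ a, ∑ b, ((w a : ℝ) : ℂ) * (((w b : ℝ) : ℂ) * ((X a b : ℝ) : ℂ)) =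
        (((w ⬝ᵥ (X *ᵥ w) : ℝ)) : ℂ) := by
      simp only [dotProduct, mulVec, Finset.mul_sum]
      push_cast
      exact sum_congr rfl fun a _ => sum_congr rfl fun b _ => by ring
    rw [h2, hw, dotProduct_zero, Complex.ofReal_zero]
  exact trace_conjTranspose_mul_self_eq_zero_iff.mp htr

/-- **PSVW Theorem 17, tracial algebra `M_d(ℂ)` (the `CS_+` case), Gram-free form.** Let `X` be cpsd,
`X_{ab} = Tr(P_a P_b)`. Suppose `w, w'` are kernel vectors of `X` with `w_i ≠ 0`, `w'_j ≠ 0` such that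
every further index `a ∉ {i,j}` in the support of `w` (resp. `w'`) has `X_{ja} = 0` (resp. `X_{ai} = 0`),
and `X_{ij} ≠ 0`. Then row `j` of `X` is a POSITIVE multiple of row `i` ("`u_{i*}` is parallel to
`u_{j*}`", contradicting (iv)). Printed mechanism: `p_i ∈ span{p_a}` (Remark 6.1), pre- and
post-multiplication by `p_j`, `p_i` kills the orthogonal terms (`Tr(pq) = 0 ⇒ pq = 0`), whence
`p_j² = c·p_i²` with `c > 0` and, by uniqueness of psd square roots, `p_j = √c·p_i`. Hypotheses
(i)–(iii) of the printed statement are what produces such `w, w'` from Gram vectors; (v) is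
`X_{ij} ≠ 0`. [cite: PrakashEtAl2017, Thm. 17 (p20)] -/
theorem HasCpsdFactorization.exists_row_eq_mul_row {ι : Type*} [Fintype ι] [DecidableEq ι]
    {d : ℕ} {X : Matrix ι ι ℝ} (hXd : HasCpsdFactorization X d) {i j : ι}
    {w w' : ι → ℝ} (hw : X *ᵥ w = 0) (hw' : X *ᵥ w' = 0) (hwi : w i ≠ 0) (hw'j : w' j ≠ 0)
    (hJ : ∀ a, a ≠ i → a ≠ j → w a = 0 ∨ X j a = 0)
    (hI : ∀ a, a ≠ i → a ≠ j → w' a = 0 ∨ X a i = 0) (hXij : X i j ≠ 0) :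
    ∃ c : ℝ, 0 < c ∧ ∀ b, X j b = c * X i b := by
  classical
  obtain ⟨P, hP, hX⟩ := hXd
  by_cases hij : i = j
  · subst hij
    exact ⟨1, one_pos, fun b => by rw [one_mul]⟩
  have hXsymm : ∀ a b, X a b = X b a := fun a b => by
    have h := hX a b
    rw [trace_mul_comm, ← hX b a] at h
    exact_mod_cast h
  -- `Tr(P_a P_b) = 0 ⇒ P_a P_b = 0`
  have hperp : ∀ a b, X a b = 0 → P a * P b = 0 := fun a b h =>
    mul_eq_zero_of_posSemidef_trace_eq_zero_complex (hP a) (hP b) (by rw [← hX, h]; simp)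
  -- the two kernel relations
  have hS := HasCpsdFactorization.sum_smul_eq_zero_of_mulVec_eq_zero hP hX hw
  have hS' := HasCpsdFactorization.sum_smul_eq_zero_of_mulVec_eq_zero hP hX hw'
  -- pre-multiply the first by `P_j`: only `a = i, j` survive
  have hE1 : ((w i : ℝ) : ℂ) • (P j * P i) + ((w j : ℝ) : ℂ) • (P j * P j) = 0 := by
    have h := congrArg (fun M => P j * M) hS
    simp only [Matrix.mul_sum, Matrix.mul_smul, Matrix.mul_zero] at h
    rw [← Finset.sum_subset (Finset.subset_univ ({i, j} : Finset ι))] at h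
    · rwa [Finset.sum_pair hij] at h
    · intro a _ ha
      rw [Finset.mem_insert, Finset.mem_singleton, not_or] at ha
      rcases hJ a ha.1 ha.2 with h0 | h0
      · rw [h0, Complex.ofReal_zero, zero_smul]
      · rw [hperp j a h0, smul_zero]
  -- post-multiply the second by `P_i`
  have hE2 : ((w' i : ℝ) : ℂ) • (P i * P i) + ((w' j : ℝ) : ℂ) • (P j * P i) = 0 := by
    have h := congrArg (fun M => M * P i) hS'
    simp only [Finset.sum_mul, Matrix.smul_mul, Matrix.zero_mul] at h
    rw [← Finset.sum_subset (Finset.subset_univ ({i, j} : Finset ι))] at h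
    · rwa [Finset.sum_pair hij] at h
    · intro a _ ha
      rw [Finset.mem_insert, Finset.mem_singleton, not_or] at ha
      rcases hI a ha.1 ha.2 with h0 | h0
      · rw [h0, Complex.ofReal_zero, zero_smul]
      · rw [hperp a i h0, smul_zero]
  -- `P_j P_i ≠ 0`, hence `w_j ≠ 0`, `w'_i ≠ 0`, `P_i ≠ 0`, `P_j ≠ 0`
  have hM : P j * P i ≠ 0 := by
    intro h0
    apply hXij
    rw [hXsymm]
    have := hX j i
    rw [h0, trace_zero] at this
    exact_mod_cast this
  have hwj : w j ≠ 0 := by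
    intro h0
    rw [h0, Complex.ofReal_zero, zero_smul, add_zero, smul_eq_zero] at hE1
    rcases hE1 with h1 | h1
    · exact hwi (by exact_mod_cast h1)
    · exact hM h1
  have hw'i : w' i ≠ 0 := by
    intro h0
    rw [h0, Complex.ofReal_zero, zero_smul, zero_add, smul_eq_zero] at hE2
    rcases hE2 with h1 | h1
    · exact hw'j (by exact_mod_cast h1)
    · exact hM h1
  -- `P_j² = α · P_jP_i`, `P_i² = β · P_jP_i`
  set α : ℝ := -(w i / w j) with hα
  set β : ℝ := -(w' j / w' i) with hβ
  have hPj : P j * P j = ((α : ℝ) : ℂ) • (P j * P i) := by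
    have hwjC : ((w j : ℝ) : ℂ) ≠ 0 := by exact_mod_cast hwj
    have h1 : ((w j : ℝ) : ℂ) • (P j * P j) = -(((w i : ℝ) : ℂ) • (P j * P i)) :=
      eq_neg_of_add_eq_zero_right hE1
    calc P j * P j = (((w j : ℝ) : ℂ))⁻¹ • (((w j : ℝ) : ℂ) • (P j * P j)) := by
          rw [smul_smul, inv_mul_cancel₀ hwjC, one_smul]
      _ = ((α : ℝ) : ℂ) • (P j * P i) := by
          rw [h1, smul_neg, smul_smul, ← neg_smul]
          have e : -((((w j : ℝ) : ℂ))⁻¹ * ((w i : ℝ) : ℂ)) = ((α : ℝ) : ℂ) := by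
            rw [hα]
            push_cast
            try ring
          rw [e]
  have hPi : P i * P i = ((β : ℝ) : ℂ) • (P j * P i) := by
    have hwiC : ((w' i : ℝ) : ℂ) ≠ 0 := by exact_mod_cast hw'i
    have h1 : ((w' i : ℝ) : ℂ) • (P i * P i) = -(((w' j : ℝ) : ℂ) • (P j * P i)) :=
      eq_neg_of_add_eq_zero_left hE2
    calc P i * P i = (((w' i : ℝ) : ℂ))⁻¹ • (((w' i : ℝ) : ℂ) • (P i * P i)) := by
          rw [smul_smul, inv_mul_cancel₀ hwiC, one_smul]
      _ = ((β : ℝ) : ℂ) • (P j * P i) := by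
          rw [h1, smul_neg, smul_smul, ← neg_smul]
          have e : -((((w' i : ℝ) : ℂ))⁻¹ * ((w' j : ℝ) : ℂ)) = ((β : ℝ) : ℂ) := by
            rw [hβ]
            push_cast
            try ring
          rw [e]
  -- `P_i ≠ 0`, `P_j ≠ 0`, so `β ≠ 0`, `α ≠ 0`, and the diagonal entries are positive
  have hPsq_ne : ∀ a, P a * P i ≠ 0 ∨ P j * P a ≠ 0 → P a * P a ≠ 0 := by
    intro a ha h0
    have hPa : P a = 0 := by
      have : ((P a)ᴴ * P a).trace = 0 := by rw [(hP a).1.eq, h0, trace_zero]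
      exact trace_conjTranspose_mul_self_eq_zero_iff.mp this
    rcases ha with ha | ha
    · exact ha (by rw [hPa, Matrix.zero_mul])
    · exact ha (by rw [hPa, Matrix.mul_zero])
  have hPii : P i * P i ≠ 0 := hPsq_ne i (Or.inr hM)
  have hPjj : P j * P j ≠ 0 := hPsq_ne j (Or.inl hM)
  have hβ0 : β ≠ 0 := by
    intro h0
    rw [h0, Complex.ofReal_zero, zero_smul] at hPi
    exact hPii hPi
  have hα0 : α ≠ 0 := by
    intro h0
    rw [h0, Complex.ofReal_zero, zero_smul] at hPj
    exact hPjj hPj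
  -- `P_j² = c · P_i²`, `c = α/β`
  set c : ℝ := α / β with hc
  have hPjc : P j * P j = ((c : ℝ) : ℂ) • (P i * P i) := by
    rw [hPi, smul_smul, hPj]
    have e : ((α : ℝ) : ℂ) = ((c : ℝ) : ℂ) * ((β : ℝ) : ℂ) := by
      rw [hc]
      have hβC : ((β : ℝ) : ℂ) ≠ 0 := by exact_mod_cast hβ0
      push_cast
      rw [div_mul_cancel₀ _ hβC]
    rw [e]
  have hXii_pos : 0 < X i i := by
    have h0 : 0 ≤ X i i := by
      have h1 : (0 : ℂ) ≤ (P i * P i).trace := by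
        have := (posSemidef_conjTranspose_mul_self (P i)).trace_nonneg
        rwa [(hP i).1.eq] at this
      rw [← hX i i] at h1
      exact_mod_cast h1
    rcases h0.lt_or_eq with h0 | h0
    · exact h0
    · exfalso
      apply hPii
      have : ((P i)ᴴ * P i).trace = 0 := by rw [(hP i).1.eq, ← hX, ← h0]; simp
      have hPi0 := trace_conjTranspose_mul_self_eq_zero_iff.mp this
      rw [hPi0, Matrix.zero_mul]
  have hXjj_nn : 0 ≤ X j j := by
    have h1 : (0 : ℂ) ≤ (P j * P j).trace := by
      have := (posSemidef_conjTranspose_mul_self (P j)).trace_nonneg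
      rwa [(hP j).1.eq] at this
    rw [← hX j j] at h1
    exact_mod_cast h1
  have hcXX : X j j = c * X i i := by
    have h := congrArg Matrix.trace hPjc
    rw [trace_smul, ← hX, ← hX, smul_eq_mul] at h
    exact_mod_cast h
  have hc_pos : 0 < c := by
    have hc0 : c ≠ 0 := div_ne_zero hα0 hβ0
    have hc_nn : 0 ≤ c := by
      by_contra hneg
      push Not at hneg
      have : X j j < 0 := by rw [hcXX]; exact mul_neg_of_neg_of_pos hneg hXii_pos
      linarith
    exact lt_of_le_of_ne hc_nn (Ne.symm hc0)
  -- uniqueness of psd square roots: `P_j = √c · P_i`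
  have hsq : P j * P j = (((Real.sqrt c : ℝ) : ℂ) • P i) * (((Real.sqrt c : ℝ) : ℂ) • P i) := by
    rw [Matrix.smul_mul, Matrix.mul_smul, smul_smul, hPjc]
    congr 1
    rw [← Complex.ofReal_mul, Real.mul_self_sqrt hc_pos.le]
  have hPj_eq : P j = ((Real.sqrt c : ℝ) : ℂ) • P i := by
    have hsPi : (((Real.sqrt c : ℝ) : ℂ) • P i).PosSemidef :=
      (hP i).smul (Complex.zero_le_real.mpr (Real.sqrt_nonneg c))
    exact (CFC.mul_self_eq_mul_self_iff (P j) _ (hP j).nonneg hsPi.nonneg).mp hsq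
  refine ⟨Real.sqrt c, Real.sqrt_pos.mpr hc_pos, fun b => ?_⟩
  have h := hX j b
  rw [hPj_eq, Matrix.smul_mul, trace_smul, ← hX, smul_eq_mul] at h
  exact_mod_cast h

/-! #### Trigonometric sums over `ℤ/n` -/

/-- `Σ_{j<n} cos(2π j M / n) = n` if `n ∣ M` and `0` otherwise (`M ∈ ℤ`, `n ≥ 1`): real part of the
sum of the powers of the root of unity `e^{2πiM/n}`. [folklore] -/
private theorem sum_cos_two_pi_mul_int_div {n : ℕ} (hn : 1 ≤ n) (M : ℤ) :
    ∑ j : Fin n, Real.cos (2 * π * j * M / n) = if (n : ℤ) ∣ M then (n : ℝ) else 0 := by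
  have hn0 : (n : ℂ) ≠ 0 := by exact_mod_cast (show n ≠ 0 by omega)
  set z : ℂ := Complex.exp (2 * π * Complex.I * M / n) with hz
  have hzj : ∀ j : ℕ, Complex.exp (2 * π * Complex.I * j * M / n) = z ^ j := by
    intro j
    rw [hz, ← Complex.exp_nat_mul]
    congr 1
    ring
  have hzn : z ^ n = 1 := by
    rw [← hzj n]
    have : (2 * π * Complex.I * n * M / n : ℂ) = M * (2 * π * Complex.I) := by
      field_simp
      try ring
    rw [this]
    exact Complex.exp_int_mul_two_pi_mul_I M
  have hz1 : z = 1 ↔ (n : ℤ) ∣ M := by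
    rw [hz, Complex.exp_eq_one_iff]
    constructor
    · rintro ⟨q, hq⟩
      refine ⟨q, ?_⟩
      have h2πI : (2 * π * Complex.I : ℂ) ≠ 0 := by
        simp [Real.pi_ne_zero, Complex.I_ne_zero]
      rw [div_eq_iff hn0] at hq
      have h3 : (2 * π * Complex.I) * (M : ℂ) = (2 * π * Complex.I) * (n * q) := by
        linear_combination hq
      have h2 : (M : ℂ) = n * q := mul_left_cancel₀ h2πI h3
      exact_mod_cast h2
    · rintro ⟨q, hq⟩
      refine ⟨q, ?_⟩
      rw [hq]
      push_cast
      rw [show 2 * (π : ℂ) * Complex.I * ((n : ℂ) * (q : ℂ)) / (n : ℂ) =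
        (q : ℂ) * (2 * π * Complex.I) * ((n : ℂ) / (n : ℂ)) by ring, div_self hn0, mul_one]
  have key : ∑ j : Fin n, z ^ (j : ℕ) = if (n : ℤ) ∣ M then (n : ℂ) else 0 := by
    rw [Fin.sum_univ_eq_sum_range (fun j => z ^ j) n]
    split_ifs with hdiv
    · rw [hz1.mpr hdiv]
      simp
    · rw [geom_sum_eq (fun h => hdiv (hz1.mp h)), hzn, sub_self, zero_div]
  have hre := congrArg Complex.re key
  rw [Complex.re_sum] at hre
  convert hre using 1
  · refine sum_congr rfl fun j _ => ?_
    rw [← hzj, show (2 * π * Complex.I * (j : ℕ) * M / n : ℂ) = ((2 * π * j * M / n : ℝ) : ℂ) * Complex.I by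
      push_cast; ring]
    exact (Complex.exp_ofReal_mul_I_re _).symm
  · split_ifs <;> simp

/-! #### The cycle `C_n`, `n = m + 2 ≥ 3`: adjacency through `ℤ/n`, and the Fourier form of `A − λI` -/

variable {m : ℕ}

/-- `a = b + 1` in `Fin n` iff `n ∣ a − b − 1` in `ℤ`. [folklore] -/
private theorem fin_eq_add_one_iff_dvd (a b : Fin (m + 2)) :
    a = b + 1 ↔ ((m + 2 : ℕ) : ℤ) ∣ ((a : ℕ) : ℤ) - ((b : ℕ) : ℤ) - 1 := by
  rw [← CharP.intCast_eq_zero_iff (Fin (m + 2)) (m + 2)]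
  push_cast
  rw [sub_sub, sub_eq_zero]

/-- `a = b` in `Fin n` iff `n ∣ a − b` in `ℤ`. [folklore] -/
private theorem fin_eq_iff_dvd (a b : Fin (m + 2)) :
    a = b ↔ ((m + 2 : ℕ) : ℤ) ∣ ((a : ℕ) : ℤ) - ((b : ℕ) : ℤ) := by
  rw [← CharP.intCast_eq_zero_iff (Fin (m + 2)) (m + 2)]
  push_cast
  rw [sub_eq_zero]

/-- Adjacency in the cycle graph `C_{m+2}`: `a ∼ b` iff `a = b ± 1`. [folklore] -/
private theorem cycleGraph_adj_iff (a b : Fin (m + 2)) :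
    (SimpleGraph.cycleGraph (m + 2)).Adj a b ↔ a = b + 1 ∨ b = a + 1 := by
  rw [SimpleGraph.cycleGraph_adj, sub_eq_iff_eq_add, sub_eq_iff_eq_add, add_comm (1 : Fin (m + 2)) b,
    add_comm (1 : Fin (m + 2)) a]

/-- The adjacency indicator of `C_n` (`n ≥ 3`) in terms of divisibility: `[a ∼ b] = [n ∣ a−b−1] +
[n ∣ a−b+1]`. [folklore] -/
private theorem cycleGraph_adj_indicator (hm : 1 ≤ m) (a b : Fin (m + 2)) :
    (if (SimpleGraph.cycleGraph (m + 2)).Adj a b then (1 : ℝ) else 0) =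
      (if ((m + 2 : ℕ) : ℤ) ∣ ((a : ℕ) : ℤ) - ((b : ℕ) : ℤ) - 1 then (1 : ℝ) else 0) +
      (if ((m + 2 : ℕ) : ℤ) ∣ ((a : ℕ) : ℤ) - ((b : ℕ) : ℤ) + 1 then (1 : ℝ) else 0) := by
  have h1 : (SimpleGraph.cycleGraph (m + 2)).Adj a b ↔
      ((m + 2 : ℕ) : ℤ) ∣ ((a : ℕ) : ℤ) - ((b : ℕ) : ℤ) - 1 ∨
        ((m + 2 : ℕ) : ℤ) ∣ ((a : ℕ) : ℤ) - ((b : ℕ) : ℤ) + 1 := by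
    rw [cycleGraph_adj_iff, fin_eq_add_one_iff_dvd, fin_eq_add_one_iff_dvd]
    have : ((b : ℕ) : ℤ) - ((a : ℕ) : ℤ) - 1 = -(((a : ℕ) : ℤ) - ((b : ℕ) : ℤ) + 1) := by ring
    rw [this, dvd_neg]
  have hboth : ¬ (((m + 2 : ℕ) : ℤ) ∣ ((a : ℕ) : ℤ) - ((b : ℕ) : ℤ) - 1 ∧
      ((m + 2 : ℕ) : ℤ) ∣ ((a : ℕ) : ℤ) - ((b : ℕ) : ℤ) + 1) := by
    rintro ⟨h1, h2⟩
    have h3 : ((m + 2 : ℕ) : ℤ) ∣ 2 := by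
      have := dvd_sub h2 h1
      rwa [show ((a : ℕ) : ℤ) - ((b : ℕ) : ℤ) + 1 - (((a : ℕ) : ℤ) - ((b : ℕ) : ℤ) - 1) = 2 by ring] at this
    have h4 := Int.le_of_dvd (by norm_num) h3
    push_cast at h4
    omega
  by_cases hA : ((m + 2 : ℕ) : ℤ) ∣ ((a : ℕ) : ℤ) - ((b : ℕ) : ℤ) - 1
  · have hB : ¬ ((m + 2 : ℕ) : ℤ) ∣ ((a : ℕ) : ℤ) - ((b : ℕ) : ℤ) + 1 := fun h => hboth ⟨hA, h⟩
    rw [if_pos (h1.mpr (Or.inl hA)), if_pos hA, if_neg hB, add_zero]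
  · by_cases hB : ((m + 2 : ℕ) : ℤ) ∣ ((a : ℕ) : ℤ) - ((b : ℕ) : ℤ) + 1
    · rw [if_pos (h1.mpr (Or.inr hB)), if_neg hA, if_pos hB, zero_add]
    · rw [if_neg (fun h => (h1.mp h).elim hA hB), if_neg hA, if_neg hB, add_zero]

/-- **Fourier form of `A(C_n) − λI`**: with `c_j = (2cos(2πj/n) − λ)/n`,
`(A − λI)_{ab} = Σ_j c_j (cos(2πja/n)cos(2πjb/n) + sin(2πja/n)sin(2πjb/n))` — the spectral
decomposition of the circulant `A(C_n)` (eigenvalues `2cos(2πj/n)`), written with real Fourier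
vectors. [cite: PrakashEtAl2017, Lemma 11 proof (p21, "`λ_t = 2cos(2πt/(2t+1))` with multiplicity 2")] -/
private theorem cycle_sub_smul_one_apply_eq_fourier (hm : 1 ≤ m) (lam : ℝ) (a b : Fin (m + 2)) :
    ((SimpleGraph.cycleGraph (m + 2)).adjMatrix ℝ - lam • (1 : Matrix (Fin (m + 2)) (Fin (m + 2)) ℝ)) a b =
      ∑ j : Fin (m + 2), (2 * Real.cos (2 * π * j / (m + 2 : ℕ)) - lam) / (m + 2 : ℕ) *
        (Real.cos (2 * π * j * a / (m + 2 : ℕ)) * Real.cos (2 * π * j * b / (m + 2 : ℕ)) +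
          Real.sin (2 * π * j * a / (m + 2 : ℕ)) * Real.sin (2 * π * j * b / (m + 2 : ℕ))) := by
  have hn1 : 1 ≤ m + 2 := by omega
  have hnR : ((m + 2 : ℕ) : ℝ) ≠ 0 := by positivity
  set M : ℤ := ((a : ℕ) : ℤ) - ((b : ℕ) : ℤ) with hM
  -- each summand is `c_j cos(2πjM/n)`, and `2cos(2πj/n)cos(2πjM/n) = cos(2πj(M+1)/n) + cos(2πj(M−1)/n)`
  have hterm : ∀ j : Fin (m + 2), (2 * Real.cos (2 * π * j / (m + 2 : ℕ)) - lam) / (m + 2 : ℕ) *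
      (Real.cos (2 * π * j * a / (m + 2 : ℕ)) * Real.cos (2 * π * j * b / (m + 2 : ℕ)) +
        Real.sin (2 * π * j * a / (m + 2 : ℕ)) * Real.sin (2 * π * j * b / (m + 2 : ℕ))) =
      (1 / (m + 2 : ℕ)) * (Real.cos (2 * π * j * ((M + 1 : ℤ)) / (m + 2 : ℕ)) +
          Real.cos (2 * π * j * ((M - 1 : ℤ)) / (m + 2 : ℕ))) -
        (lam / (m + 2 : ℕ)) * Real.cos (2 * π * j * M / (m + 2 : ℕ)) := by
    intro j
    have hcos : Real.cos (2 * π * j * a / (m + 2 : ℕ)) * Real.cos (2 * π * j * b / (m + 2 : ℕ)) +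
        Real.sin (2 * π * j * a / (m + 2 : ℕ)) * Real.sin (2 * π * j * b / (m + 2 : ℕ)) =
        Real.cos (2 * π * j * M / (m + 2 : ℕ)) := by
      rw [← Real.cos_sub, hM]
      congr 1
      push_cast
      try ring
    have hprod : 2 * Real.cos (2 * π * j / (m + 2 : ℕ)) * Real.cos (2 * π * j * M / (m + 2 : ℕ)) =
        Real.cos (2 * π * j * ((M + 1 : ℤ)) / (m + 2 : ℕ)) +
          Real.cos (2 * π * j * ((M - 1 : ℤ)) / (m + 2 : ℕ)) := by
      have e1 : (2 * π * j * ((M + 1 : ℤ)) / (m + 2 : ℕ) : ℝ) =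
          2 * π * j * M / (m + 2 : ℕ) + 2 * π * j / (m + 2 : ℕ) := by
        push_cast; ring
      have e2 : (2 * π * j * ((M - 1 : ℤ)) / (m + 2 : ℕ) : ℝ) =
          2 * π * j * M / (m + 2 : ℕ) - 2 * π * j / (m + 2 : ℕ) := by
        push_cast; ring
      rw [e1, e2, Real.cos_add, Real.cos_sub]
      ring
    rw [hcos, ← hprod]
    field_simp
    try ring
  rw [Finset.sum_congr rfl fun j _ => hterm j, Finset.sum_sub_distrib, ← Finset.mul_sum, ← Finset.mul_sum,
    Finset.sum_add_distrib, sum_cos_two_pi_mul_int_div hn1, sum_cos_two_pi_mul_int_div hn1,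
    sum_cos_two_pi_mul_int_div hn1]
  -- the matrix entry
  have hone : (if a = b then (1 : ℝ) else 0) = if ((m + 2 : ℕ) : ℤ) ∣ M then 1 else 0 := by
    by_cases hab : a = b
    · rw [if_pos hab, if_pos ((fin_eq_iff_dvd a b).mp hab)]
    · rw [if_neg hab, if_neg (fun h => hab ((fin_eq_iff_dvd a b).mpr h))]
  rw [Matrix.sub_apply, Matrix.smul_apply, Matrix.one_apply, SimpleGraph.adjMatrix_apply, smul_eq_mul,
    cycleGraph_adj_indicator hm, hone]
  have e3 : ((a : ℕ) : ℤ) - ((b : ℕ) : ℤ) + 1 = M + 1 := by rw [hM]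
  have e4 : ((a : ℕ) : ℤ) - ((b : ℕ) : ℤ) - 1 = M - 1 := by rw [hM]
  rw [e3, e4]
  split_ifs <;> field_simp <;> ring

/-- The Fourier coefficients are nonnegative: `cos(2πj/n) ≥ cos(2πt/n)` for `n = 2t+1` and every
`j` (the least eigenvalue of `C_{2t+1}` is `λ_t = 2cos(2πt/(2t+1))`). [cite: PrakashEtAl2017, Lemma 11 (p20)] -/
private theorem cos_le_cos_of_cycle (t : ℕ) (hm : m + 2 = 2 * t + 1) (j : Fin (m + 2)) :
    Real.cos (2 * π * t / (m + 2 : ℕ)) ≤ Real.cos (2 * π * j / (m + 2 : ℕ)) := by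
  have hnpos : (0 : ℝ) < (m + 2 : ℕ) := by positivity
  have hθle : 2 * π * t / (m + 2 : ℕ) ≤ π := by
    rw [div_le_iff₀ hnpos]
    have : (t : ℝ) * 2 ≤ (m + 2 : ℕ) := by exact_mod_cast (by omega : t * 2 ≤ m + 2)
    nlinarith [Real.pi_pos]
  by_cases hj : (j : ℕ) ≤ t
  · apply Real.cos_le_cos_of_nonneg_of_le_pi _ hθle
    · have : (j : ℝ) ≤ t := by exact_mod_cast hj
      exact div_le_div_of_nonneg_right (by nlinarith [Real.pi_pos]) hnpos.le
    · positivity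
  · -- `cos(2πj/n) = cos(2π(n−j)/n)` with `n − j ≤ t`
    have hjlt : (j : ℕ) < m + 2 := j.isLt
    have hnj : m + 2 - (j : ℕ) ≤ t := by omega
    have e : Real.cos (2 * π * j / (m + 2 : ℕ)) = Real.cos (2 * π * ((m + 2 - (j : ℕ) : ℕ)) / (m + 2 : ℕ)) := by
      rw [← Real.cos_two_pi_sub]
      congr 1
      rw [Nat.cast_sub hjlt.le]
      field_simp
      try ring
    rw [e]
    apply Real.cos_le_cos_of_nonneg_of_le_pi _ hθle
    · have : ((m + 2 - (j : ℕ) : ℕ) : ℝ) ≤ t := by exact_mod_cast hnj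
      exact div_le_div_of_nonneg_right (by nlinarith [Real.pi_pos]) hnpos.le
    · positivity

/-- **`A(C_{2t+1}) − λ_t I ⪰ 0`**: by the Fourier form it is a nonnegative combination of the rank-`≤ 2`
psd matrices `c_jc_jᵀ + s_js_jᵀ`. [cite: PrakashEtAl2017, Lemma 11 (p20–p21)] -/
private theorem posSemidef_cycle_sub (hm : 1 ≤ m) (t : ℕ) (ht : m + 2 = 2 * t + 1) :
    ((SimpleGraph.cycleGraph (m + 2)).adjMatrix ℝ -
      (2 * Real.cos (2 * π * t / (m + 2 : ℕ))) • (1 : Matrix (Fin (m + 2)) (Fin (m + 2)) ℝ)).PosSemidef := by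
  set lam : ℝ := 2 * Real.cos (2 * π * t / (m + 2 : ℕ)) with hlam
  set cs : Fin (m + 2) → Fin (m + 2) → ℝ := fun j a => Real.cos (2 * π * j * a / (m + 2 : ℕ)) with hcs
  set sn : Fin (m + 2) → Fin (m + 2) → ℝ := fun j a => Real.sin (2 * π * j * a / (m + 2 : ℕ)) with hsn
  have hX : (SimpleGraph.cycleGraph (m + 2)).adjMatrix ℝ - lam • (1 : Matrix (Fin (m + 2)) (Fin (m + 2)) ℝ) =
      ∑ j : Fin (m + 2), ((2 * Real.cos (2 * π * j / (m + 2 : ℕ)) - lam) / (m + 2 : ℕ)) •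
        (vecMulVec (cs j) (cs j) + vecMulVec (sn j) (sn j)) := by
    ext a b
    rw [cycle_sub_smul_one_apply_eq_fourier hm lam a b, Matrix.sum_apply]
    refine sum_congr rfl fun j _ => ?_
    simp only [hcs, hsn, Matrix.smul_apply, Matrix.add_apply, vecMulVec_apply, smul_eq_mul]
  rw [hX]
  refine posSemidef_sum _ fun j _ => PosSemidef.smul ?_ ?_
  · have h1 : (vecMulVec (cs j) (cs j)).PosSemidef := by
      simpa using posSemidef_vecMulVec_self_star (cs j)
    have h2 : (vecMulVec (sn j) (sn j)).PosSemidef := by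
      simpa using posSemidef_vecMulVec_self_star (sn j)
    exact h1.add h2
  · exact div_nonneg (by linarith [cos_le_cos_of_cycle t ht j]) (by positivity)

/-! #### Kernel vectors `k ↦ sin(θk + φ)` and the special entries -/

/-- `(A(C_n) w)_v = w_{v−1} + w_{v+1}` for `n ≥ 3`. [folklore] -/
private theorem cycle_adjMatrix_mulVec (hm : 1 ≤ m) (w : Fin (m + 2) → ℝ) (v : Fin (m + 2)) :
    ((SimpleGraph.cycleGraph (m + 2)).adjMatrix ℝ *ᵥ w) v = w (v - 1) + w (v + 1) := by
  rw [SimpleGraph.adjMatrix_mulVec_apply, SimpleGraph.cycleGraph_neighborFinset, Finset.sum_pair]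
  intro h
  have h2 : (1 : Fin (m + 2)) + 1 = 0 := by linear_combination (-1 : Fin (m + 2)) * h
  have h3 := congrArg Fin.val h2
  rw [Fin.val_add, Fin.val_one, Fin.val_zero, Nat.mod_eq_of_lt (by omega)] at h3
  omega

/-- For `θ` with `θ·n ∈ 2πℤ`, the vector `k ↦ sin(θk + φ)` is an eigenvector of `A(C_n)` for `2cos θ`,
i.e. lies in the kernel of `A(C_n) − 2cos θ·I` ("`λ_t … with multiplicity 2`", p21). [cite: PrakashEtAl2017, Lemma 11 proof (p21)] -/
private theorem cycle_sub_mulVec_sin (hm : 1 ≤ m) (θ φ : ℝ) (t : ℕ) (hθ : θ * (m + 2 : ℕ) = 2 * π * t) :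
    ((SimpleGraph.cycleGraph (m + 2)).adjMatrix ℝ -
        (2 * Real.cos θ) • (1 : Matrix (Fin (m + 2)) (Fin (m + 2)) ℝ)) *ᵥ
      (fun k : Fin (m + 2) => Real.sin (θ * k + φ)) = 0 := by
  -- the periodic extension `g(x) = sin(θx + φ)`, `g(x + n) = g(x)`
  set g : ℝ → ℝ := fun x => Real.sin (θ * x + φ) with hg
  have hper : ∀ x, g (x + (m + 2 : ℕ)) = g x := by
    intro x
    simp only [hg]
    rw [mul_add, hθ, show θ * x + 2 * π * t + φ = θ * x + φ + t * (2 * π) by ring,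
      Real.sin_add_nat_mul_two_pi]
  have hsucc : ∀ v : Fin (m + 2), g ((v + 1 : Fin (m + 2)) : ℕ) = g ((v : ℕ) + 1) := by
    intro v
    rw [Fin.val_add_one]
    split_ifs with hv
    · rw [hv, Fin.val_last, ← hper ((0 : ℕ) : ℝ)]
      congr 1
      push_cast
      ring
    · push_cast
      rfl
  have hpred : ∀ v : Fin (m + 2), g ((v - 1 : Fin (m + 2)) : ℕ) = g ((v : ℕ) - 1) := by
    intro v
    rw [Fin.coe_sub_one]
    split_ifs with hv
    · rw [hv, Fin.val_zero, ← hper (((0 : ℕ) : ℝ) - 1)]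
      congr 1
      push_cast
      ring
    · have h1 : 1 ≤ (v : ℕ) := by
        rcases Nat.eq_zero_or_pos (v : ℕ) with h | h
        · exact absurd (Fin.ext h) hv
        · exact h
      rw [Nat.cast_sub h1, Nat.cast_one]
  ext v
  rw [sub_mulVec, Pi.sub_apply, cycle_adjMatrix_mulVec hm, smul_mulVec, one_mulVec, Pi.zero_apply,
    Pi.smul_apply, smul_eq_mul]
  have e1 : Real.sin (θ * ((v - 1 : Fin (m + 2)) : ℕ) + φ) = g ((v : ℕ) - 1) := hpred v
  have e2 : Real.sin (θ * ((v + 1 : Fin (m + 2)) : ℕ) + φ) = g ((v : ℕ) + 1) := hsucc v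
  rw [e1, e2]
  simp only [hg]
  have key : ∀ U : ℝ, Real.sin (U - θ) + Real.sin (U + θ) - 2 * Real.cos θ * Real.sin U = 0 := by
    intro U
    rw [Real.sin_sub, Real.sin_add]
    ring
  have e3 : θ * ((v : ℕ) - 1 : ℝ) + φ = (θ * ((v : ℕ) : ℝ) + φ) - θ := by ring
  have e4 : θ * ((v : ℕ) + 1 : ℝ) + φ = (θ * ((v : ℕ) : ℝ) + φ) + θ := by ring
  rw [e3, e4]
  linarith [key (θ * ((v : ℕ) : ℝ) + φ)]

/-! #### The core statement on `Fin (m + 2)` and the discharge -/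

/-- **PSVW Lemma 11 on `Fin (m+2)`, `m + 2 = 2t + 1`, `t ≥ 2`.** DNN: entries `A_{ab} ≥ 0` off the
diagonal and `−λ_t > 0` on it; psd by `posSemidef_cycle_sub`. Not cpsd: Theorem 17 for `M_d(ℂ)`
(`HasCpsdFactorization.exists_row_eq_mul_row`) with `i* = 0`, `j* = 1`, kernel vectors
`w_k = sin(θ(k − 2))` (vanishing at `2`, the other neighbour of `1`) and `w'_k = sin(θ(k + 1))`
(vanishing at `n − 1`, the other neighbour of `0`), `θ = 2πt/n`, gives rows `0, 1` proportional, i.e.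
`det X[{0,1}] = λ_t² − 1 = 0`; but `λ_t < −1` for `t ≥ 2` ((iv) of the printed proof).
[cite: PrakashEtAl2017, Lemma 11 (p20–p21), Thm. 17 (p20)] -/
private theorem lemma11_core (m t : ℕ) (ht : 2 ≤ t) (hm : m + 2 = 2 * t + 1) :
    IsDnn ((SimpleGraph.cycleGraph (m + 2)).adjMatrix ℝ -
        (2 * Real.cos (2 * Real.pi * t / (2 * t + 1))) • (1 : Matrix (Fin (m + 2)) (Fin (m + 2)) ℝ)) ∧
    ¬ IsCpsd ((SimpleGraph.cycleGraph (m + 2)).adjMatrix ℝ -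
        (2 * Real.cos (2 * Real.pi * t / (2 * t + 1))) • (1 : Matrix (Fin (m + 2)) (Fin (m + 2)) ℝ)) := by
  classical
  have hm1 : 1 ≤ m := by omega
  have hnR : ((m + 2 : ℕ) : ℝ) = 2 * t + 1 := by exact_mod_cast hm
  set θ : ℝ := 2 * Real.pi * t / (2 * t + 1) with hθ
  have hθ' : θ = 2 * π * t / (m + 2 : ℕ) := by rw [hθ, hnR]
  have hnpos : (0 : ℝ) < 2 * t + 1 := by positivity
  have hθn : θ * (m + 2 : ℕ) = 2 * π * t := by rw [hnR, hθ, div_mul_cancel₀ _ hnpos.ne']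
  -- `θ = π − π/n`, so `2π/3 < θ < π`, `λ = 2cos θ < −1`, `sin θ > 0`, `sin 2θ < 0`
  have hθeq : θ = π - π / (2 * t + 1) := by rw [hθ]; field_simp; ring
  have ht2 : (2 : ℝ) ≤ t := by exact_mod_cast ht
  have hθlt : θ < π := by
    rw [hθeq]
    have : 0 < π / (2 * t + 1) := div_pos Real.pi_pos hnpos
    linarith
  have hθgt : 2 * π / 3 < θ := by
    rw [hθeq, show 2 * π / 3 = π - π / 3 by ring]
    have : π / (2 * t + 1) < π / 3 := div_lt_div_of_pos_left Real.pi_pos (by norm_num) (by linarith)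
    linarith
  have hθpos : 0 < θ := by linarith [Real.pi_pos]
  set lam : ℝ := 2 * Real.cos θ with hlam
  have hlam_lt : lam < -1 := by
    have : Real.cos θ < Real.cos (2 * π / 3) :=
      Real.cos_lt_cos_of_nonneg_of_le_pi (by positivity) hθlt.le hθgt
    rw [show 2 * π / 3 = π - π / 3 by ring, Real.cos_pi_sub, Real.cos_pi_div_three] at this
    rw [hlam]
    linarith
  have hsinθ : Real.sin θ ≠ 0 := (Real.sin_pos_of_pos_of_lt_pi hθpos hθlt).ne'
  have hsin2θ : Real.sin (2 * θ) ≠ 0 := by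
    have h1 : Real.sin (2 * θ) = -Real.sin (2 * π / (2 * t + 1)) := by
      rw [hθeq, show 2 * (π - π / (2 * t + 1)) = -(2 * π / (2 * t + 1)) + (1 : ℕ) * (2 * π) by push_cast; ring,
        Real.sin_add_nat_mul_two_pi, Real.sin_neg]
    have h2 : 0 < Real.sin (2 * π / (2 * t + 1)) := by
      apply Real.sin_pos_of_pos_of_lt_pi (by positivity)
      rw [div_lt_iff₀ hnpos]
      nlinarith [Real.pi_pos]
    rw [h1]
    linarith
  set X : Matrix (Fin (m + 2)) (Fin (m + 2)) ℝ := (SimpleGraph.cycleGraph (m + 2)).adjMatrix ℝ -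
    lam • (1 : Matrix (Fin (m + 2)) (Fin (m + 2)) ℝ) with hXdef
  -- entries of `X`
  have hXapply : ∀ a b : Fin (m + 2), X a b =
      (if (SimpleGraph.cycleGraph (m + 2)).Adj a b then 1 else 0) - lam * (if a = b then 1 else 0) := by
    intro a b
    rw [hXdef, Matrix.sub_apply, Matrix.smul_apply, Matrix.one_apply, SimpleGraph.adjMatrix_apply,
      smul_eq_mul]
  have hXdiag : ∀ a : Fin (m + 2), X a a = -lam := by
    intro a
    rw [hXapply, if_neg (SimpleGraph.irrefl _), if_pos rfl]
    ring
  have hXoff : ∀ a b : Fin (m + 2), a ≠ b → ¬ (SimpleGraph.cycleGraph (m + 2)).Adj a b → X a b = 0 := by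
    intro a b hab hadj
    rw [hXapply, if_neg hadj, if_neg hab]
    ring
  have h01 : (SimpleGraph.cycleGraph (m + 2)).Adj 0 1 := by
    rw [cycleGraph_adj_iff]
    exact Or.inr (by ring)
  have h10ne : (1 : Fin (m + 2)) ≠ 0 := by
    intro h
    have := congrArg Fin.val h
    rw [Fin.val_one, Fin.val_zero] at this
    omega
  have hX01 : X 0 1 = 1 := by
    rw [hXapply, if_pos h01, if_neg h10ne.symm]
    ring
  have hX10 : X 1 0 = 1 := by
    rw [hXapply, if_pos h01.symm, if_neg h10ne]
    ring
  refine ⟨⟨?_, fun a b => ?_⟩, ?_⟩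
  · -- psd
    have := posSemidef_cycle_sub hm1 t hm
    rwa [← hθ'] at this
  · -- entrywise nonnegative
    rw [hXapply]
    split_ifs <;> linarith
  · -- not cpsd: Theorem 17
    rintro ⟨d, hXd⟩
    -- kernel vectors
    have hw : X *ᵥ (fun k : Fin (m + 2) => Real.sin (θ * k + -(2 * θ))) = 0 :=
      cycle_sub_mulVec_sin hm1 θ (-(2 * θ)) t hθn
    have hw' : X *ᵥ (fun k : Fin (m + 2) => Real.sin (θ * k + θ)) = 0 :=
      cycle_sub_mulVec_sin hm1 θ θ t hθn
    have h2val : ((1 + 1 : Fin (m + 2)) : ℕ) = 2 := by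
      rw [Fin.val_add, Fin.val_one, Nat.mod_eq_of_lt (by omega)]
    obtain ⟨c, hc, hrow⟩ := HasCpsdFactorization.exists_row_eq_mul_row hXd (i := 0) (j := 1) hw hw'
      (by -- `w_0 = sin(−2θ) ≠ 0`
        simp only [Fin.val_zero, Nat.cast_zero, mul_zero, zero_add, Real.sin_neg, neg_ne_zero]
        exact hsin2θ)
      (by -- `w'_1 = sin(2θ) ≠ 0`
        simp only [Fin.val_one, Nat.cast_one, mul_one, show θ + θ = 2 * θ by ring]
        exact hsin2θ)
      (by -- other indices: `a = 2` has `w_2 = 0`, else `1 ≁ a`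
        intro a ha0 ha1
        by_cases ha2 : a = 1 + 1
        · left
          show Real.sin (θ * ((a : ℕ) : ℝ) + -(2 * θ)) = 0
          rw [ha2, h2val, show θ * ((2 : ℕ) : ℝ) + -(2 * θ) = 0 by push_cast; ring, Real.sin_zero]
        · right
          refine hXoff 1 a (Ne.symm ha1) fun hadj => ?_
          rw [cycleGraph_adj_iff] at hadj
          rcases hadj with h | h
          · exact ha0 (by linear_combination (-1 : Fin (m + 2)) * h)
          · exact ha2 h)
      (by -- other indices: `a = −1` has `w'_a = sin(θn) = 0`, else `a ≁ 0`
        intro a ha0 ha1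
        by_cases ha2 : a = -1
        · left
          show Real.sin (θ * ((a : ℕ) : ℝ) + θ) = 0
          rw [ha2, Fin.coe_neg_one, show θ * ((m + 1 : ℕ) : ℝ) + θ = θ * ((m + 2 : ℕ) : ℝ) by push_cast; ring,
            hθn, show 2 * π * (t : ℝ) = ((2 * t : ℕ) : ℝ) * π by push_cast; ring, Real.sin_nat_mul_pi]
        · right
          refine hXoff a 0 ha0 fun hadj => ?_
          rw [cycleGraph_adj_iff] at hadj
          rcases hadj with h | h
          · exact ha1 (by rw [h, zero_add])
          · exact ha2 (by linear_combination (-1 : Fin (m + 2)) * h))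
      (by rw [hX01]; exact one_ne_zero)
    -- rows `0` and `1` proportional: `1 = c(−λ)` and `−λ = c`, so `λ² = 1`
    have h0 := hrow 0
    have h1 := hrow 1
    rw [hX10, hXdiag] at h0
    rw [hXdiag, hX01, mul_one] at h1
    rw [← h1] at h0
    nlinarith

/-- **Discharge of `PrakashEtAl2017_lemma11`** (Lemma 11: for `t ≥ 2` the matrix `A_t − λ_t I` of the odd
cycle `C_{2t+1}`, `λ_t = 2cos(2πt/(2t+1))` its least eigenvalue, is doubly nonnegative and not
completely positive semidefinite), from `lemma11_core` after writing `2t+1 = m+2`.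
[cite: PrakashEtAl2017, Lemma 11 (p20–p21), Remark 6.2 (p21)] -/
theorem PrakashEtAl2017_lemma11_holds : PrakashEtAl2017_lemma11 := by
  intro t ht
  obtain ⟨m, hm⟩ : ∃ m, 2 * t + 1 = m + 2 := ⟨2 * t - 1, by omega⟩
  rw [hm]
  exact lemma11_core m t ht hm.symm

end Lemma11

/-! ### Proposition 2: extreme points of the elliptope are extreme quantum correlations -/

/-- `𝓔_n ⊆ Cor(n,n)` (PSVW §5.2.2, p18: the elements of `Cor(n,n)` "whose diagonal entries are all
equal to 1 … coincide with the `n`-dimensional elliptope"; this is the inclusion `⊆`): a correlation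
matrix `X` (psd, unit diagonal) is `(⟨u_x, u_y⟩)` for unit vectors `u_x ∈ ℝ^{2n}` (Gram vectors of
`X = CᵀC`, padded by zeros). [cite: PrakashEtAl2017, §5.2.2 (p18) and Thm. 10 (iii) (p17)] -/
theorem exists_unit_gram_of_mem_elliptope {n : ℕ} {X : Matrix (Fin n) (Fin n) ℝ}
    (hX : X ∈ elliptope n) :
    ∃ u : Fin n → EuclideanSpace ℝ (Fin (n + n)),
      (∀ x, ‖u x‖ = 1) ∧ ∀ x y, X x y = inner ℝ (u x) (u y) := by
  classical
  obtain ⟨hpsd, hdiag⟩ := hX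
  obtain ⟨C, hC⟩ := CStarAlgebra.nonneg_iff_eq_star_mul_self.mp hpsd.nonneg
  have hCT : star C = Cᵀ := by
    rw [star_eq_conjTranspose, conjTranspose_eq_transpose_of_trivial]
  let u : Fin n → EuclideanSpace ℝ (Fin (n + n)) := fun x =>
    WithLp.toLp 2 (Fin.addCases (fun i : Fin n => C i x) (fun _ : Fin n => (0 : ℝ)))
  have hinner : ∀ x y, inner ℝ (u x) (u y) = X x y := fun x y => by
    rw [EuclideanSpace.inner_toLp_toLp, star_trivial, dotProduct, Fin.sum_univ_add, hC, hCT,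
      Matrix.mul_apply]
    simp only [Fin.addCases_left, Fin.addCases_right, mul_zero, Finset.sum_const_zero, add_zero,
      Matrix.transpose_apply]
    exact Finset.sum_congr rfl fun i _ => mul_comm _ _
  refine ⟨u, fun x => ?_, fun x y => (hinner x y).symm⟩
  have h : ‖u x‖ ^ 2 = 1 := by rw [← real_inner_self_eq_norm_sq, hinner, hdiag]
  nlinarith [norm_nonneg (u x)]

/-- Conversely (same passage, p18, proof of Proposition 2: "`1 = A_{ii} = ⟨u_i, v_i⟩ ≤ 1` … thus
`u_i = v_i` … and thus `A ∈ 𝓔_n`"): a quantum correlation `(⟨u_x, v_y⟩)` (unit vectors) with unit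
diagonal lies in the elliptope. [cite: PrakashEtAl2017, Prop. 2, proof (p18)] -/
theorem mem_elliptope_of_unit_gram_diag {n N : ℕ} {A : Matrix (Fin n) (Fin n) ℝ}
    (u v : Fin n → EuclideanSpace ℝ (Fin N)) (hu : ∀ x, ‖u x‖ = 1) (hv : ∀ y, ‖v y‖ = 1)
    (hA : ∀ x y, A x y = inner ℝ (u x) (v y)) (hdiag : ∀ x, A x x = 1) : A ∈ elliptope n := by
  classical
  have huv : ∀ x, u x = v x := fun x =>
    (inner_eq_one_iff_of_norm_eq_one (hu x) (hv x)).mp ((hA x x).symm.trans (hdiag x))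
  -- `A = Bᵀ B` with `B k x = (u x) k`
  let B : Matrix (Fin N) (Fin n) ℝ := Matrix.of fun k x => (u x : EuclideanSpace ℝ (Fin N)) k
  have hAB : A = Bᴴ * B := by
    ext x y
    rw [hA, ← huv y, conjTranspose_eq_transpose_of_trivial, Matrix.mul_apply,
      EuclideanSpace.inner_eq_star_dotProduct, star_trivial, dotProduct]
    exact Finset.sum_congr rfl fun k _ => mul_comm _ _
  refine ⟨?_, hdiag⟩
  rw [hAB]
  exact posSemidef_conjTranspose_mul_self B

/-- **PSVW Proposition 2** (p18, verbatim): "We have that `ext(𝓔_n) ⊆ ext(Cor(n,n))`." Here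
`Cor(n,n) = {(⟨u_x, v_y⟩)_{x,y} : u_x, v_y ∈ ℝ^{2n} unit vectors}` (Tsirelson, Theorem 10 (iii)), the
set in the hypothesis of `PrakashEtAl2017_thm11` with `m = n`. Printed proof: for
`X = λA + (1−λ)B` with `A, B ∈ Cor(n,n)`, the diagonal forces `A_{ii} = B_{ii} = 1` (entries of
`Cor` lie in `[−1,1]`), hence `A, B ∈ 𝓔_n` (`mem_elliptope_of_unit_gram_diag`), and extremality in
`𝓔_n` concludes; `X ∈ Cor(n,n)` by `exists_unit_gram_of_mem_elliptope`. One of the three inputs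
(with Theorems 11 and 2) of Theorem 16 (`PrakashEtAl2017_thm16`). [cite: PrakashEtAl2017, Prop. 2 (p18)] -/
theorem PrakashEtAl2017_prop2 {n : ℕ} {X : Matrix (Fin n) (Fin n) ℝ}
    (hX : X ∈ Set.extremePoints ℝ (elliptope n)) :
    X ∈ Set.extremePoints ℝ
      {C' : Matrix (Fin n) (Fin n) ℝ | ∃ (u : Fin n → EuclideanSpace ℝ (Fin (n + n)))
        (v : Fin n → EuclideanSpace ℝ (Fin (n + n))),
        (∀ x, ‖u x‖ = 1) ∧ (∀ y, ‖v y‖ = 1) ∧ ∀ x y, C' x y = inner ℝ (u x) (v y)} := by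
  rw [mem_extremePoints] at hX ⊢
  obtain ⟨hXE, hext⟩ := hX
  have hdiagX : ∀ x, X x x = 1 := hXE.2
  refine ⟨?_, fun A hA B hB hseg => ?_⟩
  · obtain ⟨u, hu, hXu⟩ := exists_unit_gram_of_mem_elliptope hXE
    exact ⟨u, u, hu, hu, hXu⟩
  obtain ⟨uA, vA, huA, hvA, hAuv⟩ := hA
  obtain ⟨uB, vB, huB, hvB, hBuv⟩ := hB
  -- entries of quantum correlations are at most `1`
  have hA1 : ∀ x, A x x ≤ 1 := fun x => by
    rw [hAuv]
    have := abs_real_inner_le_norm (uA x) (vA x)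
    rw [huA, hvA, mul_one] at this
    exact (le_abs_self _).trans this
  have hB1 : ∀ x, B x x ≤ 1 := fun x => by
    rw [hBuv]
    have := abs_real_inner_le_norm (uB x) (vB x)
    rw [huB, hvB, mul_one] at this
    exact (le_abs_self _).trans this
  -- the diagonal of `X = aA + bB` forces `A_xx = B_xx = 1`
  obtain ⟨a, b, ha, hb, hab, hXab⟩ := hseg
  have hdiag : ∀ x, A x x = 1 ∧ B x x = 1 := fun x => by
    have h := congrFun (congrFun hXab x) x
    simp only [Matrix.add_apply, Matrix.smul_apply, smul_eq_mul, hdiagX x] at h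
    constructor <;> nlinarith [hA1 x, hB1 x]
  have hAE : A ∈ elliptope n := mem_elliptope_of_unit_gram_diag uA vA huA hvA hAuv fun x => (hdiag x).1
  have hBE : B ∈ elliptope n := mem_elliptope_of_unit_gram_diag uB vB huB hvB hBuv fun x => (hdiag x).2
  exact hext A hAE B hBE ⟨a, b, ha, hb, hab, hXab⟩

end Literature.Combinatorics.Optimization
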